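import Literature.AlgebraicGeometry.Motives.HodgeThetaSubalgebraUnitaryOrthogonalChainPos
import Literature.AlgebraicGeometry.Motives.HodgeThetaSubalgebraUnitaryFortyOneFortyThreeGoodRankCores
import Literature.AlgebraicGeometry.Motives.HodgeThetaSubalgebraUnitaryThirtyFourThirtyNineCorePart1
import Literature.AlgebraicGeometry.Motives.HodgeThetaSubalgebraUnitaryThirtyNineFortyCorePart1
import Literature.AlgebraicGeometry.Motives.HodgeThetaSubalgebraUnitaryThirtyNineFortyCorePart2
import Literature.AlgebraicGeometry.Motives.HodgeThetaSubalgebraUnitaryThirtyNineFortyCorePart3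
import Literature.AlgebraicGeometry.Motives.HodgeThetaSubalgebraUnitaryThirtyThreeThirtyFourCorePart1
import Literature.AlgebraicGeometry.Motives.HodgeThetaSubalgebraUnitaryThirtyTwoThirtyNineCorePart1
import Literature.AlgebraicGeometry.Motives.HodgeThetaSubalgebraUnitaryTwentyEightThirtyNineCorePart1
import Literature.AlgebraicGeometry.Motives.HodgeThetaSubalgebraUnitaryThirtyNineFortyFourCorePart1
import HarnessLib
import Literature.AlgebraicGeometry.Motives.HodgeThetaSubalgebraUnitaryConstantRankLeviThree
import Literature.AlgebraicGeometry.Motives.HodgeThetaSubalgebraUnitaryEightCore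
import Literature.AlgebraicGeometry.Motives.HodgeThetaSubalgebraUnitaryEightFifteenCore
import Literature.AlgebraicGeometry.Motives.HodgeThetaSubalgebraUnitaryEightNineCore
import Literature.AlgebraicGeometry.Motives.HodgeThetaSubalgebraUnitaryEightTwentyOneCore
import Literature.AlgebraicGeometry.Motives.HodgeThetaSubalgebraUnitaryFiveCoreAll
import Literature.AlgebraicGeometry.Motives.HodgeThetaSubalgebraUnitaryFourOddCore
import Literature.AlgebraicGeometry.Motives.HodgeThetaSubalgebraUnitaryFourteenFifteenCore
import Literature.AlgebraicGeometry.Motives.HodgeThetaSubalgebraUnitaryHighRankPrune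
import Literature.AlgebraicGeometry.Motives.HodgeThetaSubalgebraUnitaryNineElevenCore
import Literature.AlgebraicGeometry.Motives.HodgeThetaSubalgebraUnitaryNineFourteenCore
import Literature.AlgebraicGeometry.Motives.HodgeThetaSubalgebraUnitaryNineTwentyCore
import Literature.AlgebraicGeometry.Motives.HodgeThetaSubalgebraUnitaryNineTwentyThreeCore
import Literature.AlgebraicGeometry.Motives.HodgeThetaSubalgebraUnitaryRankOneRaise
import Literature.AlgebraicGeometry.Motives.HodgeThetaSubalgebraUnitarySeventeenCore
import Literature.AlgebraicGeometry.Motives.HodgeThetaSubalgebraUnitarySixSevenCoreAll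
import Literature.AlgebraicGeometry.Motives.HodgeThetaSubalgebraUnitaryTenNineteenCore
import Literature.AlgebraicGeometry.Motives.HodgeThetaSubalgebraUnitaryTenTwentyThreeCore
import Literature.AlgebraicGeometry.Motives.HodgeThetaSubalgebraUnitaryThreeCoprimeCore
import Literature.AlgebraicGeometry.Motives.HodgeThetaSubalgebraUnitaryTwelveThirteenCore
import Literature.AlgebraicGeometry.Motives.HodgeThetaSubalgebraUnitaryTwoOddCore

/-!
# (Part 2 of 5 — lemmas) The `Θ`-subalgebra theorem for unitary multiplicities `(39, 44)` — a `p = 83` cell by minimal-rank base points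
# and sub-Levi recursion (Ribet 1983 Thm. 3, Lie step; abelian 83-folds of type `(39, 44)`)

Family `hodge`, layer `Literature/AlgebraicGeometry/Motives` (pure linear algebra over `ℂ`; no geometry). Research
context: cell `pub-hodge-ring2` (HONEST FRAMING: research route conditional on HC_CM; not a corollary; Q11.4-sentence-2
already refuted in dim ≥ 3), Literature lane gen 89. UNCONDITIONAL; theorems only, no definition, no named fact
(D-0026), no `sorry`.

THE PRINT. K. A. Ribet, Amer. J. Math. 105 (1983), Thm. 3 = Gordon's survey Thm. 6.3 (3) [held
`paper:arxiv-alg-geom_9709030` p. 18]. THE METHOD: `HodgeThetaSubalgebraUnitarySixteenTwentyOneCore` (a raising operator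
`B` of MINIMAL non-zero rank `m`, the profile dichotomy `i + j ≤ m` or `i, j ≥ m`, tree cores making a Levi algebra full
or killing a Levi rank, lifts `UnitaryRaisingSpace.exists_raise_finrank_range_eq` + `UnitaryLeviSetup.exists_lift`, two
pencils `UnitaryGenericRank.exists_finrank_le_and_finrank_le`, the non-vanishing lemma
`UnitaryLeviFull.exists_raise_commute_apply_ne_zero`, TOOL C `UnitaryConstantRank.exists_raise_rank_ne_two`, TOOL F
`UnitaryConstantRank.false_of_le_rank`), the full-rank chain `UnitaryConstantRank.dvd_of_rank_eq_finrank`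
(`HodgeThetaSubalgebraUnitaryNineTwentyEightCore`) and TOOL G `UnitaryOrthogonalChain.false_of_constProfile`.

THIS PART FILE holds minimal-rank lemmas of the cell (the gate caps a proposal at 200 kB); the core theorem `UnitaryThirtyNineFortyFour.eq_top_of_smul` is assembled in `HodgeThetaSubalgebraUnitaryThirtyNineFortyFourCore`.

THE CELL `(39 | 44)`. Good ranks 1, 3, 5, 7, 9, 13, 31, 35, 37, 39 (Levi types `(1|43)`, `(3|41)`, `(5|39)`, `(7|37)`, `(9|35)`, `(13|31)`, `(31|13)`, `(35|9)`, `(37|7)`, `(39|5)` are tree cores); a proper `𝔊` has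
raising ranks in `{0, 2, 4, 6, 8, 10, 11, 12, 14, 15, 16, 17, 18, 19, 20, 21, 22, 23, 24, 25, 26, 27, 28, 29, 30, 32, 33, 34, 36, 38}`; `m` minimal non-zero, `B` of rank `m`; a commuting raising `X` has profile
`(i, j)` (`i + j` a raising rank, `i + j ≤ m` or `i, j ≥ m`). SUB-LEVI RECURSION: when the non-zero profiles are constantly
`(i, j)`, the Levi algebra `L⁺` (resp. `L⁻`) is a `Θ`-algebra whose non-zero raising ranks are all `i` (resp. `j`), and the
same minimal-rank analysis applies to it (the `sub…` lemmas of §1).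
* `m = 2` (`U⁺` of type `(37 | 2)`, `U⁻` of type `(2 | 42)`): `L⁺` of type `(37 | 2)` is full and a lift with `i = 1` has `j ∈ {1}`, killed in `L⁻` (type `(2 | 42)`).
* `m = 4` (`U⁺` of type `(35 | 4)`, `U⁻` of type `(4 | 40)`): `L⁺` of type `(35 | 4)` is full and a lift with `i = 1` has `j ∈ {3}`, killed in `L⁻` (type `(4 | 40)`).
* `m = 6` (`U⁺` of type `(33 | 6)`, `U⁻` of type `(6 | 38)`): after the Levi kills the profiles are [(0, 0), (0, 6), (6, 0), (6, 6)], so `L⁺` (type `(33 | 6)`) is a `Θ`-algebra with non-zero raising ranks in `{6}` — impossible by the sub-Levi lemmas.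
* `m = 8` (`U⁺` of type `(31 | 8)`, `U⁻` of type `(8 | 36)`): after the Levi kills every profile has `i = 0` (profiles [(0, 0), (0, 8)]), against the non-vanishing lemma.
* `m = 10` (`U⁺` of type `(29 | 10)`, `U⁻` of type `(10 | 34)`): after the Levi kills every profile has `i = 0` (profiles [(0, 0), (0, 10)]), against the non-vanishing lemma.
* `m = 11` (`U⁺` of type `(28 | 11)`, `U⁻` of type `(11 | 33)`): `L⁺` of type `(28 | 11)` is full and a lift with `i = 1` has `j ∈ {10}`, killed in `L⁻` (type `(11 | 33)`).
* `m = 12` (`U⁺` of type `(27 | 12)`, `U⁻` of type `(12 | 32)`): after the Levi kills the profiles are [(0, 0), (0, 12), (6, 6), (12, 0), (12, 12)], so `L⁺` (type `(27 | 12)`) is a `Θ`-algebra with non-zero raising ranks in `{6, 12}` — impossible by the sub-Levi lemmas.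
* `m = 14` (`U⁺` of type `(25 | 14)`, `U⁻` of type `(14 | 30)`): the non-zero profiles [(0, 14), (5, 9), (9, 5), (10, 4)] are pairwise exclusive, so constant; `(5, 9)`: `L⁺` (type `(25 | 14)`) has constant rank `5`; `(9, 5)`: `L⁺` (type `(25 | 14)`) has constant rank `9`; `(10, 4)`: `L⁺` (type `(25 | 14)`) has constant rank `10`.
* `m = 15` (`U⁺` of type `(24 | 15)`, `U⁻` of type `(15 | 29)`): after the Levi kills every profile has `i = 0` (profiles [(0, 0)]), against the non-vanishing lemma.
* `m = 16` (`U⁺` of type `(23 | 16)`, `U⁻` of type `(16 | 28)`): after the Levi kills every profile has `i = 0` (profiles [(0, 0), (0, 16)]), against the non-vanishing lemma.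
* `m = 17` (`U⁺` of type `(22 | 17)`, `U⁻` of type `(17 | 27)`): the non-zero profiles [(2, 15), (8, 9), (11, 6), (14, 3)] are pairwise exclusive, so constant; `(2, 15)`: TOOL C on `L⁺`; `(8, 9)`: `L⁺` (type `(22 | 17)`) has constant rank `8`; `(11, 6)`: `L⁺` (type `(22 | 17)`) has constant rank `11`; `(14, 3)`: TOOL G.
* `m = 18` (`U⁺` of type `(21 | 18)`, `U⁻` of type `(18 | 26)`): the ranks [33, 34, 36, 38] are pruned first (a raising operator of such a rank `r` has Levi pieces with `min(39 − r, r) + min(r, 44 − r) < 18`, `UnitaryRankPrune.rank_ne`), leaving raising ranks in `{0, 18, 19, 20, 21, 22, 23, 24, 25, 26, 27, 28, 29, 30, 32}`; then the non-zero profiles [(0, 18), (6, 12), (12, 6), (14, 4), (18, 0)] are pairwise exclusive, so constant; `(6, 12)`: `L⁺` (type `(21 | 18)`) has constant rank `6`; `(12, 6)`: `L⁺` (type `(21 | 18)`) has constant rank `12`; `(14, 4)`: TOOL G; `(18, 0)`: `L⁻` would kill `Q ∩ ker B`.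
* `m = 19` (`U⁺` of type `(20 | 19)`, `U⁻` of type `(19 | 25)`): the non-zero profiles [(4, 15), (10, 9), (14, 5)] are pairwise exclusive, so constant; `(4, 15)`: `L⁺` (type `(20 | 19)`) has constant rank `4`; `(10, 9)`: `L⁺` (type `(20 | 19)`) has constant rank `10`; `(14, 5)`: TOOL G.
* `m = 20` (`U⁺` of type `(19 | 20)`, `U⁻` of type `(20 | 24)`): the non-zero profiles [(0, 20), (2, 18), (4, 16), (5, 15), (6, 14), (8, 12), (10, 10), (12, 8), (14, 6), (16, 4), (18, 2)] are pairwise exclusive, so constant; `(2, 18)`: TOOL C on `L⁺`; `(4, 16)`: `L⁺` (type `(19 | 20)`) has constant rank `4`; `(5, 15)`: `L⁺` (type `(19 | 20)`) has constant rank `5`; `(6, 14)`: `L⁺` (type `(19 | 20)`) has constant rank `6`; `(8, 12)`: `L⁺` (type `(19 | 20)`) has constant rank `8`; `(10, 10)`: `L⁺` (type `(19 | 20)`) has constant rank `10`; `(12, 8)`: `L⁺` (type `(19 | 20)`) has constant rank `12`; `(14, 6)`: TOOL G; `(16, 4)`: TOOL G; `(18, 2)`: TOOL C on `L⁻`.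
* `m = 21` (`U⁺` of type `(18 | 21)`, `U⁻` of type `(21 | 23)`): after the Levi kills every profile has `i = 0` (profiles [(0, 0)]), against the non-vanishing lemma.
* `m = 22` (`U⁺` of type `(17 | 22)`, `U⁻` of type `(22 | 22)`): the non-zero profiles [(0, 22), (1, 21), (2, 20), (3, 19), (4, 18), (5, 17), (6, 16), (7, 15), (8, 14), (9, 13), (10, 12), (11, 11), (12, 10), (13, 9), (14, 8), (15, 7), (16, 6), (17, 5)] are pairwise exclusive, so constant; `(1, 21)`: `L⁺` (type `(17 | 22)`) has constant rank `1`; `(2, 20)`: TOOL C on `L⁺`; `(3, 19)`: `L⁺` (type `(17 | 22)`) has constant rank `3`; `(4, 18)`: `L⁺` (type `(17 | 22)`) has constant rank `4`; `(5, 17)`: `L⁺` (type `(17 | 22)`) has constant rank `5`; `(6, 16)`: `L⁺` (type `(17 | 22)`) has constant rank `6`; `(7, 15)`: `L⁺` (type `(17 | 22)`) has constant rank `7`; `(8, 14)`: `L⁺` (type `(17 | 22)`) has constant rank `8`; `(9, 13)`: `L⁺` (type `(17 | 22)`) has constant rank `9`; `(10, 12)`: `L⁺` (type `(17 | 22)`)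 has constant rank `10`; `(11, 11)`: `L⁺` (type `(17 | 22)`) has constant rank `11`; `(12, 10)`: `L⁺` (type `(17 | 22)`) has constant rank `12`; `(13, 9)`: TOOL G; `(14, 8)`: TOOL G; `(15, 7)`: TOOL G; `(16, 6)`: TOOL G; `(17, 5)`: TOOL G.
* `m = 23` (`U⁺` of type `(16 | 23)`, `U⁻` of type `(23 | 21)`): after the Levi kills every profile has `i = 0` (profiles [(0, 0)]), against the non-vanishing lemma.
* `m = 24` (`U⁺` of type `(15 | 24)`, `U⁻` of type `(24 | 20)`): the non-zero profiles [(4, 20), (6, 18), (8, 16), (9, 15), (10, 14), (12, 12), (14, 10), (15, 9)] are pairwise exclusive, so constant; `(4, 20)`: `L⁺` (type `(15 | 24)`) has constant rank `4`; `(6, 18)`: `L⁺` (type `(15 | 24)`) has constant rank `6`; `(8, 16)`: `L⁺` (type `(15 | 24)`) has constant rank `8`; `(9, 15)`: `L⁺` (type `(15 | 24)`) has constant rank `9`; `(10, 14)`: `L⁺` (type `(15 | 24)`) has constant rank `10`; `(12, 12)`: TOOL G; `(14, 10)`: TOOL G; `(15, 9)`: TOOL G.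
* `m = 25` (`U⁺` of type `(14 | 25)`, `U⁻` of type `(25 | 19)`): the non-zero profiles [(9, 16)] are pairwise exclusive, so constant; `(9, 16)`: `L⁺` (type `(14 | 25)`) has constant rank `9`.
* `m = 26` (`U⁺` of type `(13 | 26)`, `U⁻` of type `(26 | 18)`): the non-zero profiles [(8, 18), (10, 16), (12, 14), (13, 13)] are pairwise exclusive, so constant; `(8, 18)`: `L⁺` (type `(13 | 26)`) has constant rank `8`; `(10, 16)`: `L⁺` (type `(13 | 26)`) has constant rank `10`; `(12, 14)`: TOOL G; `(13, 13)`: TOOL G.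
* `m = 27` (`U⁺` of type `(12 | 27)`, `U⁻` of type `(27 | 17)`): after the Levi kills every profile has `i = 0` (profiles [(0, 0)]), against the non-vanishing lemma.
* `m = 28` (`U⁺` of type `(11 | 28)`, `U⁻` of type `(28 | 16)`): `L⁺` of type `(11 | 28)` is full and a lift with `i = 1` has no feasible `j`.
* `m = 29` (`U⁺` of type `(10 | 29)`, `U⁻` of type `(29 | 15)`): after the Levi kills every profile has `i = 0` (profiles [(0, 0)]), against the non-vanishing lemma.
* `m = 30` (`U⁺` of type `(9 | 30)`, `U⁻` of type `(30 | 14)`): after the Levi kills every profile has `i = 0` (profiles [(0, 0)]), against the non-vanishing lemma.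
* `m = 32` (`U⁺` of type `(7 | 32)`, `U⁻` of type `(32 | 12)`): `L⁺` of type `(7 | 32)` is full and a lift with `i = 1` has no feasible `j`.
* `m = 33` (`U⁺` of type `(6 | 33)`, `U⁻` of type `(33 | 11)`): after the Levi kills every profile has `i = 0` (profiles [(0, 0)]), against the non-vanishing lemma.
* `m = 34` (`U⁺` of type `(5 | 34)`, `U⁻` of type `(34 | 10)`): `L⁺` of type `(5 | 34)` is full and a lift with `i = 1` has no feasible `j`.
* `m = 36` (`U⁺` of type `(3 | 36)`, `U⁻` of type `(36 | 8)`): after the Levi kills every profile has `i = 0` (profiles [(0, 0)]), against the non-vanishing lemma.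
* `m = 38` (`U⁺` of type `(1 | 38)`, `U⁻` of type `(38 | 6)`): `L⁺` of type `(1 | 38)` is full and a lift with `i = 1` has no feasible `j`.

## References
* [Ribet1983] K. A. Ribet, *Hodge classes on certain types of abelian varieties*, Amer. J. Math. 105 (1983), Thm. 3.
* [Gordon1997] B. B. Gordon, *A survey of the Hodge conjecture for abelian varieties*, Thm. 6.3 (3), pp. 18–19.
* [Deligne1982HodgeCycles] P. Deligne, *Hodge cycles on abelian varieties*, LNM 900 (1982), I §3 Prop. 3.4, 3.6.
* [GoodmanWallachGTM255] R. Goodman, N. R. Wallach, GTM 255 (2009), §2.3.1, §4.1.1.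
* [HoffmanKunze1971LinearAlgebra] K. Hoffman, R. Kunze, *Linear Algebra* (1971), §3.1 Thm. 2, §6.7, §8.5.
-/

noncomputable section

open Module

namespace Literature.AlgebraicGeometry.Motives

namespace HodgeStructure

universe u

variable {W : Type u} [AddCommGroup W] [Module ℂ W]

/-! ### §2 The minimal-rank lemmas -/

/-- `(39 | 44)`, minimal rank `8`: after the Levi kills every profile has `i = 0` (profiles [(0, 0), (0, 8)]), against the non-vanishing lemma. [cite: Ribet1983, Thm. 3] [cite: Gordon1997, Thm. 6.3 (3)]
[cite: Deligne1982HodgeCycles, I §3 Prop. 3.4, 3.6] [cite: GoodmanWallachGTM255, §4.1.1] -/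
theorem UnitaryThirtyNineFortyFour.no_minRank_8 [FiniteDimensional ℂ W] {𝔊 : Submodule ℂ (Module.End ℂ W)}
    (hbr : ∀ Y ∈ 𝔊, ∀ Z ∈ 𝔊, Y * Z - Z * Y ∈ 𝔊)
    (hirr : ∀ U : Submodule ℂ W, (∀ A ∈ 𝔊, ∀ u ∈ U, A u ∈ U) → U = ⊥ ∨ U = ⊤)
    {Θ : Module.End ℂ W} (hΘ : Θ ∈ 𝔊) (hΘΘ : Θ * Θ = 1)
    {P Q : Submodule ℂ W} (hP : ∀ x, x ∈ P ↔ Θ x = x) (hQ : ∀ x, x ∈ Q ↔ Θ x = -x)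
    (hP39 : Module.finrank ℂ P = 39) (hQ44 : Module.finrank ℂ Q = 44)
    {s : W → W → ℂ} (hadd : ∀ x y z, s (x + y) z = s x z + s y z)
    (hsmul : ∀ (c : ℂ) (x y : W), s (c • x) y = c * s x y) (hsymm : ∀ x y, s y x = starRingEnd ℂ (s x y))
    (hPQ : ∀ p ∈ P, ∀ q ∈ Q, s p q = 0) (hdefP : ∀ p ∈ P, s p p = 0 → p = 0) (hdefQ : ∀ q ∈ Q, s q q = 0 → q = 0)
    (hadj : ∀ X ∈ 𝔊, ∃ Y ∈ 𝔊, ∀ x y, s (X x) y = s x (Y y))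
    (hS : ∀ B' ∈ 𝔊, Θ * B' = B' → B' * Θ = -B' →
      Module.finrank ℂ (LinearMap.range B') = 0 ∨ Module.finrank ℂ (LinearMap.range B') = 8 ∨ Module.finrank ℂ (LinearMap.range B') = 10 ∨ Module.finrank ℂ (LinearMap.range B') = 11 ∨ Module.finrank ℂ (LinearMap.range B') = 12 ∨ Module.finrank ℂ (LinearMap.range B') = 14 ∨ Module.finrank ℂ (LinearMap.range B') = 15 ∨ Module.finrank ℂ (LinearMap.range B') = 16 ∨ Module.finrank ℂ (LinearMap.range B') = 17 ∨ Module.finrank ℂ (LinearMap.range B') = 18 ∨ Module.finrank ℂ (LinearMap.range B') = 19 ∨ Module.finrank ℂ (LinearMap.range B') = 20 ∨ Module.finrank ℂ (LinearMap.range B') = 21 ∨ Module.finrank ℂ (LinearMap.range B') = 22 ∨ Module.finrank ℂ (LinearMap.range B') = 23 ∨ Module.finrank ℂ (LinearMap.range B') = 24 ∨ Module.finrank ℂ (LinearMap.range B') = 25 ∨ Module.finrank ℂ (LinearMap.range B') = 26 ∨ Module.finrank ℂ (LinearMap.range B') = 27 ∨ Module.finrank ℂ (LinearMap.range B') = 28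 ∨ Module.finrank ℂ (LinearMap.range B') = 29 ∨ Module.finrank ℂ (LinearMap.range B') = 30 ∨ Module.finrank ℂ (LinearMap.range B') = 32 ∨ Module.finrank ℂ (LinearMap.range B') = 33 ∨ Module.finrank ℂ (LinearMap.range B') = 34 ∨ Module.finrank ℂ (LinearMap.range B') = 36 ∨ Module.finrank ℂ (LinearMap.range B') = 38)
    {B : Module.End ℂ W} (hB : B ∈ 𝔊) (hΘB : Θ * B = B) (hBΘ : B * Θ = -B)
    (hr : Module.finrank ℂ (LinearMap.range B) = 8) : False := by
  classical
  have hsU : ∀ U : Submodule ℂ W, ∀ x y z : U, s ((x + y : U) : W) z = s (x : W) z + s (y : W) z :=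
    fun U x y z => by simp only [Submodule.coe_add, hadd]
  have hsmU : ∀ U : Submodule ℂ W, ∀ (c : ℂ) (x y : U), s ((c • x : U) : W) y = c * s (x : W) y :=
    fun U c x y => by simp only [Submodule.coe_smul, hsmul]
  have hno1 : ∀ B' ∈ 𝔊, Θ * B' = B' → B' * Θ = -B' → Module.finrank ℂ (LinearMap.range B') ≠ 1 := by
    intro B' hB' hΘB' hB'Θ h1
    rcases hS B' hB' hΘB' hB'Θ with h | h | h | h | h | h | h | h | h | h | h | h | h | h | h | h | h | h | h | h | h | h | h | h | h | h | h <;> omega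
  have hmin : ∀ Y ∈ 𝔊, Θ * Y = Y → Y * Θ = -Y → Y ≠ 0 → 8 ≤ Module.finrank ℂ (LinearMap.range Y) := by
    intro Y hY hΘY hYΘ hY0
    have h0 : Module.finrank ℂ (LinearMap.range Y) ≠ 0 := fun h =>
      hY0 (LinearMap.range_eq_bot.1 (Submodule.finrank_eq_zero.1 h))
    rcases hS Y hY hΘY hYΘ with h | h | h | h | h | h | h | h | h | h | h | h | h | h | h | h | h | h | h | h | h | h | h | h | h | h | h <;> omega
  have hmin' : ∀ Z ∈ 𝔊, Θ * Z = Z → Z * Θ = -Z → Z ≠ 0 → Module.finrank ℂ (LinearMap.range B) ≤ Module.finrank ℂ (LinearMap.range Z) := by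
    rw [hr]; exact hmin
  obtain ⟨ι, Um, Up, PU, QU, Lm, ιm, Pm, Qm, Lp, ιp, Pp, Qp, hιmem, hιι, hιΘ, hιs, hUm, hUp, hfinUm, hfinUp,
    hPM, hQM, hPU, hQU, hrangeP, hPUP, hQUQ, hfinQM, hfinPU, hfinQU, hLm, hLp,
    hιmapply, hPmmem, hQmmem, hbrLm, hirrLm, hιmmem, hιmιm, hPm, hQm, hfinPm, hfinQm, hPmQm, hdefPm, hdefQm, hadjLm,
    hιpapply, hPpmem, hQpmem, hbrLp, hirrLp, hιpmem, hιpιp, hPp, hQp, hfinPp, hfinQp, hPpQp, hdefPp, hdefQp, hadjLp,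
    hsplit⟩ :=
    UnitaryLeviSetup.exists_levi_pair hbr hirr hΘ hΘΘ hP hQ hadd hsymm hPQ hdefP hdefQ hadj hB hΘB hBΘ
  have hdich : ∀ X ∈ 𝔊, Θ * X = X → X * Θ = -X → X * ι = ι * X →
      Module.finrank ℂ (Up.map X) + Module.finrank ℂ (Um.map X) ≤ Module.finrank ℂ (LinearMap.range B) ∨
        (8 ≤ Module.finrank ℂ (Up.map X) ∧ 8 ≤ Module.finrank ℂ (Um.map X)) := fun X hX hΘX hXΘ hXc =>
    UnitaryLeviSetup.profile_dichotomy hbr hΘΘ hP hQ hadd hsymm hPQ hdefP hdefQ hadj hmin hB hΘB hBΘ hιι hιΘ hιs hUm hUp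
      hPM hQM hQU hfinQU hrangeP hX hΘX hXΘ hXc
  have hfinQU' := hfinQU
  rw [hr] at hfinQM hfinPU hfinQU hfinPm hfinQm hfinPp hfinQp hsplit hdich
  rw [hQ44] at hfinQM hfinQm hfinUm
  rw [hP39] at hfinPU hfinPp hfinUp
  have hcm : ∀ Z : Module.End ℂ W, Z * ι = ι * Z → ∀ x ∈ Um, Z x ∈ Um := fun Z hZ x hx =>
    (hUm _).2 (by rw [← Module.End.mul_apply, ← hZ, Module.End.mul_apply, (hUm x).1 hx, map_neg])
  have hcp : ∀ Z : Module.End ℂ W, Z * ι = ι * Z → ∀ x ∈ Up, Z x ∈ Up := fun Z hZ x hx =>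
    (hUp _).2 (by rw [← Module.End.mul_apply, ← hZ, Module.End.mul_apply, (hUp x).1 hx])
  have hfullm_of : Lm = ⊤ → False := fun h =>
    UnitaryLeviSetup.false_of_full_larger hbr hΘΘ hno1 hιι hιΘ hUm hUp (by omega) (by omega) hPM hQM (by omega)
      (by omega) hLm h
  have hkillm1 : ∀ X ∈ 𝔊, Θ * X = X → X * Θ = -X → X * ι = ι * X → Module.finrank ℂ (Um.map X) ≠ 1 := by
    intro X hX hΘX hXΘ hXc h1
    obtain ⟨hxmem, hιmx, hxιm, hxrk⟩ := UnitaryLeviSetup.restrict_mem hcm hLm hιmapply X hX hΘX hXΘ hXc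
    rw [h1] at hxrk
    exact hfullm_of (UnitaryRankOneRaise.eq_top_of_rankOne_raise hbrLm hirrLm hιmmem hιmιm hPm hQm
      (s := fun v w : Um => s (v : W) w) (hsU Um) (fun v w => hsymm v w) hPmQm hdefPm hdefQm hadjLm hxmem hιmx hxιm
      hxrk (by omega) (by omega) (by omega))
  have hkillm5 : ∀ X ∈ 𝔊, Θ * X = X → X * Θ = -X → X * ι = ι * X → Module.finrank ℂ (Um.map X) ≠ 5 := by
    intro X hX hΘX hXΘ hXc h5
    obtain ⟨hxmem, hιmx, hxιm, hxrk⟩ := UnitaryLeviSetup.restrict_mem hcm hLm hιmapply X hX hΘX hXΘ hXc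
    rw [h5] at hxrk
    refine hfullm_of (UnitaryDoubleLevi.eq_top_of_raise_of_core hbrLm hirrLm hιmmem hιmιm hPm hQm
      (s := fun v w : Um => s (v : W) w) (hsU Um) (fun v w => hsymm v w) hPmQm hdefPm hdefQm hadjLm hxmem hιmx hxιm
      (by rw [hxrk]; omega) (by omega) (by omega)
      fun U' 𝔩' ι' P' Q' hbr𝔩' hirr𝔩' hι' hι'ι' hP' hQ' hfinP' hfinQ' hP'Q' hdefP' hdefQ' hadj𝔩' => ?_)
    rw [hxrk] at hfinP' hfinQ'
    exact UnitaryFive.eq_top_of_smul hbr𝔩' hirr𝔩' hι' hι'ι' hP' hQ' hfinP' (by omega) (s := fun x y : U' => s ((x : Um) : W) y) (fun x y z => by simp only [Submodule.coe_add, hadd]) (fun c x y => by simp only [Submodule.coe_smul, hsmul]) (fun x y => hsymm _ _) hP'Q' hdefP' hdefQ' hadj𝔩'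
  have hkillm7 : ∀ X ∈ 𝔊, Θ * X = X → X * Θ = -X → X * ι = ι * X → Module.finrank ℂ (Um.map X) ≠ 7 := by
    intro X hX hΘX hXΘ hXc h7
    obtain ⟨hxmem, hιmx, hxιm, hxrk⟩ := UnitaryLeviSetup.restrict_mem hcm hLm hιmapply X hX hΘX hXΘ hXc
    rw [h7] at hxrk
    refine hfullm_of (UnitaryDoubleLevi.eq_top_of_raise_of_core hbrLm hirrLm hιmmem hιmιm hPm hQm
      (s := fun v w : Um => s (v : W) w) (hsU Um) (fun v w => hsymm v w) hPmQm hdefPm hdefQm hadjLm hxmem hιmx hxιm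
      (by rw [hxrk]; omega) (by omega) (by omega)
      fun U' 𝔩' ι' P' Q' hbr𝔩' hirr𝔩' hι' hι'ι' hP' hQ' hfinP' hfinQ' hP'Q' hdefP' hdefQ' hadj𝔩' => ?_)
    rw [hxrk] at hfinP' hfinQ'
    exact UnitarySeven.eq_top_of_smul hbr𝔩' hirr𝔩' hι' hι'ι' hP' hQ' hfinP' (by omega) (s := fun x y : U' => s ((x : Um) : W) y) (fun x y z => by simp only [Submodule.coe_add, hadd]) (fun c x y => by simp only [Submodule.coe_smul, hsmul]) (fun x y => hsymm _ _) hP'Q' hdefP' hdefQ' hadj𝔩'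
  have hfullp_of : Lp = ⊤ → False := by
    intro hLptop
    obtain ⟨T1, hιT1, hT1ι, hT1r⟩ := UnitaryRaisingSpace.exists_raise_finrank_range_eq hιpιp hPp hQp (k := 1)
      (by omega) (by omega)
    obtain ⟨X1, hX1, hΘX1, hX1Θ, hX1c, hX1Up⟩ := UnitaryLeviSetup.exists_lift hbr hΘ hΘΘ hcp hιΘ hLp hιpapply T1
      (by rw [hLptop]; exact Submodule.mem_top) hιT1 hT1ι
    rw [hT1r] at hX1Up
    obtain ⟨hs1, hi1, hi1', hj1, hj1'⟩ := hsplit X1 hΘX1 hX1Θ hX1c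
    have hrk1 := hS X1 hX1 hΘX1 hX1Θ
    have hd1 := hdich X1 hX1 hΘX1 hX1Θ hX1c
    rw [hs1] at hrk1
    rw [hX1Up] at hrk1 hd1
    have hk_hkillm7 := hkillm7 X1 hX1 hΘX1 hX1Θ hX1c
    omega
  have hkillp2 : ∀ X ∈ 𝔊, Θ * X = X → X * Θ = -X → X * ι = ι * X → Module.finrank ℂ (Up.map X) ≠ 2 := by
    intro X hX hΘX hXΘ hXc h2
    obtain ⟨hymem, hιpy, hyιp, hyrk⟩ := UnitaryLeviSetup.restrict_mem hcp hLp hιpapply X hX hΘX hXΘ hXc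
    rw [h2] at hyrk
    refine hfullp_of (UnitaryDoubleLevi.eq_top_of_raise_of_core' hbrLp hirrLp hιpmem hιpιp hPp hQp
      (s := fun v w : Up => s (v : W) w) (hsU Up) (fun v w => hsymm v w) hPpQp hdefPp hdefQp hadjLp hymem hιpy hyιp
      (by rw [hyrk]; omega) (by omega) (by omega)
      fun U' 𝔩' ι' P' Q' hbr𝔩' hirr𝔩' hι' hι'ι' hP' hQ' hfinP' hfinQ' hP'Q' hdefP' hdefQ' hadj𝔩' => ?_)
    rw [hyrk] at hfinP' hfinQ'
    exact UnitaryTwoOdd.eq_top hbr𝔩' hirr𝔩' hι' hι'ι' hP' hQ' hfinP' ⟨14, by omega⟩ (s := fun x y : U' => s ((x : Up) : W) y) (fun x y z => by simp only [Submodule.coe_add, hadd]) (fun x y => hsymm _ _) hP'Q' hdefP' hdefQ' hadj𝔩'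
  have hkillp4 : ∀ X ∈ 𝔊, Θ * X = X → X * Θ = -X → X * ι = ι * X → Module.finrank ℂ (Up.map X) ≠ 4 := by
    intro X hX hΘX hXΘ hXc h4
    obtain ⟨hymem, hιpy, hyιp, hyrk⟩ := UnitaryLeviSetup.restrict_mem hcp hLp hιpapply X hX hΘX hXΘ hXc
    rw [h4] at hyrk
    refine hfullp_of (UnitaryDoubleLevi.eq_top_of_raise_of_core' hbrLp hirrLp hιpmem hιpιp hPp hQp
      (s := fun v w : Up => s (v : W) w) (hsU Up) (fun v w => hsymm v w) hPpQp hdefPp hdefQp hadjLp hymem hιpy hyιp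
      (by rw [hyrk]; omega) (by omega) (by omega)
      fun U' 𝔩' ι' P' Q' hbr𝔩' hirr𝔩' hι' hι'ι' hP' hQ' hfinP' hfinQ' hP'Q' hdefP' hdefQ' hadj𝔩' => ?_)
    rw [hyrk] at hfinP' hfinQ'
    exact UnitaryFourOdd.eq_top hbr𝔩' hirr𝔩' hι' hι'ι' hP' hQ' hfinP' ⟨13, by omega⟩ (s := fun x y : U' => s ((x : Up) : W) y) (fun x y z => by simp only [Submodule.coe_add, hadd]) (fun x y => hsymm _ _) hP'Q' hdefP' hdefQ' hadj𝔩'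
  have hkillp5 : ∀ X ∈ 𝔊, Θ * X = X → X * Θ = -X → X * ι = ι * X → Module.finrank ℂ (Up.map X) ≠ 5 := by
    intro X hX hΘX hXΘ hXc h5
    obtain ⟨hymem, hιpy, hyιp, hyrk⟩ := UnitaryLeviSetup.restrict_mem hcp hLp hιpapply X hX hΘX hXΘ hXc
    rw [h5] at hyrk
    refine hfullp_of (UnitaryDoubleLevi.eq_top_of_raise_of_core' hbrLp hirrLp hιpmem hιpιp hPp hQp
      (s := fun v w : Up => s (v : W) w) (hsU Up) (fun v w => hsymm v w) hPpQp hdefPp hdefQp hadjLp hymem hιpy hyιp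
      (by rw [hyrk]; omega) (by omega) (by omega)
      fun U' 𝔩' ι' P' Q' hbr𝔩' hirr𝔩' hι' hι'ι' hP' hQ' hfinP' hfinQ' hP'Q' hdefP' hdefQ' hadj𝔩' => ?_)
    rw [hyrk] at hfinP' hfinQ'
    exact UnitaryFive.eq_top_of_smul hbr𝔩' hirr𝔩' hι' hι'ι' hP' hQ' hfinP' (by omega) (s := fun x y : U' => s ((x : Up) : W) y) (fun x y z => by simp only [Submodule.coe_add, hadd]) (fun c x y => by simp only [Submodule.coe_smul, hsmul]) (fun x y => hsymm _ _) hP'Q' hdefP' hdefQ' hadj𝔩'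
  have hkillp6 : ∀ X ∈ 𝔊, Θ * X = X → X * Θ = -X → X * ι = ι * X → Module.finrank ℂ (Up.map X) ≠ 6 := by
    intro X hX hΘX hXΘ hXc h6
    obtain ⟨hymem, hιpy, hyιp, hyrk⟩ := UnitaryLeviSetup.restrict_mem hcp hLp hιpapply X hX hΘX hXΘ hXc
    rw [h6] at hyrk
    refine hfullp_of (UnitaryDoubleLevi.eq_top_of_raise_of_core' hbrLp hirrLp hιpmem hιpιp hPp hQp
      (s := fun v w : Up => s (v : W) w) (hsU Up) (fun v w => hsymm v w) hPpQp hdefPp hdefQp hadjLp hymem hιpy hyιp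
      (by rw [hyrk]; omega) (by omega) (by omega)
      fun U' 𝔩' ι' P' Q' hbr𝔩' hirr𝔩' hι' hι'ι' hP' hQ' hfinP' hfinQ' hP'Q' hdefP' hdefQ' hadj𝔩' => ?_)
    rw [hyrk] at hfinP' hfinQ'
    exact UnitarySix.eq_top_of_smul hbr𝔩' hirr𝔩' hι' hι'ι' hP' hQ' hfinP' ⟨12, by omega⟩ (by omega) (s := fun x y : U' => s ((x : Up) : W) y) (fun x y z => by simp only [Submodule.coe_add, hadd]) (fun c x y => by simp only [Submodule.coe_smul, hsmul]) (fun x y => hsymm _ _) hP'Q' hdefP' hdefQ' hadj𝔩'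
  have hkillp8 : ∀ X ∈ 𝔊, Θ * X = X → X * Θ = -X → X * ι = ι * X → Module.finrank ℂ (Up.map X) ≠ 8 := by
    intro X hX hΘX hXΘ hXc h8
    obtain ⟨hymem, hιpy, hyιp, hyrk⟩ := UnitaryLeviSetup.restrict_mem hcp hLp hιpapply X hX hΘX hXΘ hXc
    rw [h8] at hyrk
    refine hfullp_of (UnitaryDoubleLevi.eq_top_of_raise_of_core' hbrLp hirrLp hιpmem hιpιp hPp hQp
      (s := fun v w : Up => s (v : W) w) (hsU Up) (fun v w => hsymm v w) hPpQp hdefPp hdefQp hadjLp hymem hιpy hyιp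
      (by rw [hyrk]; omega) (by omega) (by omega)
      fun U' 𝔩' ι' P' Q' hbr𝔩' hirr𝔩' hι' hι'ι' hP' hQ' hfinP' hfinQ' hP'Q' hdefP' hdefQ' hadj𝔩' => ?_)
    rw [hyrk] at hfinP' hfinQ'
    exact UnitaryEight.eq_top_of_smul_twentythree hbr𝔩' hirr𝔩' hι' hι'ι' hP' hQ' hfinP' (by omega) (s := fun x y : U' => s ((x : Up) : W) y) (fun x y z => by simp only [Submodule.coe_add, hadd]) (fun c x y => by simp only [Submodule.coe_smul, hsmul]) (fun x y => hsymm _ _) hP'Q' hdefP' hdefQ' hadj𝔩'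
  have hprof : ∀ X ∈ 𝔊, Θ * X = X → X * Θ = -X → X * ι = ι * X →
      (Module.finrank ℂ (Up.map X) = 0 ∧ Module.finrank ℂ (Um.map X) = 0) ∨
        (Module.finrank ℂ (Up.map X) = 0 ∧ Module.finrank ℂ (Um.map X) = 8) := by
    intro X hX hΘX hXΘ hXc
    obtain ⟨hs, hi, hi', hj, hj'⟩ := hsplit X hΘX hXΘ hXc
    have hkillm1' := hkillm1 X hX hΘX hXΘ hXc
    have hkillm5' := hkillm5 X hX hΘX hXΘ hXc
    have hkillm7' := hkillm7 X hX hΘX hXΘ hXc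
    have hkillp2' := hkillp2 X hX hΘX hXΘ hXc
    have hkillp4' := hkillp4 X hX hΘX hXΘ hXc
    have hkillp5' := hkillp5 X hX hΘX hXΘ hXc
    have hkillp6' := hkillp6 X hX hΘX hXΘ hXc
    have hkillp8' := hkillp8 X hX hΘX hXΘ hXc
    have hrk := hS X hX hΘX hXΘ
    have hd := hdich X hX hΘX hXΘ hXc
    rw [hs] at hrk
    generalize Module.finrank ℂ ↥(Submodule.map X Um) = jj at *
    have hjle : jj ≤ 8 := by omega
    interval_cases jj
    · exact Or.inl ⟨by omega, rfl⟩
    · exact (hkillm1' rfl).elim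
    · exfalso; omega
    · exfalso; omega
    · exfalso; omega
    · exact (hkillm5' rfl).elim
    · exfalso; omega
    · exact (hkillm7' rfl).elim
    · exact Or.inr (⟨by omega, rfl⟩)
  obtain ⟨⟨p, hp⟩, hp0⟩ := Module.finrank_pos_iff_exists_ne_zero.1 (show 0 < Module.finrank ℂ PU by omega)
  obtain ⟨⟨q, hq⟩, hq0⟩ := Module.finrank_pos_iff_exists_ne_zero.1 (show 0 < Module.finrank ℂ QU by omega)
  obtain ⟨X₀, hX₀, hΘX₀, hX₀Θ, hX₀c, c₀, hιc₀, -, hX₀c0⟩ :=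
    UnitaryLeviFull.exists_raise_commute_apply_ne_zero hbr hirr hΘ hΘΘ hQ hιmem hιι hιΘ hUm hUp
      ⟨p, fun h => hp0 (Subtype.ext h), ((hPU p).1 hp).1, ((hPU p).1 hp).2⟩
      ⟨q, fun h => hq0 (Subtype.ext h), ((hQU q).1 hq).1, ((hQU q).1 hq).2⟩
  have hX₀i : Module.finrank ℂ (Up.map X₀) ≠ 0 := fun h0 => by
    have hmem : X₀ c₀ ∈ Up.map X₀ := Submodule.mem_map_of_mem ((hUp c₀).2 hιc₀)
    rw [Submodule.finrank_eq_zero.1 h0, Submodule.mem_bot] at hmem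
    exact hX₀c0 hmem
  have hp0 := hprof X₀ hX₀ hΘX₀ hX₀Θ hX₀c
  omega

/-- `(39 | 44)`, minimal rank `10`: after the Levi kills every profile has `i = 0` (profiles [(0, 0), (0, 10)]), against the non-vanishing lemma. [cite: Ribet1983, Thm. 3] [cite: Gordon1997, Thm. 6.3 (3)]
[cite: Deligne1982HodgeCycles, I §3 Prop. 3.4, 3.6] [cite: GoodmanWallachGTM255, §4.1.1] -/
theorem UnitaryThirtyNineFortyFour.no_minRank_10 [FiniteDimensional ℂ W] {𝔊 : Submodule ℂ (Module.End ℂ W)}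
    (hbr : ∀ Y ∈ 𝔊, ∀ Z ∈ 𝔊, Y * Z - Z * Y ∈ 𝔊)
    (hirr : ∀ U : Submodule ℂ W, (∀ A ∈ 𝔊, ∀ u ∈ U, A u ∈ U) → U = ⊥ ∨ U = ⊤)
    {Θ : Module.End ℂ W} (hΘ : Θ ∈ 𝔊) (hΘΘ : Θ * Θ = 1)
    {P Q : Submodule ℂ W} (hP : ∀ x, x ∈ P ↔ Θ x = x) (hQ : ∀ x, x ∈ Q ↔ Θ x = -x)
    (hP39 : Module.finrank ℂ P = 39) (hQ44 : Module.finrank ℂ Q = 44)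
    {s : W → W → ℂ} (hadd : ∀ x y z, s (x + y) z = s x z + s y z)
    (hsmul : ∀ (c : ℂ) (x y : W), s (c • x) y = c * s x y) (hsymm : ∀ x y, s y x = starRingEnd ℂ (s x y))
    (hPQ : ∀ p ∈ P, ∀ q ∈ Q, s p q = 0) (hdefP : ∀ p ∈ P, s p p = 0 → p = 0) (hdefQ : ∀ q ∈ Q, s q q = 0 → q = 0)
    (hadj : ∀ X ∈ 𝔊, ∃ Y ∈ 𝔊, ∀ x y, s (X x) y = s x (Y y))
    (hS : ∀ B' ∈ 𝔊, Θ * B' = B' → B' * Θ = -B' →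
      Module.finrank ℂ (LinearMap.range B') = 0 ∨ Module.finrank ℂ (LinearMap.range B') = 10 ∨ Module.finrank ℂ (LinearMap.range B') = 11 ∨ Module.finrank ℂ (LinearMap.range B') = 12 ∨ Module.finrank ℂ (LinearMap.range B') = 14 ∨ Module.finrank ℂ (LinearMap.range B') = 15 ∨ Module.finrank ℂ (LinearMap.range B') = 16 ∨ Module.finrank ℂ (LinearMap.range B') = 17 ∨ Module.finrank ℂ (LinearMap.range B') = 18 ∨ Module.finrank ℂ (LinearMap.range B') = 19 ∨ Module.finrank ℂ (LinearMap.range B') = 20 ∨ Module.finrank ℂ (LinearMap.range B') = 21 ∨ Module.finrank ℂ (LinearMap.range B') = 22 ∨ Module.finrank ℂ (LinearMap.range B') = 23 ∨ Module.finrank ℂ (LinearMap.range B') = 24 ∨ Module.finrank ℂ (LinearMap.range B') = 25 ∨ Module.finrank ℂ (LinearMap.range B') = 26 ∨ Module.finrank ℂ (LinearMap.range B') = 27 ∨ Module.finrank ℂ (LinearMap.range B') = 28 ∨ Module.finrank ℂ (LinearMap.range B') = 29 ∨ Module.finrank ℂ (LinearMap.range B') = 30 ∨ Module.finrank ℂ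 (LinearMap.range B') = 32 ∨ Module.finrank ℂ (LinearMap.range B') = 33 ∨ Module.finrank ℂ (LinearMap.range B') = 34 ∨ Module.finrank ℂ (LinearMap.range B') = 36 ∨ Module.finrank ℂ (LinearMap.range B') = 38)
    {B : Module.End ℂ W} (hB : B ∈ 𝔊) (hΘB : Θ * B = B) (hBΘ : B * Θ = -B)
    (hr : Module.finrank ℂ (LinearMap.range B) = 10) : False := by
  classical
  have hsU : ∀ U : Submodule ℂ W, ∀ x y z : U, s ((x + y : U) : W) z = s (x : W) z + s (y : W) z :=
    fun U x y z => by simp only [Submodule.coe_add, hadd]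
  have hsmU : ∀ U : Submodule ℂ W, ∀ (c : ℂ) (x y : U), s ((c • x : U) : W) y = c * s (x : W) y :=
    fun U c x y => by simp only [Submodule.coe_smul, hsmul]
  have hno1 : ∀ B' ∈ 𝔊, Θ * B' = B' → B' * Θ = -B' → Module.finrank ℂ (LinearMap.range B') ≠ 1 := by
    intro B' hB' hΘB' hB'Θ h1
    rcases hS B' hB' hΘB' hB'Θ with h | h | h | h | h | h | h | h | h | h | h | h | h | h | h | h | h | h | h | h | h | h | h | h | h | h <;> omega
  have hmin : ∀ Y ∈ 𝔊, Θ * Y = Y → Y * Θ = -Y → Y ≠ 0 → 10 ≤ Module.finrank ℂ (LinearMap.range Y) := by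
    intro Y hY hΘY hYΘ hY0
    have h0 : Module.finrank ℂ (LinearMap.range Y) ≠ 0 := fun h =>
      hY0 (LinearMap.range_eq_bot.1 (Submodule.finrank_eq_zero.1 h))
    rcases hS Y hY hΘY hYΘ with h | h | h | h | h | h | h | h | h | h | h | h | h | h | h | h | h | h | h | h | h | h | h | h | h | h <;> omega
  have hmin' : ∀ Z ∈ 𝔊, Θ * Z = Z → Z * Θ = -Z → Z ≠ 0 → Module.finrank ℂ (LinearMap.range B) ≤ Module.finrank ℂ (LinearMap.range Z) := by
    rw [hr]; exact hmin
  obtain ⟨ι, Um, Up, PU, QU, Lm, ιm, Pm, Qm, Lp, ιp, Pp, Qp, hιmem, hιι, hιΘ, hιs, hUm, hUp, hfinUm, hfinUp,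
    hPM, hQM, hPU, hQU, hrangeP, hPUP, hQUQ, hfinQM, hfinPU, hfinQU, hLm, hLp,
    hιmapply, hPmmem, hQmmem, hbrLm, hirrLm, hιmmem, hιmιm, hPm, hQm, hfinPm, hfinQm, hPmQm, hdefPm, hdefQm, hadjLm,
    hιpapply, hPpmem, hQpmem, hbrLp, hirrLp, hιpmem, hιpιp, hPp, hQp, hfinPp, hfinQp, hPpQp, hdefPp, hdefQp, hadjLp,
    hsplit⟩ :=
    UnitaryLeviSetup.exists_levi_pair hbr hirr hΘ hΘΘ hP hQ hadd hsymm hPQ hdefP hdefQ hadj hB hΘB hBΘ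
  have hdich : ∀ X ∈ 𝔊, Θ * X = X → X * Θ = -X → X * ι = ι * X →
      Module.finrank ℂ (Up.map X) + Module.finrank ℂ (Um.map X) ≤ Module.finrank ℂ (LinearMap.range B) ∨
        (10 ≤ Module.finrank ℂ (Up.map X) ∧ 10 ≤ Module.finrank ℂ (Um.map X)) := fun X hX hΘX hXΘ hXc =>
    UnitaryLeviSetup.profile_dichotomy hbr hΘΘ hP hQ hadd hsymm hPQ hdefP hdefQ hadj hmin hB hΘB hBΘ hιι hιΘ hιs hUm hUp
      hPM hQM hQU hfinQU hrangeP hX hΘX hXΘ hXc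
  have hfinQU' := hfinQU
  rw [hr] at hfinQM hfinPU hfinQU hfinPm hfinQm hfinPp hfinQp hsplit hdich
  rw [hQ44] at hfinQM hfinQm hfinUm
  rw [hP39] at hfinPU hfinPp hfinUp
  have hcm : ∀ Z : Module.End ℂ W, Z * ι = ι * Z → ∀ x ∈ Um, Z x ∈ Um := fun Z hZ x hx =>
    (hUm _).2 (by rw [← Module.End.mul_apply, ← hZ, Module.End.mul_apply, (hUm x).1 hx, map_neg])
  have hcp : ∀ Z : Module.End ℂ W, Z * ι = ι * Z → ∀ x ∈ Up, Z x ∈ Up := fun Z hZ x hx =>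
    (hUp _).2 (by rw [← Module.End.mul_apply, ← hZ, Module.End.mul_apply, (hUp x).1 hx])
  have hfullm_of : Lm = ⊤ → False := fun h =>
    UnitaryLeviSetup.false_of_full_larger hbr hΘΘ hno1 hιι hιΘ hUm hUp (by omega) (by omega) hPM hQM (by omega)
      (by omega) hLm h
  have hkillm1 : ∀ X ∈ 𝔊, Θ * X = X → X * Θ = -X → X * ι = ι * X → Module.finrank ℂ (Um.map X) ≠ 1 := by
    intro X hX hΘX hXΘ hXc h1
    obtain ⟨hxmem, hιmx, hxιm, hxrk⟩ := UnitaryLeviSetup.restrict_mem hcm hLm hιmapply X hX hΘX hXΘ hXc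
    rw [h1] at hxrk
    exact hfullm_of (UnitaryRankOneRaise.eq_top_of_rankOne_raise hbrLm hirrLm hιmmem hιmιm hPm hQm
      (s := fun v w : Um => s (v : W) w) (hsU Um) (fun v w => hsymm v w) hPmQm hdefPm hdefQm hadjLm hxmem hιmx hxιm
      hxrk (by omega) (by omega) (by omega))
  have hkillm3 : ∀ X ∈ 𝔊, Θ * X = X → X * Θ = -X → X * ι = ι * X → Module.finrank ℂ (Um.map X) ≠ 3 := by
    intro X hX hΘX hXΘ hXc h3
    obtain ⟨hxmem, hιmx, hxιm, hxrk⟩ := UnitaryLeviSetup.restrict_mem hcm hLm hιmapply X hX hΘX hXΘ hXc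
    rw [h3] at hxrk
    refine hfullm_of (UnitaryDoubleLevi.eq_top_of_raise_of_core hbrLm hirrLm hιmmem hιmιm hPm hQm
      (s := fun v w : Um => s (v : W) w) (hsU Um) (fun v w => hsymm v w) hPmQm hdefPm hdefQm hadjLm hxmem hιmx hxιm
      (by rw [hxrk]; omega) (by omega) (by omega)
      fun U' 𝔩' ι' P' Q' hbr𝔩' hirr𝔩' hι' hι'ι' hP' hQ' hfinP' hfinQ' hP'Q' hdefP' hdefQ' hadj𝔩' => ?_)
    rw [hxrk] at hfinP' hfinQ'
    exact UnitaryThreeCoprime.eq_top hbr𝔩' hirr𝔩' hι' hι'ι' hP' hQ' hfinP' (by omega) (s := fun x y : U' => s ((x : Um) : W) y) (fun x y z => by simp only [Submodule.coe_add, hadd]) (fun x y => hsymm _ _) hP'Q' hdefP' hdefQ' hadj𝔩'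
  have hkillm5 : ∀ X ∈ 𝔊, Θ * X = X → X * Θ = -X → X * ι = ι * X → Module.finrank ℂ (Um.map X) ≠ 5 := by
    intro X hX hΘX hXΘ hXc h5
    obtain ⟨hxmem, hιmx, hxιm, hxrk⟩ := UnitaryLeviSetup.restrict_mem hcm hLm hιmapply X hX hΘX hXΘ hXc
    rw [h5] at hxrk
    refine hfullm_of (UnitaryDoubleLevi.eq_top_of_raise_of_core hbrLm hirrLm hιmmem hιmιm hPm hQm
      (s := fun v w : Um => s (v : W) w) (hsU Um) (fun v w => hsymm v w) hPmQm hdefPm hdefQm hadjLm hxmem hιmx hxιm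
      (by rw [hxrk]; omega) (by omega) (by omega)
      fun U' 𝔩' ι' P' Q' hbr𝔩' hirr𝔩' hι' hι'ι' hP' hQ' hfinP' hfinQ' hP'Q' hdefP' hdefQ' hadj𝔩' => ?_)
    rw [hxrk] at hfinP' hfinQ'
    exact UnitaryFive.eq_top_of_smul hbr𝔩' hirr𝔩' hι' hι'ι' hP' hQ' hfinP' (by omega) (s := fun x y : U' => s ((x : Um) : W) y) (fun x y z => by simp only [Submodule.coe_add, hadd]) (fun c x y => by simp only [Submodule.coe_smul, hsmul]) (fun x y => hsymm _ _) hP'Q' hdefP' hdefQ' hadj𝔩'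
  have hkillm7 : ∀ X ∈ 𝔊, Θ * X = X → X * Θ = -X → X * ι = ι * X → Module.finrank ℂ (Um.map X) ≠ 7 := by
    intro X hX hΘX hXΘ hXc h7
    obtain ⟨hxmem, hιmx, hxιm, hxrk⟩ := UnitaryLeviSetup.restrict_mem hcm hLm hιmapply X hX hΘX hXΘ hXc
    rw [h7] at hxrk
    refine hfullm_of (UnitaryDoubleLevi.eq_top_of_raise_of_core hbrLm hirrLm hιmmem hιmιm hPm hQm
      (s := fun v w : Um => s (v : W) w) (hsU Um) (fun v w => hsymm v w) hPmQm hdefPm hdefQm hadjLm hxmem hιmx hxιm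
      (by rw [hxrk]; omega) (by omega) (by omega)
      fun U' 𝔩' ι' P' Q' hbr𝔩' hirr𝔩' hι' hι'ι' hP' hQ' hfinP' hfinQ' hP'Q' hdefP' hdefQ' hadj𝔩' => ?_)
    rw [hxrk] at hfinP' hfinQ'
    exact UnitarySeven.eq_top_of_smul hbr𝔩' hirr𝔩' hι' hι'ι' hP' hQ' hfinP' (by omega) (s := fun x y : U' => s ((x : Um) : W) y) (fun x y z => by simp only [Submodule.coe_add, hadd]) (fun c x y => by simp only [Submodule.coe_smul, hsmul]) (fun x y => hsymm _ _) hP'Q' hdefP' hdefQ' hadj𝔩'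
  have hfullp_of : Lp = ⊤ → False := by
    intro hLptop
    obtain ⟨T3, hιT3, hT3ι, hT3r⟩ := UnitaryRaisingSpace.exists_raise_finrank_range_eq hιpιp hPp hQp (k := 3)
      (by omega) (by omega)
    obtain ⟨X3, hX3, hΘX3, hX3Θ, hX3c, hX3Up⟩ := UnitaryLeviSetup.exists_lift hbr hΘ hΘΘ hcp hιΘ hLp hιpapply T3
      (by rw [hLptop]; exact Submodule.mem_top) hιT3 hT3ι
    rw [hT3r] at hX3Up
    obtain ⟨hs3, hi3, hi3', hj3, hj3'⟩ := hsplit X3 hΘX3 hX3Θ hX3c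
    have hrk3 := hS X3 hX3 hΘX3 hX3Θ
    have hd3 := hdich X3 hX3 hΘX3 hX3Θ hX3c
    rw [hs3] at hrk3
    rw [hX3Up] at hrk3 hd3
    have hk_hkillm7 := hkillm7 X3 hX3 hΘX3 hX3Θ hX3c
    omega
  have hkillp1 : ∀ X ∈ 𝔊, Θ * X = X → X * Θ = -X → X * ι = ι * X → Module.finrank ℂ (Up.map X) ≠ 1 := by
    intro X hX hΘX hXΘ hXc h1
    obtain ⟨hymem, hιpy, hyιp, hyrk⟩ := UnitaryLeviSetup.restrict_mem hcp hLp hιpapply X hX hΘX hXΘ hXc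
    rw [h1] at hyrk
    exact hfullp_of (UnitaryRankOneRaise.eq_top_of_rankOne_raise hbrLp hirrLp hιpmem hιpιp hPp hQp
      (s := fun v w : Up => s (v : W) w) (hsU Up) (fun v w => hsymm v w) hPpQp hdefPp hdefQp hadjLp hymem hιpy hyιp
      hyrk (by omega) (by omega) (by omega))
  have hkillp2 : ∀ X ∈ 𝔊, Θ * X = X → X * Θ = -X → X * ι = ι * X → Module.finrank ℂ (Up.map X) ≠ 2 := by
    intro X hX hΘX hXΘ hXc h2
    obtain ⟨hymem, hιpy, hyιp, hyrk⟩ := UnitaryLeviSetup.restrict_mem hcp hLp hιpapply X hX hΘX hXΘ hXc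
    rw [h2] at hyrk
    refine hfullp_of (UnitaryDoubleLevi.eq_top_of_raise_of_core' hbrLp hirrLp hιpmem hιpιp hPp hQp
      (s := fun v w : Up => s (v : W) w) (hsU Up) (fun v w => hsymm v w) hPpQp hdefPp hdefQp hadjLp hymem hιpy hyιp
      (by rw [hyrk]; omega) (by omega) (by omega)
      fun U' 𝔩' ι' P' Q' hbr𝔩' hirr𝔩' hι' hι'ι' hP' hQ' hfinP' hfinQ' hP'Q' hdefP' hdefQ' hadj𝔩' => ?_)
    rw [hyrk] at hfinP' hfinQ'
    exact UnitaryTwoOdd.eq_top hbr𝔩' hirr𝔩' hι' hι'ι' hP' hQ' hfinP' ⟨13, by omega⟩ (s := fun x y : U' => s ((x : Up) : W) y) (fun x y z => by simp only [Submodule.coe_add, hadd]) (fun x y => hsymm _ _) hP'Q' hdefP' hdefQ' hadj𝔩'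
  have hkillp4 : ∀ X ∈ 𝔊, Θ * X = X → X * Θ = -X → X * ι = ι * X → Module.finrank ℂ (Up.map X) ≠ 4 := by
    intro X hX hΘX hXΘ hXc h4
    obtain ⟨hymem, hιpy, hyιp, hyrk⟩ := UnitaryLeviSetup.restrict_mem hcp hLp hιpapply X hX hΘX hXΘ hXc
    rw [h4] at hyrk
    refine hfullp_of (UnitaryDoubleLevi.eq_top_of_raise_of_core' hbrLp hirrLp hιpmem hιpιp hPp hQp
      (s := fun v w : Up => s (v : W) w) (hsU Up) (fun v w => hsymm v w) hPpQp hdefPp hdefQp hadjLp hymem hιpy hyιp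
      (by rw [hyrk]; omega) (by omega) (by omega)
      fun U' 𝔩' ι' P' Q' hbr𝔩' hirr𝔩' hι' hι'ι' hP' hQ' hfinP' hfinQ' hP'Q' hdefP' hdefQ' hadj𝔩' => ?_)
    rw [hyrk] at hfinP' hfinQ'
    exact UnitaryFourOdd.eq_top hbr𝔩' hirr𝔩' hι' hι'ι' hP' hQ' hfinP' ⟨12, by omega⟩ (s := fun x y : U' => s ((x : Up) : W) y) (fun x y z => by simp only [Submodule.coe_add, hadd]) (fun x y => hsymm _ _) hP'Q' hdefP' hdefQ' hadj𝔩'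
  have hkillp6 : ∀ X ∈ 𝔊, Θ * X = X → X * Θ = -X → X * ι = ι * X → Module.finrank ℂ (Up.map X) ≠ 6 := by
    intro X hX hΘX hXΘ hXc h6
    obtain ⟨hymem, hιpy, hyιp, hyrk⟩ := UnitaryLeviSetup.restrict_mem hcp hLp hιpapply X hX hΘX hXΘ hXc
    rw [h6] at hyrk
    refine hfullp_of (UnitaryDoubleLevi.eq_top_of_raise_of_core' hbrLp hirrLp hιpmem hιpιp hPp hQp
      (s := fun v w : Up => s (v : W) w) (hsU Up) (fun v w => hsymm v w) hPpQp hdefPp hdefQp hadjLp hymem hιpy hyιp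
      (by rw [hyrk]; omega) (by omega) (by omega)
      fun U' 𝔩' ι' P' Q' hbr𝔩' hirr𝔩' hι' hι'ι' hP' hQ' hfinP' hfinQ' hP'Q' hdefP' hdefQ' hadj𝔩' => ?_)
    rw [hyrk] at hfinP' hfinQ'
    exact UnitarySix.eq_top_of_smul hbr𝔩' hirr𝔩' hι' hι'ι' hP' hQ' hfinP' ⟨11, by omega⟩ (by omega) (s := fun x y : U' => s ((x : Up) : W) y) (fun x y z => by simp only [Submodule.coe_add, hadd]) (fun c x y => by simp only [Submodule.coe_smul, hsmul]) (fun x y => hsymm _ _) hP'Q' hdefP' hdefQ' hadj𝔩'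
  have hkillp8 : ∀ X ∈ 𝔊, Θ * X = X → X * Θ = -X → X * ι = ι * X → Module.finrank ℂ (Up.map X) ≠ 8 := by
    intro X hX hΘX hXΘ hXc h8
    obtain ⟨hymem, hιpy, hyιp, hyrk⟩ := UnitaryLeviSetup.restrict_mem hcp hLp hιpapply X hX hΘX hXΘ hXc
    rw [h8] at hyrk
    refine hfullp_of (UnitaryDoubleLevi.eq_top_of_raise_of_core' hbrLp hirrLp hιpmem hιpιp hPp hQp
      (s := fun v w : Up => s (v : W) w) (hsU Up) (fun v w => hsymm v w) hPpQp hdefPp hdefQp hadjLp hymem hιpy hyιp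
      (by rw [hyrk]; omega) (by omega) (by omega)
      fun U' 𝔩' ι' P' Q' hbr𝔩' hirr𝔩' hι' hι'ι' hP' hQ' hfinP' hfinQ' hP'Q' hdefP' hdefQ' hadj𝔩' => ?_)
    rw [hyrk] at hfinP' hfinQ'
    exact UnitaryEightTwentyOne.eq_top_of_smul hbr𝔩' hirr𝔩' hι' hι'ι' hP' hQ' hfinP' (by omega) (s := fun x y : U' => s ((x : Up) : W) y) (fun x y z => by simp only [Submodule.coe_add, hadd]) (fun c x y => by simp only [Submodule.coe_smul, hsmul]) (fun x y => hsymm _ _) hP'Q' hdefP' hdefQ' hadj𝔩'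
  have hkillp10 : ∀ X ∈ 𝔊, Θ * X = X → X * Θ = -X → X * ι = ι * X → Module.finrank ℂ (Up.map X) ≠ 10 := by
    intro X hX hΘX hXΘ hXc h10
    obtain ⟨hymem, hιpy, hyιp, hyrk⟩ := UnitaryLeviSetup.restrict_mem hcp hLp hιpapply X hX hΘX hXΘ hXc
    rw [h10] at hyrk
    refine hfullp_of (UnitaryDoubleLevi.eq_top_of_raise_of_core' hbrLp hirrLp hιpmem hιpιp hPp hQp
      (s := fun v w : Up => s (v : W) w) (hsU Up) (fun v w => hsymm v w) hPpQp hdefPp hdefQp hadjLp hymem hιpy hyιp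
      (by rw [hyrk]; omega) (by omega) (by omega)
      fun U' 𝔩' ι' P' Q' hbr𝔩' hirr𝔩' hι' hι'ι' hP' hQ' hfinP' hfinQ' hP'Q' hdefP' hdefQ' hadj𝔩' => ?_)
    rw [hyrk] at hfinP' hfinQ'
    exact UnitaryTenNineteen.eq_top_of_smul hbr𝔩' hirr𝔩' hι' hι'ι' hP' hQ' hfinP' (by omega) (s := fun x y : U' => s ((x : Up) : W) y) (fun x y z => by simp only [Submodule.coe_add, hadd]) (fun c x y => by simp only [Submodule.coe_smul, hsmul]) (fun x y => hsymm _ _) hP'Q' hdefP' hdefQ' hadj𝔩'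
  have hprof : ∀ X ∈ 𝔊, Θ * X = X → X * Θ = -X → X * ι = ι * X →
      (Module.finrank ℂ (Up.map X) = 0 ∧ Module.finrank ℂ (Um.map X) = 0) ∨
        (Module.finrank ℂ (Up.map X) = 0 ∧ Module.finrank ℂ (Um.map X) = 10) := by
    intro X hX hΘX hXΘ hXc
    obtain ⟨hs, hi, hi', hj, hj'⟩ := hsplit X hΘX hXΘ hXc
    have hkillm1' := hkillm1 X hX hΘX hXΘ hXc
    have hkillm3' := hkillm3 X hX hΘX hXΘ hXc
    have hkillm5' := hkillm5 X hX hΘX hXΘ hXc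
    have hkillm7' := hkillm7 X hX hΘX hXΘ hXc
    have hkillp1' := hkillp1 X hX hΘX hXΘ hXc
    have hkillp2' := hkillp2 X hX hΘX hXΘ hXc
    have hkillp4' := hkillp4 X hX hΘX hXΘ hXc
    have hkillp6' := hkillp6 X hX hΘX hXΘ hXc
    have hkillp8' := hkillp8 X hX hΘX hXΘ hXc
    have hkillp10' := hkillp10 X hX hΘX hXΘ hXc
    have hrk := hS X hX hΘX hXΘ
    have hd := hdich X hX hΘX hXΘ hXc
    rw [hs] at hrk
    generalize Module.finrank ℂ ↥(Submodule.map X Um) = jj at *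
    have hjle : jj ≤ 10 := by omega
    interval_cases jj
    · exact Or.inl ⟨by omega, rfl⟩
    · exact (hkillm1' rfl).elim
    · exfalso; omega
    · exact (hkillm3' rfl).elim
    · exfalso; omega
    · exact (hkillm5' rfl).elim
    · exfalso; omega
    · exact (hkillm7' rfl).elim
    · exfalso; omega
    · exfalso; omega
    · exact Or.inr (⟨by omega, rfl⟩)
  obtain ⟨⟨p, hp⟩, hp0⟩ := Module.finrank_pos_iff_exists_ne_zero.1 (show 0 < Module.finrank ℂ PU by omega)
  obtain ⟨⟨q, hq⟩, hq0⟩ := Module.finrank_pos_iff_exists_ne_zero.1 (show 0 < Module.finrank ℂ QU by omega)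
  obtain ⟨X₀, hX₀, hΘX₀, hX₀Θ, hX₀c, c₀, hιc₀, -, hX₀c0⟩ :=
    UnitaryLeviFull.exists_raise_commute_apply_ne_zero hbr hirr hΘ hΘΘ hQ hιmem hιι hιΘ hUm hUp
      ⟨p, fun h => hp0 (Subtype.ext h), ((hPU p).1 hp).1, ((hPU p).1 hp).2⟩
      ⟨q, fun h => hq0 (Subtype.ext h), ((hQU q).1 hq).1, ((hQU q).1 hq).2⟩
  have hX₀i : Module.finrank ℂ (Up.map X₀) ≠ 0 := fun h0 => by
    have hmem : X₀ c₀ ∈ Up.map X₀ := Submodule.mem_map_of_mem ((hUp c₀).2 hιc₀)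
    rw [Submodule.finrank_eq_zero.1 h0, Submodule.mem_bot] at hmem
    exact hX₀c0 hmem
  have hp0 := hprof X₀ hX₀ hΘX₀ hX₀Θ hX₀c
  omega

/-- `(39 | 44)`, minimal rank `11`: `L⁺` of type `(28 | 11)` is full and a lift with `i = 1` has `j ∈ {10}`, killed in `L⁻` (type `(11 | 33)`). [cite: Ribet1983, Thm. 3] [cite: Gordon1997, Thm. 6.3 (3)]
[cite: Deligne1982HodgeCycles, I §3 Prop. 3.4, 3.6] [cite: GoodmanWallachGTM255, §4.1.1] -/
theorem UnitaryThirtyNineFortyFour.no_minRank_11 [FiniteDimensional ℂ W] {𝔊 : Submodule ℂ (Module.End ℂ W)}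
    (hbr : ∀ Y ∈ 𝔊, ∀ Z ∈ 𝔊, Y * Z - Z * Y ∈ 𝔊)
    (hirr : ∀ U : Submodule ℂ W, (∀ A ∈ 𝔊, ∀ u ∈ U, A u ∈ U) → U = ⊥ ∨ U = ⊤)
    {Θ : Module.End ℂ W} (hΘ : Θ ∈ 𝔊) (hΘΘ : Θ * Θ = 1)
    {P Q : Submodule ℂ W} (hP : ∀ x, x ∈ P ↔ Θ x = x) (hQ : ∀ x, x ∈ Q ↔ Θ x = -x)
    (hP39 : Module.finrank ℂ P = 39) (hQ44 : Module.finrank ℂ Q = 44)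
    {s : W → W → ℂ} (hadd : ∀ x y z, s (x + y) z = s x z + s y z)
    (hsmul : ∀ (c : ℂ) (x y : W), s (c • x) y = c * s x y) (hsymm : ∀ x y, s y x = starRingEnd ℂ (s x y))
    (hPQ : ∀ p ∈ P, ∀ q ∈ Q, s p q = 0) (hdefP : ∀ p ∈ P, s p p = 0 → p = 0) (hdefQ : ∀ q ∈ Q, s q q = 0 → q = 0)
    (hadj : ∀ X ∈ 𝔊, ∃ Y ∈ 𝔊, ∀ x y, s (X x) y = s x (Y y))
    (hS : ∀ B' ∈ 𝔊, Θ * B' = B' → B' * Θ = -B' →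
      Module.finrank ℂ (LinearMap.range B') = 0 ∨ Module.finrank ℂ (LinearMap.range B') = 11 ∨ Module.finrank ℂ (LinearMap.range B') = 12 ∨ Module.finrank ℂ (LinearMap.range B') = 14 ∨ Module.finrank ℂ (LinearMap.range B') = 15 ∨ Module.finrank ℂ (LinearMap.range B') = 16 ∨ Module.finrank ℂ (LinearMap.range B') = 17 ∨ Module.finrank ℂ (LinearMap.range B') = 18 ∨ Module.finrank ℂ (LinearMap.range B') = 19 ∨ Module.finrank ℂ (LinearMap.range B') = 20 ∨ Module.finrank ℂ (LinearMap.range B') = 21 ∨ Module.finrank ℂ (LinearMap.range B') = 22 ∨ Module.finrank ℂ (LinearMap.range B') = 23 ∨ Module.finrank ℂ (LinearMap.range B') = 24 ∨ Module.finrank ℂ (LinearMap.range B') = 25 ∨ Module.finrank ℂ (LinearMap.range B') = 26 ∨ Module.finrank ℂ (LinearMap.range B') = 27 ∨ Module.finrank ℂ (LinearMap.range B') = 28 ∨ Module.finrank ℂ (LinearMap.range B') = 29 ∨ Module.finrank ℂ (LinearMap.range B') = 30 ∨ Module.finrank ℂ (LinearMap.range B') = 32 ∨ Module.finrank ℂ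 (LinearMap.range B') = 33 ∨ Module.finrank ℂ (LinearMap.range B') = 34 ∨ Module.finrank ℂ (LinearMap.range B') = 36 ∨ Module.finrank ℂ (LinearMap.range B') = 38)
    {B : Module.End ℂ W} (hB : B ∈ 𝔊) (hΘB : Θ * B = B) (hBΘ : B * Θ = -B)
    (hr : Module.finrank ℂ (LinearMap.range B) = 11) : False := by
  classical
  have hsU : ∀ U : Submodule ℂ W, ∀ x y z : U, s ((x + y : U) : W) z = s (x : W) z + s (y : W) z :=
    fun U x y z => by simp only [Submodule.coe_add, hadd]
  have hsmU : ∀ U : Submodule ℂ W, ∀ (c : ℂ) (x y : U), s ((c • x : U) : W) y = c * s (x : W) y :=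
    fun U c x y => by simp only [Submodule.coe_smul, hsmul]
  have hno1 : ∀ B' ∈ 𝔊, Θ * B' = B' → B' * Θ = -B' → Module.finrank ℂ (LinearMap.range B') ≠ 1 := by
    intro B' hB' hΘB' hB'Θ h1
    rcases hS B' hB' hΘB' hB'Θ with h | h | h | h | h | h | h | h | h | h | h | h | h | h | h | h | h | h | h | h | h | h | h | h | h <;> omega
  have hmin : ∀ Y ∈ 𝔊, Θ * Y = Y → Y * Θ = -Y → Y ≠ 0 → 11 ≤ Module.finrank ℂ (LinearMap.range Y) := by
    intro Y hY hΘY hYΘ hY0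
    have h0 : Module.finrank ℂ (LinearMap.range Y) ≠ 0 := fun h =>
      hY0 (LinearMap.range_eq_bot.1 (Submodule.finrank_eq_zero.1 h))
    rcases hS Y hY hΘY hYΘ with h | h | h | h | h | h | h | h | h | h | h | h | h | h | h | h | h | h | h | h | h | h | h | h | h <;> omega
  have hmin' : ∀ Z ∈ 𝔊, Θ * Z = Z → Z * Θ = -Z → Z ≠ 0 → Module.finrank ℂ (LinearMap.range B) ≤ Module.finrank ℂ (LinearMap.range Z) := by
    rw [hr]; exact hmin
  obtain ⟨ι, Um, Up, PU, QU, Lm, ιm, Pm, Qm, Lp, ιp, Pp, Qp, hιmem, hιι, hιΘ, hιs, hUm, hUp, hfinUm, hfinUp,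
    hPM, hQM, hPU, hQU, hrangeP, hPUP, hQUQ, hfinQM, hfinPU, hfinQU, hLm, hLp,
    hιmapply, hPmmem, hQmmem, hbrLm, hirrLm, hιmmem, hιmιm, hPm, hQm, hfinPm, hfinQm, hPmQm, hdefPm, hdefQm, hadjLm,
    hιpapply, hPpmem, hQpmem, hbrLp, hirrLp, hιpmem, hιpιp, hPp, hQp, hfinPp, hfinQp, hPpQp, hdefPp, hdefQp, hadjLp,
    hsplit⟩ :=
    UnitaryLeviSetup.exists_levi_pair hbr hirr hΘ hΘΘ hP hQ hadd hsymm hPQ hdefP hdefQ hadj hB hΘB hBΘ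
  have hdich : ∀ X ∈ 𝔊, Θ * X = X → X * Θ = -X → X * ι = ι * X →
      Module.finrank ℂ (Up.map X) + Module.finrank ℂ (Um.map X) ≤ Module.finrank ℂ (LinearMap.range B) ∨
        (11 ≤ Module.finrank ℂ (Up.map X) ∧ 11 ≤ Module.finrank ℂ (Um.map X)) := fun X hX hΘX hXΘ hXc =>
    UnitaryLeviSetup.profile_dichotomy hbr hΘΘ hP hQ hadd hsymm hPQ hdefP hdefQ hadj hmin hB hΘB hBΘ hιι hιΘ hιs hUm hUp
      hPM hQM hQU hfinQU hrangeP hX hΘX hXΘ hXc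
  have hfinQU' := hfinQU
  rw [hr] at hfinQM hfinPU hfinQU hfinPm hfinQm hfinPp hfinQp hsplit hdich
  rw [hQ44] at hfinQM hfinQm hfinUm
  rw [hP39] at hfinPU hfinPp hfinUp
  have hcm : ∀ Z : Module.End ℂ W, Z * ι = ι * Z → ∀ x ∈ Um, Z x ∈ Um := fun Z hZ x hx =>
    (hUm _).2 (by rw [← Module.End.mul_apply, ← hZ, Module.End.mul_apply, (hUm x).1 hx, map_neg])
  have hcp : ∀ Z : Module.End ℂ W, Z * ι = ι * Z → ∀ x ∈ Up, Z x ∈ Up := fun Z hZ x hx =>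
    (hUp _).2 (by rw [← Module.End.mul_apply, ← hZ, Module.End.mul_apply, (hUp x).1 hx])
  have hfullm_of : Lm = ⊤ → False := fun h =>
    UnitaryLeviSetup.false_of_full_larger hbr hΘΘ hno1 hιι hιΘ hUm hUp (by omega) (by omega) hPM hQM (by omega)
      (by omega) hLm h
  have hkillm10 : ∀ X ∈ 𝔊, Θ * X = X → X * Θ = -X → X * ι = ι * X → Module.finrank ℂ (Um.map X) ≠ 10 := by
    intro X hX hΘX hXΘ hXc h10
    obtain ⟨hxmem, hιmx, hxιm, hxrk⟩ := UnitaryLeviSetup.restrict_mem hcm hLm hιmapply X hX hΘX hXΘ hXc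
    rw [h10] at hxrk
    refine hfullm_of (UnitaryDoubleLevi.eq_top_of_raise_of_core hbrLm hirrLm hιmmem hιmιm hPm hQm
      (s := fun v w : Um => s (v : W) w) (hsU Um) (fun v w => hsymm v w) hPmQm hdefPm hdefQm hadjLm hxmem hιmx hxιm
      (by rw [hxrk]; omega) (by omega) (by omega)
      fun U' 𝔩' ι' P' Q' hbr𝔩' hirr𝔩' hι' hι'ι' hP' hQ' hfinP' hfinQ' hP'Q' hdefP' hdefQ' hadj𝔩' => ?_)
    rw [hxrk] at hfinP' hfinQ'
    exact UnitaryTenTwentyThree.eq_top_of_smul hbr𝔩' hirr𝔩' hι' hι'ι' hP' hQ' hfinP' (by omega) (s := fun x y : U' => s ((x : Um) : W) y) (fun x y z => by simp only [Submodule.coe_add, hadd]) (fun c x y => by simp only [Submodule.coe_smul, hsmul]) (fun x y => hsymm _ _) hP'Q' hdefP' hdefQ' hadj𝔩'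
  have hLptop : Lp = ⊤ :=
    UnitaryEleven.eq_top_of_smul' hbrLp hirrLp hιpmem hιpιp hPp hQp (by omega) (by omega) (s := fun x y : Up => s (x : W) y) (fun x y z => by simp only [Submodule.coe_add, hadd]) (fun c x y => by simp only [Submodule.coe_smul, hsmul]) (fun x y => hsymm _ _) hPpQp hdefPp hdefQp hadjLp
  obtain ⟨T1, hιT1, hT1ι, hT1r⟩ := UnitaryRaisingSpace.exists_raise_finrank_range_eq hιpιp hPp hQp (k := 1)
    (by omega) (by omega)
  obtain ⟨X1, hX1, hΘX1, hX1Θ, hX1c, hX1Up⟩ := UnitaryLeviSetup.exists_lift hbr hΘ hΘΘ hcp hιΘ hLp hιpapply T1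
    (by rw [hLptop]; exact Submodule.mem_top) hιT1 hT1ι
  rw [hT1r] at hX1Up
  obtain ⟨hs1, hi1, hi1', hj1, hj1'⟩ := hsplit X1 hΘX1 hX1Θ hX1c
  have hrk1 := hS X1 hX1 hΘX1 hX1Θ
  have hd1 := hdich X1 hX1 hΘX1 hX1Θ hX1c
  rw [hs1] at hrk1
  rw [hX1Up] at hrk1 hd1
  have hk_hkillm10 := hkillm10 X1 hX1 hΘX1 hX1Θ hX1c
  omega

/-- `(39 | 44)`, minimal rank `12`: after the Levi kills the profiles are [(0, 0), (0, 12), (6, 6), (12, 0), (12, 12)], so `L⁺` (type `(27 | 12)`) is a `Θ`-algebra with non-zero raising ranks in `{6, 12}` — impossible by the sub-Levi lemmas. [cite: Ribet1983, Thm. 3] [cite: Gordon1997, Thm. 6.3 (3)]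
[cite: Deligne1982HodgeCycles, I §3 Prop. 3.4, 3.6] [cite: GoodmanWallachGTM255, §4.1.1] -/
theorem UnitaryThirtyNineFortyFour.no_minRank_12 [FiniteDimensional ℂ W] {𝔊 : Submodule ℂ (Module.End ℂ W)}
    (hbr : ∀ Y ∈ 𝔊, ∀ Z ∈ 𝔊, Y * Z - Z * Y ∈ 𝔊)
    (hirr : ∀ U : Submodule ℂ W, (∀ A ∈ 𝔊, ∀ u ∈ U, A u ∈ U) → U = ⊥ ∨ U = ⊤)
    {Θ : Module.End ℂ W} (hΘ : Θ ∈ 𝔊) (hΘΘ : Θ * Θ = 1)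
    {P Q : Submodule ℂ W} (hP : ∀ x, x ∈ P ↔ Θ x = x) (hQ : ∀ x, x ∈ Q ↔ Θ x = -x)
    (hP39 : Module.finrank ℂ P = 39) (hQ44 : Module.finrank ℂ Q = 44)
    {s : W → W → ℂ} (hadd : ∀ x y z, s (x + y) z = s x z + s y z)
    (hsmul : ∀ (c : ℂ) (x y : W), s (c • x) y = c * s x y) (hsymm : ∀ x y, s y x = starRingEnd ℂ (s x y))
    (hPQ : ∀ p ∈ P, ∀ q ∈ Q, s p q = 0) (hdefP : ∀ p ∈ P, s p p = 0 → p = 0) (hdefQ : ∀ q ∈ Q, s q q = 0 → q = 0)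
    (hadj : ∀ X ∈ 𝔊, ∃ Y ∈ 𝔊, ∀ x y, s (X x) y = s x (Y y))
    (hS : ∀ B' ∈ 𝔊, Θ * B' = B' → B' * Θ = -B' →
      Module.finrank ℂ (LinearMap.range B') = 0 ∨ Module.finrank ℂ (LinearMap.range B') = 12 ∨ Module.finrank ℂ (LinearMap.range B') = 14 ∨ Module.finrank ℂ (LinearMap.range B') = 15 ∨ Module.finrank ℂ (LinearMap.range B') = 16 ∨ Module.finrank ℂ (LinearMap.range B') = 17 ∨ Module.finrank ℂ (LinearMap.range B') = 18 ∨ Module.finrank ℂ (LinearMap.range B') = 19 ∨ Module.finrank ℂ (LinearMap.range B') = 20 ∨ Module.finrank ℂ (LinearMap.range B') = 21 ∨ Module.finrank ℂ (LinearMap.range B') = 22 ∨ Module.finrank ℂ (LinearMap.range B') = 23 ∨ Module.finrank ℂ (LinearMap.range B') = 24 ∨ Module.finrank ℂ (LinearMap.range B') = 25 ∨ Module.finrank ℂ (LinearMap.range B') = 26 ∨ Module.finrank ℂ (LinearMap.range B') = 27 ∨ Module.finrank ℂ (LinearMap.range B') = 28 ∨ Module.finrank ℂ (LinearMap.range B')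 = 29 ∨ Module.finrank ℂ (LinearMap.range B') = 30 ∨ Module.finrank ℂ (LinearMap.range B') = 32 ∨ Module.finrank ℂ (LinearMap.range B') = 33 ∨ Module.finrank ℂ (LinearMap.range B') = 34 ∨ Module.finrank ℂ (LinearMap.range B') = 36 ∨ Module.finrank ℂ (LinearMap.range B') = 38)
    {B : Module.End ℂ W} (hB : B ∈ 𝔊) (hΘB : Θ * B = B) (hBΘ : B * Θ = -B)
    (hr : Module.finrank ℂ (LinearMap.range B) = 12) : False := by
  classical
  have hsU : ∀ U : Submodule ℂ W, ∀ x y z : U, s ((x + y : U) : W) z = s (x : W) z + s (y : W) z :=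
    fun U x y z => by simp only [Submodule.coe_add, hadd]
  have hsmU : ∀ U : Submodule ℂ W, ∀ (c : ℂ) (x y : U), s ((c • x : U) : W) y = c * s (x : W) y :=
    fun U c x y => by simp only [Submodule.coe_smul, hsmul]
  have hno1 : ∀ B' ∈ 𝔊, Θ * B' = B' → B' * Θ = -B' → Module.finrank ℂ (LinearMap.range B') ≠ 1 := by
    intro B' hB' hΘB' hB'Θ h1
    rcases hS B' hB' hΘB' hB'Θ with h | h | h | h | h | h | h | h | h | h | h | h | h | h | h | h | h | h | h | h | h | h | h | h <;> omega
  have hmin : ∀ Y ∈ 𝔊, Θ * Y = Y → Y * Θ = -Y → Y ≠ 0 → 12 ≤ Module.finrank ℂ (LinearMap.range Y) := by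
    intro Y hY hΘY hYΘ hY0
    have h0 : Module.finrank ℂ (LinearMap.range Y) ≠ 0 := fun h =>
      hY0 (LinearMap.range_eq_bot.1 (Submodule.finrank_eq_zero.1 h))
    rcases hS Y hY hΘY hYΘ with h | h | h | h | h | h | h | h | h | h | h | h | h | h | h | h | h | h | h | h | h | h | h | h <;> omega
  have hmin' : ∀ Z ∈ 𝔊, Θ * Z = Z → Z * Θ = -Z → Z ≠ 0 → Module.finrank ℂ (LinearMap.range B) ≤ Module.finrank ℂ (LinearMap.range Z) := by
    rw [hr]; exact hmin
  obtain ⟨ι, Um, Up, PU, QU, Lm, ιm, Pm, Qm, Lp, ιp, Pp, Qp, hιmem, hιι, hιΘ, hιs, hUm, hUp, hfinUm, hfinUp,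
    hPM, hQM, hPU, hQU, hrangeP, hPUP, hQUQ, hfinQM, hfinPU, hfinQU, hLm, hLp,
    hιmapply, hPmmem, hQmmem, hbrLm, hirrLm, hιmmem, hιmιm, hPm, hQm, hfinPm, hfinQm, hPmQm, hdefPm, hdefQm, hadjLm,
    hιpapply, hPpmem, hQpmem, hbrLp, hirrLp, hιpmem, hιpιp, hPp, hQp, hfinPp, hfinQp, hPpQp, hdefPp, hdefQp, hadjLp,
    hsplit⟩ :=
    UnitaryLeviSetup.exists_levi_pair hbr hirr hΘ hΘΘ hP hQ hadd hsymm hPQ hdefP hdefQ hadj hB hΘB hBΘ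
  have hdich : ∀ X ∈ 𝔊, Θ * X = X → X * Θ = -X → X * ι = ι * X →
      Module.finrank ℂ (Up.map X) + Module.finrank ℂ (Um.map X) ≤ Module.finrank ℂ (LinearMap.range B) ∨
        (12 ≤ Module.finrank ℂ (Up.map X) ∧ 12 ≤ Module.finrank ℂ (Um.map X)) := fun X hX hΘX hXΘ hXc =>
    UnitaryLeviSetup.profile_dichotomy hbr hΘΘ hP hQ hadd hsymm hPQ hdefP hdefQ hadj hmin hB hΘB hBΘ hιι hιΘ hιs hUm hUp
      hPM hQM hQU hfinQU hrangeP hX hΘX hXΘ hXc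
  have hfinQU' := hfinQU
  rw [hr] at hfinQM hfinPU hfinQU hfinPm hfinQm hfinPp hfinQp hsplit hdich
  rw [hQ44] at hfinQM hfinQm hfinUm
  rw [hP39] at hfinPU hfinPp hfinUp
  have hcm : ∀ Z : Module.End ℂ W, Z * ι = ι * Z → ∀ x ∈ Um, Z x ∈ Um := fun Z hZ x hx =>
    (hUm _).2 (by rw [← Module.End.mul_apply, ← hZ, Module.End.mul_apply, (hUm x).1 hx, map_neg])
  have hcp : ∀ Z : Module.End ℂ W, Z * ι = ι * Z → ∀ x ∈ Up, Z x ∈ Up := fun Z hZ x hx =>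
    (hUp _).2 (by rw [← Module.End.mul_apply, ← hZ, Module.End.mul_apply, (hUp x).1 hx])
  have hfullm_of : Lm = ⊤ → False := fun h =>
    UnitaryLeviSetup.false_of_full_larger hbr hΘΘ hno1 hιι hιΘ hUm hUp (by omega) (by omega) hPM hQM (by omega)
      (by omega) hLm h
  have hkillm1 : ∀ X ∈ 𝔊, Θ * X = X → X * Θ = -X → X * ι = ι * X → Module.finrank ℂ (Um.map X) ≠ 1 := by
    intro X hX hΘX hXΘ hXc h1
    obtain ⟨hxmem, hιmx, hxιm, hxrk⟩ := UnitaryLeviSetup.restrict_mem hcm hLm hιmapply X hX hΘX hXΘ hXc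
    rw [h1] at hxrk
    exact hfullm_of (UnitaryRankOneRaise.eq_top_of_rankOne_raise hbrLm hirrLm hιmmem hιmιm hPm hQm
      (s := fun v w : Um => s (v : W) w) (hsU Um) (fun v w => hsymm v w) hPmQm hdefPm hdefQm hadjLm hxmem hιmx hxιm
      hxrk (by omega) (by omega) (by omega))
  have hkillm3 : ∀ X ∈ 𝔊, Θ * X = X → X * Θ = -X → X * ι = ι * X → Module.finrank ℂ (Um.map X) ≠ 3 := by
    intro X hX hΘX hXΘ hXc h3
    obtain ⟨hxmem, hιmx, hxιm, hxrk⟩ := UnitaryLeviSetup.restrict_mem hcm hLm hιmapply X hX hΘX hXΘ hXc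
    rw [h3] at hxrk
    refine hfullm_of (UnitaryDoubleLevi.eq_top_of_raise_of_core hbrLm hirrLm hιmmem hιmιm hPm hQm
      (s := fun v w : Um => s (v : W) w) (hsU Um) (fun v w => hsymm v w) hPmQm hdefPm hdefQm hadjLm hxmem hιmx hxιm
      (by rw [hxrk]; omega) (by omega) (by omega)
      fun U' 𝔩' ι' P' Q' hbr𝔩' hirr𝔩' hι' hι'ι' hP' hQ' hfinP' hfinQ' hP'Q' hdefP' hdefQ' hadj𝔩' => ?_)
    rw [hxrk] at hfinP' hfinQ'
    exact UnitaryThreeCoprime.eq_top hbr𝔩' hirr𝔩' hι' hι'ι' hP' hQ' hfinP' (by omega) (s := fun x y : U' => s ((x : Um) : W) y) (fun x y z => by simp only [Submodule.coe_add, hadd]) (fun x y => hsymm _ _) hP'Q' hdefP' hdefQ' hadj𝔩'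
  have hkillm5 : ∀ X ∈ 𝔊, Θ * X = X → X * Θ = -X → X * ι = ι * X → Module.finrank ℂ (Um.map X) ≠ 5 := by
    intro X hX hΘX hXΘ hXc h5
    obtain ⟨hxmem, hιmx, hxιm, hxrk⟩ := UnitaryLeviSetup.restrict_mem hcm hLm hιmapply X hX hΘX hXΘ hXc
    rw [h5] at hxrk
    refine hfullm_of (UnitaryDoubleLevi.eq_top_of_raise_of_core hbrLm hirrLm hιmmem hιmιm hPm hQm
      (s := fun v w : Um => s (v : W) w) (hsU Um) (fun v w => hsymm v w) hPmQm hdefPm hdefQm hadjLm hxmem hιmx hxιm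
      (by rw [hxrk]; omega) (by omega) (by omega)
      fun U' 𝔩' ι' P' Q' hbr𝔩' hirr𝔩' hι' hι'ι' hP' hQ' hfinP' hfinQ' hP'Q' hdefP' hdefQ' hadj𝔩' => ?_)
    rw [hxrk] at hfinP' hfinQ'
    exact UnitaryFive.eq_top_of_smul hbr𝔩' hirr𝔩' hι' hι'ι' hP' hQ' hfinP' (by omega) (s := fun x y : U' => s ((x : Um) : W) y) (fun x y z => by simp only [Submodule.coe_add, hadd]) (fun c x y => by simp only [Submodule.coe_smul, hsmul]) (fun x y => hsymm _ _) hP'Q' hdefP' hdefQ' hadj𝔩'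
  have hkillm7 : ∀ X ∈ 𝔊, Θ * X = X → X * Θ = -X → X * ι = ι * X → Module.finrank ℂ (Um.map X) ≠ 7 := by
    intro X hX hΘX hXΘ hXc h7
    obtain ⟨hxmem, hιmx, hxιm, hxrk⟩ := UnitaryLeviSetup.restrict_mem hcm hLm hιmapply X hX hΘX hXΘ hXc
    rw [h7] at hxrk
    refine hfullm_of (UnitaryDoubleLevi.eq_top_of_raise_of_core hbrLm hirrLm hιmmem hιmιm hPm hQm
      (s := fun v w : Um => s (v : W) w) (hsU Um) (fun v w => hsymm v w) hPmQm hdefPm hdefQm hadjLm hxmem hιmx hxιm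
      (by rw [hxrk]; omega) (by omega) (by omega)
      fun U' 𝔩' ι' P' Q' hbr𝔩' hirr𝔩' hι' hι'ι' hP' hQ' hfinP' hfinQ' hP'Q' hdefP' hdefQ' hadj𝔩' => ?_)
    rw [hxrk] at hfinP' hfinQ'
    exact UnitarySeven.eq_top_of_smul hbr𝔩' hirr𝔩' hι' hι'ι' hP' hQ' hfinP' (by omega) (s := fun x y : U' => s ((x : Um) : W) y) (fun x y z => by simp only [Submodule.coe_add, hadd]) (fun c x y => by simp only [Submodule.coe_smul, hsmul]) (fun x y => hsymm _ _) hP'Q' hdefP' hdefQ' hadj𝔩'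
  have hkillm9 : ∀ X ∈ 𝔊, Θ * X = X → X * Θ = -X → X * ι = ι * X → Module.finrank ℂ (Um.map X) ≠ 9 := by
    intro X hX hΘX hXΘ hXc h9
    obtain ⟨hxmem, hιmx, hxιm, hxrk⟩ := UnitaryLeviSetup.restrict_mem hcm hLm hιmapply X hX hΘX hXΘ hXc
    rw [h9] at hxrk
    refine hfullm_of (UnitaryDoubleLevi.eq_top_of_raise_of_core hbrLm hirrLm hιmmem hιmιm hPm hQm
      (s := fun v w : Um => s (v : W) w) (hsU Um) (fun v w => hsymm v w) hPmQm hdefPm hdefQm hadjLm hxmem hιmx hxιm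
      (by rw [hxrk]; omega) (by omega) (by omega)
      fun U' 𝔩' ι' P' Q' hbr𝔩' hirr𝔩' hι' hι'ι' hP' hQ' hfinP' hfinQ' hP'Q' hdefP' hdefQ' hadj𝔩' => ?_)
    rw [hxrk] at hfinP' hfinQ'
    exact UnitaryNineTwentyThree.eq_top_of_smul hbr𝔩' hirr𝔩' hι' hι'ι' hP' hQ' hfinP' (by omega) (s := fun x y : U' => s ((x : Um) : W) y) (fun x y z => by simp only [Submodule.coe_add, hadd]) (fun c x y => by simp only [Submodule.coe_smul, hsmul]) (fun x y => hsymm _ _) hP'Q' hdefP' hdefQ' hadj𝔩'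
  have hkillm11 : ∀ X ∈ 𝔊, Θ * X = X → X * Θ = -X → X * ι = ι * X → Module.finrank ℂ (Um.map X) ≠ 11 := by
    intro X hX hΘX hXΘ hXc h11
    obtain ⟨hxmem, hιmx, hxιm, hxrk⟩ := UnitaryLeviSetup.restrict_mem hcm hLm hιmapply X hX hΘX hXΘ hXc
    rw [h11] at hxrk
    refine hfullm_of (UnitaryDoubleLevi.eq_top_of_raise_of_core hbrLm hirrLm hιmmem hιmιm hPm hQm
      (s := fun v w : Um => s (v : W) w) (hsU Um) (fun v w => hsymm v w) hPmQm hdefPm hdefQm hadjLm hxmem hιmx hxιm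
      (by rw [hxrk]; omega) (by omega) (by omega)
      fun U' 𝔩' ι' P' Q' hbr𝔩' hirr𝔩' hι' hι'ι' hP' hQ' hfinP' hfinQ' hP'Q' hdefP' hdefQ' hadj𝔩' => ?_)
    rw [hxrk] at hfinP' hfinQ'
    exact UnitaryEleven.eq_top_of_smul hbr𝔩' hirr𝔩' hι' hι'ι' hP' hQ' hfinP' (by omega) (s := fun x y : U' => s ((x : Um) : W) y) (fun x y z => by simp only [Submodule.coe_add, hadd]) (fun c x y => by simp only [Submodule.coe_smul, hsmul]) (fun x y => hsymm _ _) hP'Q' hdefP' hdefQ' hadj𝔩'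
  have hfullp_of : Lp = ⊤ → False := by
    intro hLptop
    obtain ⟨T1, hιT1, hT1ι, hT1r⟩ := UnitaryRaisingSpace.exists_raise_finrank_range_eq hιpιp hPp hQp (k := 1)
      (by omega) (by omega)
    obtain ⟨X1, hX1, hΘX1, hX1Θ, hX1c, hX1Up⟩ := UnitaryLeviSetup.exists_lift hbr hΘ hΘΘ hcp hιΘ hLp hιpapply T1
      (by rw [hLptop]; exact Submodule.mem_top) hιT1 hT1ι
    rw [hT1r] at hX1Up
    obtain ⟨hs1, hi1, hi1', hj1, hj1'⟩ := hsplit X1 hΘX1 hX1Θ hX1c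
    have hrk1 := hS X1 hX1 hΘX1 hX1Θ
    have hd1 := hdich X1 hX1 hΘX1 hX1Θ hX1c
    rw [hs1] at hrk1
    rw [hX1Up] at hrk1 hd1
    have hk_hkillm11 := hkillm11 X1 hX1 hΘX1 hX1Θ hX1c
    omega
  have hkillp2 : ∀ X ∈ 𝔊, Θ * X = X → X * Θ = -X → X * ι = ι * X → Module.finrank ℂ (Up.map X) ≠ 2 := by
    intro X hX hΘX hXΘ hXc h2
    obtain ⟨hymem, hιpy, hyιp, hyrk⟩ := UnitaryLeviSetup.restrict_mem hcp hLp hιpapply X hX hΘX hXΘ hXc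
    rw [h2] at hyrk
    refine hfullp_of (UnitaryDoubleLevi.eq_top_of_raise_of_core' hbrLp hirrLp hιpmem hιpιp hPp hQp
      (s := fun v w : Up => s (v : W) w) (hsU Up) (fun v w => hsymm v w) hPpQp hdefPp hdefQp hadjLp hymem hιpy hyιp
      (by rw [hyrk]; omega) (by omega) (by omega)
      fun U' 𝔩' ι' P' Q' hbr𝔩' hirr𝔩' hι' hι'ι' hP' hQ' hfinP' hfinQ' hP'Q' hdefP' hdefQ' hadj𝔩' => ?_)
    rw [hyrk] at hfinP' hfinQ'
    exact UnitaryTwoOdd.eq_top hbr𝔩' hirr𝔩' hι' hι'ι' hP' hQ' hfinP' ⟨12, by omega⟩ (s := fun x y : U' => s ((x : Up) : W) y) (fun x y z => by simp only [Submodule.coe_add, hadd]) (fun x y => hsymm _ _) hP'Q' hdefP' hdefQ' hadj𝔩'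
  have hkillp4 : ∀ X ∈ 𝔊, Θ * X = X → X * Θ = -X → X * ι = ι * X → Module.finrank ℂ (Up.map X) ≠ 4 := by
    intro X hX hΘX hXΘ hXc h4
    obtain ⟨hymem, hιpy, hyιp, hyrk⟩ := UnitaryLeviSetup.restrict_mem hcp hLp hιpapply X hX hΘX hXΘ hXc
    rw [h4] at hyrk
    refine hfullp_of (UnitaryDoubleLevi.eq_top_of_raise_of_core' hbrLp hirrLp hιpmem hιpιp hPp hQp
      (s := fun v w : Up => s (v : W) w) (hsU Up) (fun v w => hsymm v w) hPpQp hdefPp hdefQp hadjLp hymem hιpy hyιp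
      (by rw [hyrk]; omega) (by omega) (by omega)
      fun U' 𝔩' ι' P' Q' hbr𝔩' hirr𝔩' hι' hι'ι' hP' hQ' hfinP' hfinQ' hP'Q' hdefP' hdefQ' hadj𝔩' => ?_)
    rw [hyrk] at hfinP' hfinQ'
    exact UnitaryFourOdd.eq_top hbr𝔩' hirr𝔩' hι' hι'ι' hP' hQ' hfinP' ⟨11, by omega⟩ (s := fun x y : U' => s ((x : Up) : W) y) (fun x y z => by simp only [Submodule.coe_add, hadd]) (fun x y => hsymm _ _) hP'Q' hdefP' hdefQ' hadj𝔩'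
  have hkillp8 : ∀ X ∈ 𝔊, Θ * X = X → X * Θ = -X → X * ι = ι * X → Module.finrank ℂ (Up.map X) ≠ 8 := by
    intro X hX hΘX hXΘ hXc h8
    obtain ⟨hymem, hιpy, hyιp, hyrk⟩ := UnitaryLeviSetup.restrict_mem hcp hLp hιpapply X hX hΘX hXΘ hXc
    rw [h8] at hyrk
    refine hfullp_of (UnitaryDoubleLevi.eq_top_of_raise_of_core' hbrLp hirrLp hιpmem hιpιp hPp hQp
      (s := fun v w : Up => s (v : W) w) (hsU Up) (fun v w => hsymm v w) hPpQp hdefPp hdefQp hadjLp hymem hιpy hyιp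
      (by rw [hyrk]; omega) (by omega) (by omega)
      fun U' 𝔩' ι' P' Q' hbr𝔩' hirr𝔩' hι' hι'ι' hP' hQ' hfinP' hfinQ' hP'Q' hdefP' hdefQ' hadj𝔩' => ?_)
    rw [hyrk] at hfinP' hfinQ'
    exact UnitaryEight.eq_top_of_smul_nineteen hbr𝔩' hirr𝔩' hι' hι'ι' hP' hQ' hfinP' (by omega) (s := fun x y : U' => s ((x : Up) : W) y) (fun x y z => by simp only [Submodule.coe_add, hadd]) (fun c x y => by simp only [Submodule.coe_smul, hsmul]) (fun x y => hsymm _ _) hP'Q' hdefP' hdefQ' hadj𝔩'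
  have hkillp10 : ∀ X ∈ 𝔊, Θ * X = X → X * Θ = -X → X * ι = ι * X → Module.finrank ℂ (Up.map X) ≠ 10 := by
    intro X hX hΘX hXΘ hXc h10
    obtain ⟨hymem, hιpy, hyιp, hyrk⟩ := UnitaryLeviSetup.restrict_mem hcp hLp hιpapply X hX hΘX hXΘ hXc
    rw [h10] at hyrk
    refine hfullp_of (UnitaryDoubleLevi.eq_top_of_raise_of_core' hbrLp hirrLp hιpmem hιpιp hPp hQp
      (s := fun v w : Up => s (v : W) w) (hsU Up) (fun v w => hsymm v w) hPpQp hdefPp hdefQp hadjLp hymem hιpy hyιp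
      (by rw [hyrk]; omega) (by omega) (by omega)
      fun U' 𝔩' ι' P' Q' hbr𝔩' hirr𝔩' hι' hι'ι' hP' hQ' hfinP' hfinQ' hP'Q' hdefP' hdefQ' hadj𝔩' => ?_)
    rw [hyrk] at hfinP' hfinQ'
    exact UnitarySeventeen.eq_top_of_smul hbr𝔩' hirr𝔩' hι' hι'ι' hP' hQ' (by omega) (by omega) (by omega) (s := fun x y : U' => s ((x : Up) : W) y) (fun x y z => by simp only [Submodule.coe_add, hadd]) (fun c x y => by simp only [Submodule.coe_smul, hsmul]) (fun x y => hsymm _ _) hP'Q' hdefP' hdefQ' hadj𝔩'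
  have hprof : ∀ X ∈ 𝔊, Θ * X = X → X * Θ = -X → X * ι = ι * X →
      (Module.finrank ℂ (Up.map X) = 0 ∧ Module.finrank ℂ (Um.map X) = 0) ∨
        (Module.finrank ℂ (Up.map X) = 0 ∧ Module.finrank ℂ (Um.map X) = 12) ∨
        (Module.finrank ℂ (Up.map X) = 6 ∧ Module.finrank ℂ (Um.map X) = 6) ∨
        (Module.finrank ℂ (Up.map X) = 12 ∧ Module.finrank ℂ (Um.map X) = 0) ∨
        (Module.finrank ℂ (Up.map X) = 12 ∧ Module.finrank ℂ (Um.map X) = 12) := by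
    intro X hX hΘX hXΘ hXc
    obtain ⟨hs, hi, hi', hj, hj'⟩ := hsplit X hΘX hXΘ hXc
    have hkillm1' := hkillm1 X hX hΘX hXΘ hXc
    have hkillm3' := hkillm3 X hX hΘX hXΘ hXc
    have hkillm5' := hkillm5 X hX hΘX hXΘ hXc
    have hkillm7' := hkillm7 X hX hΘX hXΘ hXc
    have hkillm9' := hkillm9 X hX hΘX hXΘ hXc
    have hkillm11' := hkillm11 X hX hΘX hXΘ hXc
    have hkillp2' := hkillp2 X hX hΘX hXΘ hXc
    have hkillp4' := hkillp4 X hX hΘX hXΘ hXc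
    have hkillp8' := hkillp8 X hX hΘX hXΘ hXc
    have hkillp10' := hkillp10 X hX hΘX hXΘ hXc
    have hrk := hS X hX hΘX hXΘ
    have hd := hdich X hX hΘX hXΘ hXc
    rw [hs] at hrk
    generalize Module.finrank ℂ ↥(Submodule.map X Um) = jj at *
    have hjle : jj ≤ 12 := by omega
    interval_cases jj
    · rcases (show Module.finrank ℂ (Up.map X) = 0 ∨ Module.finrank ℂ (Up.map X) = 12 by omega) with h | h
      · exact Or.inl ⟨h, rfl⟩
      · exact Or.inr (Or.inr (Or.inr (Or.inl ⟨h, rfl⟩)))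
    · exact (hkillm1' rfl).elim
    · exfalso; omega
    · exact (hkillm3' rfl).elim
    · exfalso; omega
    · exact (hkillm5' rfl).elim
    · exact Or.inr (Or.inr (Or.inl ⟨by omega, rfl⟩))
    · exact (hkillm7' rfl).elim
    · exfalso; omega
    · exact (hkillm9' rfl).elim
    · exfalso; omega
    · exact (hkillm11' rfl).elim
    · rcases (show Module.finrank ℂ (Up.map X) = 0 ∨ Module.finrank ℂ (Up.map X) = 12 by omega) with h | h
      · exact Or.inr (Or.inl ⟨h, rfl⟩)
      · exact Or.inr (Or.inr (Or.inr (Or.inr (⟨h, rfl⟩))))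
  obtain ⟨⟨p, hp⟩, hp0⟩ := Module.finrank_pos_iff_exists_ne_zero.1 (show 0 < Module.finrank ℂ PU by omega)
  obtain ⟨⟨q, hq⟩, hq0⟩ := Module.finrank_pos_iff_exists_ne_zero.1 (show 0 < Module.finrank ℂ QU by omega)
  obtain ⟨X₀, hX₀, hΘX₀, hX₀Θ, hX₀c, c₀, hιc₀, -, hX₀c0⟩ :=
    UnitaryLeviFull.exists_raise_commute_apply_ne_zero hbr hirr hΘ hΘΘ hQ hιmem hιι hιΘ hUm hUp
      ⟨p, fun h => hp0 (Subtype.ext h), ((hPU p).1 hp).1, ((hPU p).1 hp).2⟩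
      ⟨q, fun h => hq0 (Subtype.ext h), ((hQU q).1 hq).1, ((hQU q).1 hq).2⟩
  have hX₀i : Module.finrank ℂ (Up.map X₀) ≠ 0 := fun h0 => by
    have hmem : X₀ c₀ ∈ Up.map X₀ := Submodule.mem_map_of_mem ((hUp c₀).2 hιc₀)
    rw [Submodule.finrank_eq_zero.1 h0, Submodule.mem_bot] at hmem
    exact hX₀c0 hmem
  -- the raising ranks of `L⁺` lie in {0, 6, 12}
  have hSsub : ∀ A ∈ Lp, ιp * A = A → A * ιp = -A → Module.finrank ℂ (LinearMap.range A) = 0 ∨ Module.finrank ℂ (LinearMap.range A) = 6 ∨ Module.finrank ℂ (LinearMap.range A) = 12 := by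
    intro A hA hιA hAι
    by_cases hA0 : A = 0
    · exact Or.inl (by rw [hA0, LinearMap.range_zero, finrank_bot])
    · obtain ⟨XA, hXA, hΘXA, hXAΘ, hXAc, hXAU⟩ := UnitaryLeviSetup.exists_lift hbr hΘ hΘΘ hcp hιΘ hLp hιpapply A hA hιA hAι
      have hA0' : Module.finrank ℂ (LinearMap.range A) ≠ 0 := fun h =>
        hA0 (LinearMap.range_eq_bot.1 (Submodule.finrank_eq_zero.1 h))
      have hpA := hprof XA hXA hΘXA hXAΘ hXAc
      rw [← hXAU] at hA0' ⊢
      omega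
  obtain ⟨hymem, hιy, hyι, hyrk⟩ := UnitaryLeviSetup.restrict_mem hcp hLp hιpapply X₀ hX₀ hΘX₀ hX₀Θ hX₀c
  obtain ⟨A₀, hA₀, hιA₀, hA₀ι, hA₀0, hA₀min⟩ := UnitaryRaisingSpace.exists_minRank_raise Lp ιp
    ⟨_, hymem, hιy, hyι, fun h => by rw [h, LinearMap.range_zero, finrank_bot] at hyrk; omega⟩
  have hr0 : Module.finrank ℂ (LinearMap.range A₀) ≠ 0 := fun h =>
    hA₀0 (LinearMap.range_eq_bot.1 (Submodule.finrank_eq_zero.1 h))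
  rcases hSsub A₀ hA₀ hιA₀ hA₀ι with hrA | hrA | hrA
  · exact hr0 hrA
  · refine UnitaryThirtyNineFortyFour.subTwentySevenTwelve_ranks6_12_min6 hbrLp hirrLp hιpmem hιpιp hPp hQp (by omega) (by omega)
      (s := fun v w : Up => s (v : W) w) (hsU Up) (hsmU Up) (fun v w => hsymm v w) hPpQp hdefPp hdefQp hadjLp
      (fun A hA hιA hAι => ?_) hA₀ hιA₀ hA₀ι hrA
    have h1 := hSsub A hA hιA hAι
    by_cases hA0 : A = 0
    · exact Or.inl (by rw [hA0, LinearMap.range_zero, finrank_bot])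
    · have h2 := hA₀min A hA hιA hAι hA0
      omega
  · refine UnitaryTwentyEightThirtyNine.subTwentySevenTwelve_rank12 hbrLp hirrLp hιpmem hιpιp hPp hQp (by omega) (by omega)
      (s := fun v w : Up => s (v : W) w) (hsU Up) (hsmU Up) (fun v w => hsymm v w) hPpQp hdefPp hdefQp hadjLp
      (fun A hA hιA hAι => ?_) hA₀ hιA₀ hA₀ι hrA
    have h1 := hSsub A hA hιA hAι
    by_cases hA0 : A = 0
    · exact Or.inl (by rw [hA0, LinearMap.range_zero, finrank_bot])
    · have h2 := hA₀min A hA hιA hAι hA0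
      omega

/-- `(39 | 44)`, minimal rank `14`: the non-zero profiles [(0, 14), (5, 9), (9, 5), (10, 4)] are pairwise exclusive, so constant; `(5, 9)`: `L⁺` (type `(25 | 14)`) has constant rank `5`; `(9, 5)`: `L⁺` (type `(25 | 14)`) has constant rank `9`; `(10, 4)`: `L⁺` (type `(25 | 14)`) has constant rank `10`. [cite: Ribet1983, Thm. 3] [cite: Gordon1997, Thm. 6.3 (3)]
[cite: Deligne1982HodgeCycles, I §3 Prop. 3.4, 3.6] [cite: GoodmanWallachGTM255, §4.1.1] -/
theorem UnitaryThirtyNineFortyFour.no_minRank_14 [FiniteDimensional ℂ W] {𝔊 : Submodule ℂ (Module.End ℂ W)}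
    (hbr : ∀ Y ∈ 𝔊, ∀ Z ∈ 𝔊, Y * Z - Z * Y ∈ 𝔊)
    (hirr : ∀ U : Submodule ℂ W, (∀ A ∈ 𝔊, ∀ u ∈ U, A u ∈ U) → U = ⊥ ∨ U = ⊤)
    {Θ : Module.End ℂ W} (hΘ : Θ ∈ 𝔊) (hΘΘ : Θ * Θ = 1)
    {P Q : Submodule ℂ W} (hP : ∀ x, x ∈ P ↔ Θ x = x) (hQ : ∀ x, x ∈ Q ↔ Θ x = -x)
    (hP39 : Module.finrank ℂ P = 39) (hQ44 : Module.finrank ℂ Q = 44)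
    {s : W → W → ℂ} (hadd : ∀ x y z, s (x + y) z = s x z + s y z)
    (hsmul : ∀ (c : ℂ) (x y : W), s (c • x) y = c * s x y) (hsymm : ∀ x y, s y x = starRingEnd ℂ (s x y))
    (hPQ : ∀ p ∈ P, ∀ q ∈ Q, s p q = 0) (hdefP : ∀ p ∈ P, s p p = 0 → p = 0) (hdefQ : ∀ q ∈ Q, s q q = 0 → q = 0)
    (hadj : ∀ X ∈ 𝔊, ∃ Y ∈ 𝔊, ∀ x y, s (X x) y = s x (Y y))
    (hS : ∀ B' ∈ 𝔊, Θ * B' = B' → B' * Θ = -B' →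
      Module.finrank ℂ (LinearMap.range B') = 0 ∨ Module.finrank ℂ (LinearMap.range B') = 14 ∨ Module.finrank ℂ (LinearMap.range B') = 15 ∨ Module.finrank ℂ (LinearMap.range B') = 16 ∨ Module.finrank ℂ (LinearMap.range B') = 17 ∨ Module.finrank ℂ (LinearMap.range B') = 18 ∨ Module.finrank ℂ (LinearMap.range B') = 19 ∨ Module.finrank ℂ (LinearMap.range B') = 20 ∨ Module.finrank ℂ (LinearMap.range B') = 21 ∨ Module.finrank ℂ (LinearMap.range B') = 22 ∨ Module.finrank ℂ (LinearMap.range B') = 23 ∨ Module.finrank ℂ (LinearMap.range B') = 24 ∨ Module.finrank ℂ (LinearMap.range B') = 25 ∨ Module.finrank ℂ (LinearMap.range B') = 26 ∨ Module.finrank ℂ (LinearMap.range B') = 27 ∨ Module.finrank ℂ (LinearMap.range B') = 28 ∨ Module.finrank ℂ (LinearMap.range B') = 29 ∨ Module.finrank ℂ (LinearMap.range B') = 30 ∨ Module.finrank ℂ (LinearMap.range B') = 32 ∨ Module.finrank ℂ (LinearMap.range B') = 33 ∨ Module.finrank ℂ (LinearMap.range B') = 34 ∨ Module.finrank ℂ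 (LinearMap.range B') = 36 ∨ Module.finrank ℂ (LinearMap.range B') = 38)
    {B : Module.End ℂ W} (hB : B ∈ 𝔊) (hΘB : Θ * B = B) (hBΘ : B * Θ = -B)
    (hr : Module.finrank ℂ (LinearMap.range B) = 14) : False := by
  classical
  have hsU : ∀ U : Submodule ℂ W, ∀ x y z : U, s ((x + y : U) : W) z = s (x : W) z + s (y : W) z :=
    fun U x y z => by simp only [Submodule.coe_add, hadd]
  have hsmU : ∀ U : Submodule ℂ W, ∀ (c : ℂ) (x y : U), s ((c • x : U) : W) y = c * s (x : W) y :=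
    fun U c x y => by simp only [Submodule.coe_smul, hsmul]
  have hno1 : ∀ B' ∈ 𝔊, Θ * B' = B' → B' * Θ = -B' → Module.finrank ℂ (LinearMap.range B') ≠ 1 := by
    intro B' hB' hΘB' hB'Θ h1
    rcases hS B' hB' hΘB' hB'Θ with h | h | h | h | h | h | h | h | h | h | h | h | h | h | h | h | h | h | h | h | h | h | h <;> omega
  have hmin : ∀ Y ∈ 𝔊, Θ * Y = Y → Y * Θ = -Y → Y ≠ 0 → 14 ≤ Module.finrank ℂ (LinearMap.range Y) := by
    intro Y hY hΘY hYΘ hY0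
    have h0 : Module.finrank ℂ (LinearMap.range Y) ≠ 0 := fun h =>
      hY0 (LinearMap.range_eq_bot.1 (Submodule.finrank_eq_zero.1 h))
    rcases hS Y hY hΘY hYΘ with h | h | h | h | h | h | h | h | h | h | h | h | h | h | h | h | h | h | h | h | h | h | h <;> omega
  have hmin' : ∀ Z ∈ 𝔊, Θ * Z = Z → Z * Θ = -Z → Z ≠ 0 → Module.finrank ℂ (LinearMap.range B) ≤ Module.finrank ℂ (LinearMap.range Z) := by
    rw [hr]; exact hmin
  obtain ⟨ι, Um, Up, PU, QU, Lm, ιm, Pm, Qm, Lp, ιp, Pp, Qp, hιmem, hιι, hιΘ, hιs, hUm, hUp, hfinUm, hfinUp,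
    hPM, hQM, hPU, hQU, hrangeP, hPUP, hQUQ, hfinQM, hfinPU, hfinQU, hLm, hLp,
    hιmapply, hPmmem, hQmmem, hbrLm, hirrLm, hιmmem, hιmιm, hPm, hQm, hfinPm, hfinQm, hPmQm, hdefPm, hdefQm, hadjLm,
    hιpapply, hPpmem, hQpmem, hbrLp, hirrLp, hιpmem, hιpιp, hPp, hQp, hfinPp, hfinQp, hPpQp, hdefPp, hdefQp, hadjLp,
    hsplit⟩ :=
    UnitaryLeviSetup.exists_levi_pair hbr hirr hΘ hΘΘ hP hQ hadd hsymm hPQ hdefP hdefQ hadj hB hΘB hBΘ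
  have hdich : ∀ X ∈ 𝔊, Θ * X = X → X * Θ = -X → X * ι = ι * X →
      Module.finrank ℂ (Up.map X) + Module.finrank ℂ (Um.map X) ≤ Module.finrank ℂ (LinearMap.range B) ∨
        (14 ≤ Module.finrank ℂ (Up.map X) ∧ 14 ≤ Module.finrank ℂ (Um.map X)) := fun X hX hΘX hXΘ hXc =>
    UnitaryLeviSetup.profile_dichotomy hbr hΘΘ hP hQ hadd hsymm hPQ hdefP hdefQ hadj hmin hB hΘB hBΘ hιι hιΘ hιs hUm hUp
      hPM hQM hQU hfinQU hrangeP hX hΘX hXΘ hXc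
  have hfinQU' := hfinQU
  rw [hr] at hfinQM hfinPU hfinQU hfinPm hfinQm hfinPp hfinQp hsplit hdich
  rw [hQ44] at hfinQM hfinQm hfinUm
  rw [hP39] at hfinPU hfinPp hfinUp
  have hcm : ∀ Z : Module.End ℂ W, Z * ι = ι * Z → ∀ x ∈ Um, Z x ∈ Um := fun Z hZ x hx =>
    (hUm _).2 (by rw [← Module.End.mul_apply, ← hZ, Module.End.mul_apply, (hUm x).1 hx, map_neg])
  have hcp : ∀ Z : Module.End ℂ W, Z * ι = ι * Z → ∀ x ∈ Up, Z x ∈ Up := fun Z hZ x hx =>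
    (hUp _).2 (by rw [← Module.End.mul_apply, ← hZ, Module.End.mul_apply, (hUp x).1 hx])
  have hfullm_of : Lm = ⊤ → False := fun h =>
    UnitaryLeviSetup.false_of_full_larger hbr hΘΘ hno1 hιι hιΘ hUm hUp (by omega) (by omega) hPM hQM (by omega)
      (by omega) hLm h
  have hkillm1 : ∀ X ∈ 𝔊, Θ * X = X → X * Θ = -X → X * ι = ι * X → Module.finrank ℂ (Um.map X) ≠ 1 := by
    intro X hX hΘX hXΘ hXc h1
    obtain ⟨hxmem, hιmx, hxιm, hxrk⟩ := UnitaryLeviSetup.restrict_mem hcm hLm hιmapply X hX hΘX hXΘ hXc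
    rw [h1] at hxrk
    exact hfullm_of (UnitaryRankOneRaise.eq_top_of_rankOne_raise hbrLm hirrLm hιmmem hιmιm hPm hQm
      (s := fun v w : Um => s (v : W) w) (hsU Um) (fun v w => hsymm v w) hPmQm hdefPm hdefQm hadjLm hxmem hιmx hxιm
      hxrk (by omega) (by omega) (by omega))
  have hkillm7 : ∀ X ∈ 𝔊, Θ * X = X → X * Θ = -X → X * ι = ι * X → Module.finrank ℂ (Um.map X) ≠ 7 := by
    intro X hX hΘX hXΘ hXc h7
    obtain ⟨hxmem, hιmx, hxιm, hxrk⟩ := UnitaryLeviSetup.restrict_mem hcm hLm hιmapply X hX hΘX hXΘ hXc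
    rw [h7] at hxrk
    refine hfullm_of (UnitaryDoubleLevi.eq_top_of_raise_of_core hbrLm hirrLm hιmmem hιmιm hPm hQm
      (s := fun v w : Um => s (v : W) w) (hsU Um) (fun v w => hsymm v w) hPmQm hdefPm hdefQm hadjLm hxmem hιmx hxιm
      (by rw [hxrk]; omega) (by omega) (by omega)
      fun U' 𝔩' ι' P' Q' hbr𝔩' hirr𝔩' hι' hι'ι' hP' hQ' hfinP' hfinQ' hP'Q' hdefP' hdefQ' hadj𝔩' => ?_)
    rw [hxrk] at hfinP' hfinQ'
    exact UnitarySeven.eq_top_of_smul hbr𝔩' hirr𝔩' hι' hι'ι' hP' hQ' hfinP' (by omega) (s := fun x y : U' => s ((x : Um) : W) y) (fun x y z => by simp only [Submodule.coe_add, hadd]) (fun c x y => by simp only [Submodule.coe_smul, hsmul]) (fun x y => hsymm _ _) hP'Q' hdefP' hdefQ' hadj𝔩'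
  have hkillm11 : ∀ X ∈ 𝔊, Θ * X = X → X * Θ = -X → X * ι = ι * X → Module.finrank ℂ (Um.map X) ≠ 11 := by
    intro X hX hΘX hXΘ hXc h11
    obtain ⟨hxmem, hιmx, hxιm, hxrk⟩ := UnitaryLeviSetup.restrict_mem hcm hLm hιmapply X hX hΘX hXΘ hXc
    rw [h11] at hxrk
    refine hfullm_of (UnitaryDoubleLevi.eq_top_of_raise_of_core hbrLm hirrLm hιmmem hιmιm hPm hQm
      (s := fun v w : Um => s (v : W) w) (hsU Um) (fun v w => hsymm v w) hPmQm hdefPm hdefQm hadjLm hxmem hιmx hxιm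
      (by rw [hxrk]; omega) (by omega) (by omega)
      fun U' 𝔩' ι' P' Q' hbr𝔩' hirr𝔩' hι' hι'ι' hP' hQ' hfinP' hfinQ' hP'Q' hdefP' hdefQ' hadj𝔩' => ?_)
    rw [hxrk] at hfinP' hfinQ'
    exact UnitaryEleven.eq_top_of_smul hbr𝔩' hirr𝔩' hι' hι'ι' hP' hQ' hfinP' (by omega) (s := fun x y : U' => s ((x : Um) : W) y) (fun x y z => by simp only [Submodule.coe_add, hadd]) (fun c x y => by simp only [Submodule.coe_smul, hsmul]) (fun x y => hsymm _ _) hP'Q' hdefP' hdefQ' hadj𝔩'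
  have hkillm13 : ∀ X ∈ 𝔊, Θ * X = X → X * Θ = -X → X * ι = ι * X → Module.finrank ℂ (Um.map X) ≠ 13 := by
    intro X hX hΘX hXΘ hXc h13
    obtain ⟨hxmem, hιmx, hxιm, hxrk⟩ := UnitaryLeviSetup.restrict_mem hcm hLm hιmapply X hX hΘX hXΘ hXc
    rw [h13] at hxrk
    refine hfullm_of (UnitaryDoubleLevi.eq_top_of_raise_of_core hbrLm hirrLm hιmmem hιmιm hPm hQm
      (s := fun v w : Um => s (v : W) w) (hsU Um) (fun v w => hsymm v w) hPmQm hdefPm hdefQm hadjLm hxmem hιmx hxιm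
      (by rw [hxrk]; omega) (by omega) (by omega)
      fun U' 𝔩' ι' P' Q' hbr𝔩' hirr𝔩' hι' hι'ι' hP' hQ' hfinP' hfinQ' hP'Q' hdefP' hdefQ' hadj𝔩' => ?_)
    rw [hxrk] at hfinP' hfinQ'
    exact UnitaryThirteen.eq_top_of_smul hbr𝔩' hirr𝔩' hι' hι'ι' hP' hQ' hfinP' (by omega) (s := fun x y : U' => s ((x : Um) : W) y) (fun x y z => by simp only [Submodule.coe_add, hadd]) (fun c x y => by simp only [Submodule.coe_smul, hsmul]) (fun x y => hsymm _ _) hP'Q' hdefP' hdefQ' hadj𝔩'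
  have hfullp_of : Lp = ⊤ → False := by
    intro hLptop
    obtain ⟨T1, hιT1, hT1ι, hT1r⟩ := UnitaryRaisingSpace.exists_raise_finrank_range_eq hιpιp hPp hQp (k := 1)
      (by omega) (by omega)
    obtain ⟨X1, hX1, hΘX1, hX1Θ, hX1c, hX1Up⟩ := UnitaryLeviSetup.exists_lift hbr hΘ hΘΘ hcp hιΘ hLp hιpapply T1
      (by rw [hLptop]; exact Submodule.mem_top) hιT1 hT1ι
    rw [hT1r] at hX1Up
    obtain ⟨hs1, hi1, hi1', hj1, hj1'⟩ := hsplit X1 hΘX1 hX1Θ hX1c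
    have hrk1 := hS X1 hX1 hΘX1 hX1Θ
    have hd1 := hdich X1 hX1 hΘX1 hX1Θ hX1c
    rw [hs1] at hrk1
    rw [hX1Up] at hrk1 hd1
    have hk_hkillm13 := hkillm13 X1 hX1 hΘX1 hX1Θ hX1c
    omega
  have hkillp2 : ∀ X ∈ 𝔊, Θ * X = X → X * Θ = -X → X * ι = ι * X → Module.finrank ℂ (Up.map X) ≠ 2 := by
    intro X hX hΘX hXΘ hXc h2
    obtain ⟨hymem, hιpy, hyιp, hyrk⟩ := UnitaryLeviSetup.restrict_mem hcp hLp hιpapply X hX hΘX hXΘ hXc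
    rw [h2] at hyrk
    refine hfullp_of (UnitaryDoubleLevi.eq_top_of_raise_of_core' hbrLp hirrLp hιpmem hιpιp hPp hQp
      (s := fun v w : Up => s (v : W) w) (hsU Up) (fun v w => hsymm v w) hPpQp hdefPp hdefQp hadjLp hymem hιpy hyιp
      (by rw [hyrk]; omega) (by omega) (by omega)
      fun U' 𝔩' ι' P' Q' hbr𝔩' hirr𝔩' hι' hι'ι' hP' hQ' hfinP' hfinQ' hP'Q' hdefP' hdefQ' hadj𝔩' => ?_)
    rw [hyrk] at hfinP' hfinQ'
    exact UnitaryTwoOdd.eq_top hbr𝔩' hirr𝔩' hι' hι'ι' hP' hQ' hfinP' ⟨11, by omega⟩ (s := fun x y : U' => s ((x : Up) : W) y) (fun x y z => by simp only [Submodule.coe_add, hadd]) (fun x y => hsymm _ _) hP'Q' hdefP' hdefQ' hadj𝔩'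
  have hkillp4 : ∀ X ∈ 𝔊, Θ * X = X → X * Θ = -X → X * ι = ι * X → Module.finrank ℂ (Up.map X) ≠ 4 := by
    intro X hX hΘX hXΘ hXc h4
    obtain ⟨hymem, hιpy, hyιp, hyrk⟩ := UnitaryLeviSetup.restrict_mem hcp hLp hιpapply X hX hΘX hXΘ hXc
    rw [h4] at hyrk
    refine hfullp_of (UnitaryDoubleLevi.eq_top_of_raise_of_core' hbrLp hirrLp hιpmem hιpιp hPp hQp
      (s := fun v w : Up => s (v : W) w) (hsU Up) (fun v w => hsymm v w) hPpQp hdefPp hdefQp hadjLp hymem hιpy hyιp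
      (by rw [hyrk]; omega) (by omega) (by omega)
      fun U' 𝔩' ι' P' Q' hbr𝔩' hirr𝔩' hι' hι'ι' hP' hQ' hfinP' hfinQ' hP'Q' hdefP' hdefQ' hadj𝔩' => ?_)
    rw [hyrk] at hfinP' hfinQ'
    exact UnitaryFourOdd.eq_top hbr𝔩' hirr𝔩' hι' hι'ι' hP' hQ' hfinP' ⟨10, by omega⟩ (s := fun x y : U' => s ((x : Up) : W) y) (fun x y z => by simp only [Submodule.coe_add, hadd]) (fun x y => hsymm _ _) hP'Q' hdefP' hdefQ' hadj𝔩'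
  have hkillp6 : ∀ X ∈ 𝔊, Θ * X = X → X * Θ = -X → X * ι = ι * X → Module.finrank ℂ (Up.map X) ≠ 6 := by
    intro X hX hΘX hXΘ hXc h6
    obtain ⟨hymem, hιpy, hyιp, hyrk⟩ := UnitaryLeviSetup.restrict_mem hcp hLp hιpapply X hX hΘX hXΘ hXc
    rw [h6] at hyrk
    refine hfullp_of (UnitaryDoubleLevi.eq_top_of_raise_of_core' hbrLp hirrLp hιpmem hιpιp hPp hQp
      (s := fun v w : Up => s (v : W) w) (hsU Up) (fun v w => hsymm v w) hPpQp hdefPp hdefQp hadjLp hymem hιpy hyιp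
      (by rw [hyrk]; omega) (by omega) (by omega)
      fun U' 𝔩' ι' P' Q' hbr𝔩' hirr𝔩' hι' hι'ι' hP' hQ' hfinP' hfinQ' hP'Q' hdefP' hdefQ' hadj𝔩' => ?_)
    rw [hyrk] at hfinP' hfinQ'
    exact UnitarySix.eq_top_of_smul hbr𝔩' hirr𝔩' hι' hι'ι' hP' hQ' hfinP' ⟨9, by omega⟩ (by omega) (s := fun x y : U' => s ((x : Up) : W) y) (fun x y z => by simp only [Submodule.coe_add, hadd]) (fun c x y => by simp only [Submodule.coe_smul, hsmul]) (fun x y => hsymm _ _) hP'Q' hdefP' hdefQ' hadj𝔩'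
  have hkillp8 : ∀ X ∈ 𝔊, Θ * X = X → X * Θ = -X → X * ι = ι * X → Module.finrank ℂ (Up.map X) ≠ 8 := by
    intro X hX hΘX hXΘ hXc h8
    obtain ⟨hymem, hιpy, hyιp, hyrk⟩ := UnitaryLeviSetup.restrict_mem hcp hLp hιpapply X hX hΘX hXΘ hXc
    rw [h8] at hyrk
    refine hfullp_of (UnitaryDoubleLevi.eq_top_of_raise_of_core' hbrLp hirrLp hιpmem hιpιp hPp hQp
      (s := fun v w : Up => s (v : W) w) (hsU Up) (fun v w => hsymm v w) hPpQp hdefPp hdefQp hadjLp hymem hιpy hyιp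
      (by rw [hyrk]; omega) (by omega) (by omega)
      fun U' 𝔩' ι' P' Q' hbr𝔩' hirr𝔩' hι' hι'ι' hP' hQ' hfinP' hfinQ' hP'Q' hdefP' hdefQ' hadj𝔩' => ?_)
    rw [hyrk] at hfinP' hfinQ'
    exact UnitarySeventeen.eq_top_of_smul hbr𝔩' hirr𝔩' hι' hι'ι' hP' hQ' (by omega) (by omega) (by omega) (s := fun x y : U' => s ((x : Up) : W) y) (fun x y z => by simp only [Submodule.coe_add, hadd]) (fun c x y => by simp only [Submodule.coe_smul, hsmul]) (fun x y => hsymm _ _) hP'Q' hdefP' hdefQ' hadj𝔩'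
  have hkillp11 : ∀ X ∈ 𝔊, Θ * X = X → X * Θ = -X → X * ι = ι * X → Module.finrank ℂ (Up.map X) ≠ 11 := by
    intro X hX hΘX hXΘ hXc h11
    obtain ⟨hymem, hιpy, hyιp, hyrk⟩ := UnitaryLeviSetup.restrict_mem hcp hLp hιpapply X hX hΘX hXΘ hXc
    rw [h11] at hyrk
    refine hfullp_of (UnitaryDoubleLevi.eq_top_of_raise_of_core' hbrLp hirrLp hιpmem hιpιp hPp hQp
      (s := fun v w : Up => s (v : W) w) (hsU Up) (fun v w => hsymm v w) hPpQp hdefPp hdefQp hadjLp hymem hιpy hyιp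
      (by rw [hyrk]; omega) (by omega) (by omega)
      fun U' 𝔩' ι' P' Q' hbr𝔩' hirr𝔩' hι' hι'ι' hP' hQ' hfinP' hfinQ' hP'Q' hdefP' hdefQ' hadj𝔩' => ?_)
    rw [hyrk] at hfinP' hfinQ'
    exact UnitaryEleven.eq_top_of_smul hbr𝔩' hirr𝔩' hι' hι'ι' hP' hQ' hfinP' (by omega) (s := fun x y : U' => s ((x : Up) : W) y) (fun x y z => by simp only [Submodule.coe_add, hadd]) (fun c x y => by simp only [Submodule.coe_smul, hsmul]) (fun x y => hsymm _ _) hP'Q' hdefP' hdefQ' hadj𝔩'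
  have hkillp12 : ∀ X ∈ 𝔊, Θ * X = X → X * Θ = -X → X * ι = ι * X → Module.finrank ℂ (Up.map X) ≠ 12 := by
    intro X hX hΘX hXΘ hXc h12
    obtain ⟨hymem, hιpy, hyιp, hyrk⟩ := UnitaryLeviSetup.restrict_mem hcp hLp hιpapply X hX hΘX hXΘ hXc
    rw [h12] at hyrk
    refine hfullp_of (UnitaryDoubleLevi.eq_top_of_raise_of_core' hbrLp hirrLp hιpmem hιpιp hPp hQp
      (s := fun v w : Up => s (v : W) w) (hsU Up) (fun v w => hsymm v w) hPpQp hdefPp hdefQp hadjLp hymem hιpy hyιp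
      (by rw [hyrk]; omega) (by omega) (by omega)
      fun U' 𝔩' ι' P' Q' hbr𝔩' hirr𝔩' hι' hι'ι' hP' hQ' hfinP' hfinQ' hP'Q' hdefP' hdefQ' hadj𝔩' => ?_)
    rw [hyrk] at hfinP' hfinQ'
    exact UnitaryThirteen.eq_top_of_smul' hbr𝔩' hirr𝔩' hι' hι'ι' hP' hQ' (by omega) (by omega) (s := fun x y : U' => s ((x : Up) : W) y) (fun x y z => by simp only [Submodule.coe_add, hadd]) (fun c x y => by simp only [Submodule.coe_smul, hsmul]) (fun x y => hsymm _ _) hP'Q' hdefP' hdefQ' hadj𝔩'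
  have hkillp14 : ∀ X ∈ 𝔊, Θ * X = X → X * Θ = -X → X * ι = ι * X → Module.finrank ℂ (Up.map X) ≠ 14 := by
    intro X hX hΘX hXΘ hXc h14
    obtain ⟨hymem, hιpy, hyιp, hyrk⟩ := UnitaryLeviSetup.restrict_mem hcp hLp hιpapply X hX hΘX hXΘ hXc
    rw [h14] at hyrk
    refine hfullp_of (UnitaryDoubleLevi.eq_top_of_raise_of_core' hbrLp hirrLp hιpmem hιpιp hPp hQp
      (s := fun v w : Up => s (v : W) w) (hsU Up) (fun v w => hsymm v w) hPpQp hdefPp hdefQp hadjLp hymem hιpy hyιp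
      (by rw [hyrk]; omega) (by omega) (by omega)
      fun U' 𝔩' ι' P' Q' hbr𝔩' hirr𝔩' hι' hι'ι' hP' hQ' hfinP' hfinQ' hP'Q' hdefP' hdefQ' hadj𝔩' => ?_)
    rw [hyrk] at hfinP' hfinQ'
    exact UnitaryEleven.eq_top_of_smul' hbr𝔩' hirr𝔩' hι' hι'ι' hP' hQ' (by omega) (by omega) (s := fun x y : U' => s ((x : Up) : W) y) (fun x y z => by simp only [Submodule.coe_add, hadd]) (fun c x y => by simp only [Submodule.coe_smul, hsmul]) (fun x y => hsymm _ _) hP'Q' hdefP' hdefQ' hadj𝔩'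
  have hprof : ∀ X ∈ 𝔊, Θ * X = X → X * Θ = -X → X * ι = ι * X →
      (Module.finrank ℂ (Up.map X) = 0 ∧ Module.finrank ℂ (Um.map X) = 0) ∨
        (Module.finrank ℂ (Up.map X) = 0 ∧ Module.finrank ℂ (Um.map X) = 14) ∨
        (Module.finrank ℂ (Up.map X) = 5 ∧ Module.finrank ℂ (Um.map X) = 9) ∨
        (Module.finrank ℂ (Up.map X) = 9 ∧ Module.finrank ℂ (Um.map X) = 5) ∨
        (Module.finrank ℂ (Up.map X) = 10 ∧ Module.finrank ℂ (Um.map X) = 4) := by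
    intro X hX hΘX hXΘ hXc
    obtain ⟨hs, hi, hi', hj, hj'⟩ := hsplit X hΘX hXΘ hXc
    have hkillm1' := hkillm1 X hX hΘX hXΘ hXc
    have hkillm7' := hkillm7 X hX hΘX hXΘ hXc
    have hkillm11' := hkillm11 X hX hΘX hXΘ hXc
    have hkillm13' := hkillm13 X hX hΘX hXΘ hXc
    have hkillp2' := hkillp2 X hX hΘX hXΘ hXc
    have hkillp4' := hkillp4 X hX hΘX hXΘ hXc
    have hkillp6' := hkillp6 X hX hΘX hXΘ hXc
    have hkillp8' := hkillp8 X hX hΘX hXΘ hXc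
    have hkillp11' := hkillp11 X hX hΘX hXΘ hXc
    have hkillp12' := hkillp12 X hX hΘX hXΘ hXc
    have hkillp14' := hkillp14 X hX hΘX hXΘ hXc
    have hrk := hS X hX hΘX hXΘ
    have hd := hdich X hX hΘX hXΘ hXc
    rw [hs] at hrk
    generalize Module.finrank ℂ ↥(Submodule.map X Um) = jj at *
    have hjle : jj ≤ 14 := by omega
    interval_cases jj
    · exact Or.inl ⟨by omega, rfl⟩
    · exact (hkillm1' rfl).elim
    · exfalso; omega
    · exfalso; omega
    · exact Or.inr (Or.inr (Or.inr (Or.inr (⟨by omega, rfl⟩))))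
    · exact Or.inr (Or.inr (Or.inr (Or.inl ⟨by omega, rfl⟩)))
    · exfalso; omega
    · exact (hkillm7' rfl).elim
    · exfalso; omega
    · exact Or.inr (Or.inr (Or.inl ⟨by omega, rfl⟩))
    · exfalso; omega
    · exact (hkillm11' rfl).elim
    · exfalso; omega
    · exact (hkillm13' rfl).elim
    · exact Or.inr (Or.inl ⟨by omega, rfl⟩)
  obtain ⟨⟨p, hp⟩, hp0⟩ := Module.finrank_pos_iff_exists_ne_zero.1 (show 0 < Module.finrank ℂ PU by omega)
  obtain ⟨⟨q, hq⟩, hq0⟩ := Module.finrank_pos_iff_exists_ne_zero.1 (show 0 < Module.finrank ℂ QU by omega)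
  obtain ⟨X₀, hX₀, hΘX₀, hX₀Θ, hX₀c, c₀, hιc₀, -, hX₀c0⟩ :=
    UnitaryLeviFull.exists_raise_commute_apply_ne_zero hbr hirr hΘ hΘΘ hQ hιmem hιι hιΘ hUm hUp
      ⟨p, fun h => hp0 (Subtype.ext h), ((hPU p).1 hp).1, ((hPU p).1 hp).2⟩
      ⟨q, fun h => hq0 (Subtype.ext h), ((hQU q).1 hq).1, ((hQU q).1 hq).2⟩
  have hX₀i : Module.finrank ℂ (Up.map X₀) ≠ 0 := fun h0 => by
    have hmem : X₀ c₀ ∈ Up.map X₀ := Submodule.mem_map_of_mem ((hUp c₀).2 hιc₀)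
    rw [Submodule.finrank_eq_zero.1 h0, Submodule.mem_bot] at hmem
    exact hX₀c0 hmem
  have hnotboth : ∀ X ∈ 𝔊, Θ * X = X → X * Θ = -X → X * ι = ι * X → ∀ X' ∈ 𝔊, Θ * X' = X' → X' * Θ = -X' →
      X' * ι = ι * X' → 14 < Module.finrank ℂ (Up.map X') + Module.finrank ℂ (Um.map X) → False := by
    intro X hX hΘX hXΘ hXc X' hX' hΘX' hX'Θ hX'c hgt
    obtain ⟨c, hc1, hc2⟩ := UnitaryGenericRank.exists_finrank_le_and_finrank_le (X'.restrict (hcp X' hX'c))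
      (X.restrict (hcp X hXc)) (X.restrict (hcm X hXc)) (X'.restrict (hcm X' hX'c))
    obtain ⟨hX₁, hΘX₁, hX₁Θ, hX₁c⟩ := UnitaryLeviSetup.add_smul_raise X hX hΘX hXΘ hXc X' hX' hΘX' hX'Θ hX'c c
    have hi₁ := UnitaryLeviSetup.finrank_map_add_smul hcp X X' hXc hX'c c hX₁c
    have hj₁ := UnitaryLeviSetup.finrank_map_add_smul hcm X X' hXc hX'c c hX₁c
    rw [UnitaryLeviRank.finrank_range_restrict] at hc1 hc2
    have hp := hprof (X + c • X') hX₁ hΘX₁ hX₁Θ hX₁c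
    rw [hi₁, hj₁] at hp
    omega
  have hzero : ∀ X ∈ 𝔊, Θ * X = X → X * Θ = -X → X * ι = ι * X → Module.finrank ℂ (Up.map X) = 0 → Module.finrank ℂ (Um.map X) = 0 → X = 0 := by
    intro X hX hΘX hXΘ hXc hi hj
    obtain ⟨hs, -, -, -, -⟩ := hsplit X hΘX hXΘ hXc
    rw [hi, hj, add_zero] at hs
    exact LinearMap.range_eq_bot.1 (Submodule.finrank_eq_zero.1 hs)
  rcases hprof X₀ hX₀ hΘX₀ hX₀Θ hX₀c with ⟨h0i, h0j⟩ | ⟨h0i, h0j⟩ | ⟨h0i, h0j⟩ | ⟨h0i, h0j⟩ | ⟨h0i, h0j⟩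
  · exact hX₀i h0i
  · exact hX₀i h0i
  · -- constant profile `(5, 9)`
    have hprofc : ∀ X ∈ 𝔊, Θ * X = X → X * Θ = -X → X * ι = ι * X → X ≠ 0 →
        Module.finrank ℂ (Up.map X) = 5 ∧ Module.finrank ℂ (Um.map X) = 9 := by
      intro X hX hΘX hXΘ hXc hX0
      rcases hprof X hX hΘX hXΘ hXc with ⟨hi, hj⟩ | ⟨hi, hj⟩ | ⟨hi, hj⟩ | ⟨hi, hj⟩ | ⟨hi, hj⟩
      · exact (hX0 (hzero X hX hΘX hXΘ hXc hi hj)).elim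
      · exact (hnotboth X hX hΘX hXΘ hXc X₀ hX₀ hΘX₀ hX₀Θ hX₀c (by omega)).elim
      · exact ⟨hi, hj⟩
      · exact (hnotboth X₀ hX₀ hΘX₀ hX₀Θ hX₀c X hX hΘX hXΘ hXc (by omega)).elim
      · exact (hnotboth X₀ hX₀ hΘX₀ hX₀Θ hX₀c X hX hΘX hXΘ hXc (by omega)).elim
    obtain ⟨hymem, hιpy, hyιp, hyrk⟩ := UnitaryLeviSetup.restrict_mem hcp hLp hιpapply X₀ hX₀ hΘX₀ hX₀Θ hX₀c
    have hSp : ∀ A ∈ Lp, ιp * A = A → A * ιp = -A →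
        Module.finrank ℂ (LinearMap.range A) = 0 ∨ Module.finrank ℂ (LinearMap.range A) = 5 := by
      intro A hA hιA hAι
      by_cases hA0 : A = 0
      · left; rw [hA0, LinearMap.range_zero, finrank_bot]
      · obtain ⟨XA, hXA, hΘXA, hXAΘ, hXAc, hXAUp⟩ :=
          UnitaryLeviSetup.exists_lift hbr hΘ hΘΘ hcp hιΘ hLp hιpapply A hA hιA hAι
        have hXA0 : XA ≠ 0 := fun h0 => hA0 (LinearMap.range_eq_bot.1 (Submodule.finrank_eq_zero.1
          (by rw [← hXAUp, h0, Submodule.map_zero, finrank_bot])))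
        right; rw [← hXAUp]; exact (hprofc XA hXA hΘXA hXAΘ hXAc hXA0).1
    exact UnitaryThirtyNineFortyFour.subTwentyFiveFourteen_rank5 hbrLp hirrLp hιpmem hιpιp hPp hQp (by omega) (by omega)
      (s := fun v w : Up => s (v : W) w) (hsU Up) (hsmU Up) (fun v w => hsymm v w) hPpQp hdefPp hdefQp hadjLp hSp
      hymem hιpy hyιp (by rw [hyrk, h0i])
  · -- constant profile `(9, 5)`
    have hprofc : ∀ X ∈ 𝔊, Θ * X = X → X * Θ = -X → X * ι = ι * X → X ≠ 0 →
        Module.finrank ℂ (Up.map X) = 9 ∧ Module.finrank ℂ (Um.map X) = 5 := by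
      intro X hX hΘX hXΘ hXc hX0
      rcases hprof X hX hΘX hXΘ hXc with ⟨hi, hj⟩ | ⟨hi, hj⟩ | ⟨hi, hj⟩ | ⟨hi, hj⟩ | ⟨hi, hj⟩
      · exact (hX0 (hzero X hX hΘX hXΘ hXc hi hj)).elim
      · exact (hnotboth X hX hΘX hXΘ hXc X₀ hX₀ hΘX₀ hX₀Θ hX₀c (by omega)).elim
      · exact (hnotboth X hX hΘX hXΘ hXc X₀ hX₀ hΘX₀ hX₀Θ hX₀c (by omega)).elim
      · exact ⟨hi, hj⟩
      · exact (hnotboth X₀ hX₀ hΘX₀ hX₀Θ hX₀c X hX hΘX hXΘ hXc (by omega)).elim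
    obtain ⟨hymem, hιpy, hyιp, hyrk⟩ := UnitaryLeviSetup.restrict_mem hcp hLp hιpapply X₀ hX₀ hΘX₀ hX₀Θ hX₀c
    have hSp : ∀ A ∈ Lp, ιp * A = A → A * ιp = -A →
        Module.finrank ℂ (LinearMap.range A) = 0 ∨ Module.finrank ℂ (LinearMap.range A) = 9 := by
      intro A hA hιA hAι
      by_cases hA0 : A = 0
      · left; rw [hA0, LinearMap.range_zero, finrank_bot]
      · obtain ⟨XA, hXA, hΘXA, hXAΘ, hXAc, hXAUp⟩ :=
          UnitaryLeviSetup.exists_lift hbr hΘ hΘΘ hcp hιΘ hLp hιpapply A hA hιA hAι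
        have hXA0 : XA ≠ 0 := fun h0 => hA0 (LinearMap.range_eq_bot.1 (Submodule.finrank_eq_zero.1
          (by rw [← hXAUp, h0, Submodule.map_zero, finrank_bot])))
        right; rw [← hXAUp]; exact (hprofc XA hXA hΘXA hXAΘ hXAc hXA0).1
    exact UnitaryThirtyNineFortyFour.subTwentyFiveFourteen_rank9 hbrLp hirrLp hιpmem hιpιp hPp hQp (by omega) (by omega)
      (s := fun v w : Up => s (v : W) w) (hsU Up) (hsmU Up) (fun v w => hsymm v w) hPpQp hdefPp hdefQp hadjLp hSp
      hymem hιpy hyιp (by rw [hyrk, h0i])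
  · -- constant profile `(10, 4)`
    have hprofc : ∀ X ∈ 𝔊, Θ * X = X → X * Θ = -X → X * ι = ι * X → X ≠ 0 →
        Module.finrank ℂ (Up.map X) = 10 ∧ Module.finrank ℂ (Um.map X) = 4 := by
      intro X hX hΘX hXΘ hXc hX0
      rcases hprof X hX hΘX hXΘ hXc with ⟨hi, hj⟩ | ⟨hi, hj⟩ | ⟨hi, hj⟩ | ⟨hi, hj⟩ | ⟨hi, hj⟩
      · exact (hX0 (hzero X hX hΘX hXΘ hXc hi hj)).elim
      · exact (hnotboth X hX hΘX hXΘ hXc X₀ hX₀ hΘX₀ hX₀Θ hX₀c (by omega)).elim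
      · exact (hnotboth X hX hΘX hXΘ hXc X₀ hX₀ hΘX₀ hX₀Θ hX₀c (by omega)).elim
      · exact (hnotboth X hX hΘX hXΘ hXc X₀ hX₀ hΘX₀ hX₀Θ hX₀c (by omega)).elim
      · exact ⟨hi, hj⟩
    obtain ⟨hymem, hιpy, hyιp, hyrk⟩ := UnitaryLeviSetup.restrict_mem hcp hLp hιpapply X₀ hX₀ hΘX₀ hX₀Θ hX₀c
    have hSp : ∀ A ∈ Lp, ιp * A = A → A * ιp = -A →
        Module.finrank ℂ (LinearMap.range A) = 0 ∨ Module.finrank ℂ (LinearMap.range A) = 10 := by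
      intro A hA hιA hAι
      by_cases hA0 : A = 0
      · left; rw [hA0, LinearMap.range_zero, finrank_bot]
      · obtain ⟨XA, hXA, hΘXA, hXAΘ, hXAc, hXAUp⟩ :=
          UnitaryLeviSetup.exists_lift hbr hΘ hΘΘ hcp hιΘ hLp hιpapply A hA hιA hAι
        have hXA0 : XA ≠ 0 := fun h0 => hA0 (LinearMap.range_eq_bot.1 (Submodule.finrank_eq_zero.1
          (by rw [← hXAUp, h0, Submodule.map_zero, finrank_bot])))
        right; rw [← hXAUp]; exact (hprofc XA hXA hΘXA hXAΘ hXAc hXA0).1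
    exact UnitaryThirtyNineForty.subTwentyFiveFourteen_rank10 hbrLp hirrLp hιpmem hιpιp hPp hQp (by omega) (by omega)
      (s := fun v w : Up => s (v : W) w) (hsU Up) (hsmU Up) (fun v w => hsymm v w) hPpQp hdefPp hdefQp hadjLp hSp
      hymem hιpy hyιp (by rw [hyrk, h0i])

/-- `(39 | 44)`, minimal rank `15`: after the Levi kills every profile has `i = 0` (profiles [(0, 0)]), against the non-vanishing lemma. [cite: Ribet1983, Thm. 3] [cite: Gordon1997, Thm. 6.3 (3)]
[cite: Deligne1982HodgeCycles, I §3 Prop. 3.4, 3.6] [cite: GoodmanWallachGTM255, §4.1.1] -/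
theorem UnitaryThirtyNineFortyFour.no_minRank_15 [FiniteDimensional ℂ W] {𝔊 : Submodule ℂ (Module.End ℂ W)}
    (hbr : ∀ Y ∈ 𝔊, ∀ Z ∈ 𝔊, Y * Z - Z * Y ∈ 𝔊)
    (hirr : ∀ U : Submodule ℂ W, (∀ A ∈ 𝔊, ∀ u ∈ U, A u ∈ U) → U = ⊥ ∨ U = ⊤)
    {Θ : Module.End ℂ W} (hΘ : Θ ∈ 𝔊) (hΘΘ : Θ * Θ = 1)
    {P Q : Submodule ℂ W} (hP : ∀ x, x ∈ P ↔ Θ x = x) (hQ : ∀ x, x ∈ Q ↔ Θ x = -x)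
    (hP39 : Module.finrank ℂ P = 39) (hQ44 : Module.finrank ℂ Q = 44)
    {s : W → W → ℂ} (hadd : ∀ x y z, s (x + y) z = s x z + s y z)
    (hsmul : ∀ (c : ℂ) (x y : W), s (c • x) y = c * s x y) (hsymm : ∀ x y, s y x = starRingEnd ℂ (s x y))
    (hPQ : ∀ p ∈ P, ∀ q ∈ Q, s p q = 0) (hdefP : ∀ p ∈ P, s p p = 0 → p = 0) (hdefQ : ∀ q ∈ Q, s q q = 0 → q = 0)
    (hadj : ∀ X ∈ 𝔊, ∃ Y ∈ 𝔊, ∀ x y, s (X x) y = s x (Y y))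
    (hS : ∀ B' ∈ 𝔊, Θ * B' = B' → B' * Θ = -B' →
      Module.finrank ℂ (LinearMap.range B') = 0 ∨ Module.finrank ℂ (LinearMap.range B') = 15 ∨ Module.finrank ℂ (LinearMap.range B') = 16 ∨ Module.finrank ℂ (LinearMap.range B') = 17 ∨ Module.finrank ℂ (LinearMap.range B') = 18 ∨ Module.finrank ℂ (LinearMap.range B') = 19 ∨ Module.finrank ℂ (LinearMap.range B') = 20 ∨ Module.finrank ℂ (LinearMap.range B') = 21 ∨ Module.finrank ℂ (LinearMap.range B') = 22 ∨ Module.finrank ℂ (LinearMap.range B') = 23 ∨ Module.finrank ℂ (LinearMap.range B') = 24 ∨ Module.finrank ℂ (LinearMap.range B') = 25 ∨ Module.finrank ℂ (LinearMap.range B') = 26 ∨ Module.finrank ℂ (LinearMap.range B') = 27 ∨ Module.finrank ℂ (LinearMap.range B') = 28 ∨ Module.finrank ℂ (LinearMap.range B') = 29 ∨ Module.finrank ℂ (LinearMap.range B') = 30 ∨ Module.finrank ℂ (LinearMap.range B') = 32 ∨ Module.finrank ℂ (LinearMap.range B') = 33 ∨ Module.finrank ℂ (LinearMap.range B') = 34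 ∨ Module.finrank ℂ (LinearMap.range B') = 36 ∨ Module.finrank ℂ (LinearMap.range B') = 38)
    {B : Module.End ℂ W} (hB : B ∈ 𝔊) (hΘB : Θ * B = B) (hBΘ : B * Θ = -B)
    (hr : Module.finrank ℂ (LinearMap.range B) = 15) : False := by
  classical
  have hsU : ∀ U : Submodule ℂ W, ∀ x y z : U, s ((x + y : U) : W) z = s (x : W) z + s (y : W) z :=
    fun U x y z => by simp only [Submodule.coe_add, hadd]
  have hsmU : ∀ U : Submodule ℂ W, ∀ (c : ℂ) (x y : U), s ((c • x : U) : W) y = c * s (x : W) y :=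
    fun U c x y => by simp only [Submodule.coe_smul, hsmul]
  have hno1 : ∀ B' ∈ 𝔊, Θ * B' = B' → B' * Θ = -B' → Module.finrank ℂ (LinearMap.range B') ≠ 1 := by
    intro B' hB' hΘB' hB'Θ h1
    rcases hS B' hB' hΘB' hB'Θ with h | h | h | h | h | h | h | h | h | h | h | h | h | h | h | h | h | h | h | h | h | h <;> omega
  have hmin : ∀ Y ∈ 𝔊, Θ * Y = Y → Y * Θ = -Y → Y ≠ 0 → 15 ≤ Module.finrank ℂ (LinearMap.range Y) := by
    intro Y hY hΘY hYΘ hY0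
    have h0 : Module.finrank ℂ (LinearMap.range Y) ≠ 0 := fun h =>
      hY0 (LinearMap.range_eq_bot.1 (Submodule.finrank_eq_zero.1 h))
    rcases hS Y hY hΘY hYΘ with h | h | h | h | h | h | h | h | h | h | h | h | h | h | h | h | h | h | h | h | h | h <;> omega
  have hmin' : ∀ Z ∈ 𝔊, Θ * Z = Z → Z * Θ = -Z → Z ≠ 0 → Module.finrank ℂ (LinearMap.range B) ≤ Module.finrank ℂ (LinearMap.range Z) := by
    rw [hr]; exact hmin
  obtain ⟨ι, Um, Up, PU, QU, Lm, ιm, Pm, Qm, Lp, ιp, Pp, Qp, hιmem, hιι, hιΘ, hιs, hUm, hUp, hfinUm, hfinUp,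
    hPM, hQM, hPU, hQU, hrangeP, hPUP, hQUQ, hfinQM, hfinPU, hfinQU, hLm, hLp,
    hιmapply, hPmmem, hQmmem, hbrLm, hirrLm, hιmmem, hιmιm, hPm, hQm, hfinPm, hfinQm, hPmQm, hdefPm, hdefQm, hadjLm,
    hιpapply, hPpmem, hQpmem, hbrLp, hirrLp, hιpmem, hιpιp, hPp, hQp, hfinPp, hfinQp, hPpQp, hdefPp, hdefQp, hadjLp,
    hsplit⟩ :=
    UnitaryLeviSetup.exists_levi_pair hbr hirr hΘ hΘΘ hP hQ hadd hsymm hPQ hdefP hdefQ hadj hB hΘB hBΘ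
  have hdich : ∀ X ∈ 𝔊, Θ * X = X → X * Θ = -X → X * ι = ι * X →
      Module.finrank ℂ (Up.map X) + Module.finrank ℂ (Um.map X) ≤ Module.finrank ℂ (LinearMap.range B) ∨
        (15 ≤ Module.finrank ℂ (Up.map X) ∧ 15 ≤ Module.finrank ℂ (Um.map X)) := fun X hX hΘX hXΘ hXc =>
    UnitaryLeviSetup.profile_dichotomy hbr hΘΘ hP hQ hadd hsymm hPQ hdefP hdefQ hadj hmin hB hΘB hBΘ hιι hιΘ hιs hUm hUp
      hPM hQM hQU hfinQU hrangeP hX hΘX hXΘ hXc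
  have hfinQU' := hfinQU
  rw [hr] at hfinQM hfinPU hfinQU hfinPm hfinQm hfinPp hfinQp hsplit hdich
  rw [hQ44] at hfinQM hfinQm hfinUm
  rw [hP39] at hfinPU hfinPp hfinUp
  have hcm : ∀ Z : Module.End ℂ W, Z * ι = ι * Z → ∀ x ∈ Um, Z x ∈ Um := fun Z hZ x hx =>
    (hUm _).2 (by rw [← Module.End.mul_apply, ← hZ, Module.End.mul_apply, (hUm x).1 hx, map_neg])
  have hcp : ∀ Z : Module.End ℂ W, Z * ι = ι * Z → ∀ x ∈ Up, Z x ∈ Up := fun Z hZ x hx =>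
    (hUp _).2 (by rw [← Module.End.mul_apply, ← hZ, Module.End.mul_apply, (hUp x).1 hx])
  have hfullm_of : Lm = ⊤ → False := fun h =>
    UnitaryLeviSetup.false_of_full_larger hbr hΘΘ hno1 hιι hιΘ hUm hUp (by omega) (by omega) hPM hQM (by omega)
      (by omega) hLm h
  have hkillm1 : ∀ X ∈ 𝔊, Θ * X = X → X * Θ = -X → X * ι = ι * X → Module.finrank ℂ (Um.map X) ≠ 1 := by
    intro X hX hΘX hXΘ hXc h1
    obtain ⟨hxmem, hιmx, hxιm, hxrk⟩ := UnitaryLeviSetup.restrict_mem hcm hLm hιmapply X hX hΘX hXΘ hXc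
    rw [h1] at hxrk
    exact hfullm_of (UnitaryRankOneRaise.eq_top_of_rankOne_raise hbrLm hirrLm hιmmem hιmιm hPm hQm
      (s := fun v w : Um => s (v : W) w) (hsU Um) (fun v w => hsymm v w) hPmQm hdefPm hdefQm hadjLm hxmem hιmx hxιm
      hxrk (by omega) (by omega) (by omega))
  have hkillm2 : ∀ X ∈ 𝔊, Θ * X = X → X * Θ = -X → X * ι = ι * X → Module.finrank ℂ (Um.map X) ≠ 2 := by
    intro X hX hΘX hXΘ hXc h2
    obtain ⟨hxmem, hιmx, hxιm, hxrk⟩ := UnitaryLeviSetup.restrict_mem hcm hLm hιmapply X hX hΘX hXΘ hXc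
    rw [h2] at hxrk
    refine hfullm_of (UnitaryDoubleLevi.eq_top_of_raise_of_core hbrLm hirrLm hιmmem hιmιm hPm hQm
      (s := fun v w : Um => s (v : W) w) (hsU Um) (fun v w => hsymm v w) hPmQm hdefPm hdefQm hadjLm hxmem hιmx hxιm
      (by rw [hxrk]; omega) (by omega) (by omega)
      fun U' 𝔩' ι' P' Q' hbr𝔩' hirr𝔩' hι' hι'ι' hP' hQ' hfinP' hfinQ' hP'Q' hdefP' hdefQ' hadj𝔩' => ?_)
    rw [hxrk] at hfinP' hfinQ'
    exact UnitaryTwoOdd.eq_top hbr𝔩' hirr𝔩' hι' hι'ι' hP' hQ' hfinP' ⟨13, by omega⟩ (s := fun x y : U' => s ((x : Um) : W) y) (fun x y z => by simp only [Submodule.coe_add, hadd]) (fun x y => hsymm _ _) hP'Q' hdefP' hdefQ' hadj𝔩'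
  have hkillm3 : ∀ X ∈ 𝔊, Θ * X = X → X * Θ = -X → X * ι = ι * X → Module.finrank ℂ (Um.map X) ≠ 3 := by
    intro X hX hΘX hXΘ hXc h3
    obtain ⟨hxmem, hιmx, hxιm, hxrk⟩ := UnitaryLeviSetup.restrict_mem hcm hLm hιmapply X hX hΘX hXΘ hXc
    rw [h3] at hxrk
    refine hfullm_of (UnitaryDoubleLevi.eq_top_of_raise_of_core hbrLm hirrLm hιmmem hιmιm hPm hQm
      (s := fun v w : Um => s (v : W) w) (hsU Um) (fun v w => hsymm v w) hPmQm hdefPm hdefQm hadjLm hxmem hιmx hxιm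
      (by rw [hxrk]; omega) (by omega) (by omega)
      fun U' 𝔩' ι' P' Q' hbr𝔩' hirr𝔩' hι' hι'ι' hP' hQ' hfinP' hfinQ' hP'Q' hdefP' hdefQ' hadj𝔩' => ?_)
    rw [hxrk] at hfinP' hfinQ'
    exact UnitaryThreeCoprime.eq_top hbr𝔩' hirr𝔩' hι' hι'ι' hP' hQ' hfinP' (by omega) (s := fun x y : U' => s ((x : Um) : W) y) (fun x y z => by simp only [Submodule.coe_add, hadd]) (fun x y => hsymm _ _) hP'Q' hdefP' hdefQ' hadj𝔩'
  have hkillm4 : ∀ X ∈ 𝔊, Θ * X = X → X * Θ = -X → X * ι = ι * X → Module.finrank ℂ (Um.map X) ≠ 4 := by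
    intro X hX hΘX hXΘ hXc h4
    obtain ⟨hxmem, hιmx, hxιm, hxrk⟩ := UnitaryLeviSetup.restrict_mem hcm hLm hιmapply X hX hΘX hXΘ hXc
    rw [h4] at hxrk
    refine hfullm_of (UnitaryDoubleLevi.eq_top_of_raise_of_core hbrLm hirrLm hιmmem hιmιm hPm hQm
      (s := fun v w : Um => s (v : W) w) (hsU Um) (fun v w => hsymm v w) hPmQm hdefPm hdefQm hadjLm hxmem hιmx hxιm
      (by rw [hxrk]; omega) (by omega) (by omega)
      fun U' 𝔩' ι' P' Q' hbr𝔩' hirr𝔩' hι' hι'ι' hP' hQ' hfinP' hfinQ' hP'Q' hdefP' hdefQ' hadj𝔩' => ?_)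
    rw [hxrk] at hfinP' hfinQ'
    exact UnitaryFourOdd.eq_top hbr𝔩' hirr𝔩' hι' hι'ι' hP' hQ' hfinP' ⟨12, by omega⟩ (s := fun x y : U' => s ((x : Um) : W) y) (fun x y z => by simp only [Submodule.coe_add, hadd]) (fun x y => hsymm _ _) hP'Q' hdefP' hdefQ' hadj𝔩'
  have hkillm5 : ∀ X ∈ 𝔊, Θ * X = X → X * Θ = -X → X * ι = ι * X → Module.finrank ℂ (Um.map X) ≠ 5 := by
    intro X hX hΘX hXΘ hXc h5
    obtain ⟨hxmem, hιmx, hxιm, hxrk⟩ := UnitaryLeviSetup.restrict_mem hcm hLm hιmapply X hX hΘX hXΘ hXc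
    rw [h5] at hxrk
    refine hfullm_of (UnitaryDoubleLevi.eq_top_of_raise_of_core hbrLm hirrLm hιmmem hιmιm hPm hQm
      (s := fun v w : Um => s (v : W) w) (hsU Um) (fun v w => hsymm v w) hPmQm hdefPm hdefQm hadjLm hxmem hιmx hxιm
      (by rw [hxrk]; omega) (by omega) (by omega)
      fun U' 𝔩' ι' P' Q' hbr𝔩' hirr𝔩' hι' hι'ι' hP' hQ' hfinP' hfinQ' hP'Q' hdefP' hdefQ' hadj𝔩' => ?_)
    rw [hxrk] at hfinP' hfinQ'
    exact UnitaryFive.eq_top_of_smul hbr𝔩' hirr𝔩' hι' hι'ι' hP' hQ' hfinP' (by omega) (s := fun x y : U' => s ((x : Um) : W) y) (fun x y z => by simp only [Submodule.coe_add, hadd]) (fun c x y => by simp only [Submodule.coe_smul, hsmul]) (fun x y => hsymm _ _) hP'Q' hdefP' hdefQ' hadj𝔩'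
  have hkillm6 : ∀ X ∈ 𝔊, Θ * X = X → X * Θ = -X → X * ι = ι * X → Module.finrank ℂ (Um.map X) ≠ 6 := by
    intro X hX hΘX hXΘ hXc h6
    obtain ⟨hxmem, hιmx, hxιm, hxrk⟩ := UnitaryLeviSetup.restrict_mem hcm hLm hιmapply X hX hΘX hXΘ hXc
    rw [h6] at hxrk
    refine hfullm_of (UnitaryDoubleLevi.eq_top_of_raise_of_core hbrLm hirrLm hιmmem hιmιm hPm hQm
      (s := fun v w : Um => s (v : W) w) (hsU Um) (fun v w => hsymm v w) hPmQm hdefPm hdefQm hadjLm hxmem hιmx hxιm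
      (by rw [hxrk]; omega) (by omega) (by omega)
      fun U' 𝔩' ι' P' Q' hbr𝔩' hirr𝔩' hι' hι'ι' hP' hQ' hfinP' hfinQ' hP'Q' hdefP' hdefQ' hadj𝔩' => ?_)
    rw [hxrk] at hfinP' hfinQ'
    exact UnitarySix.eq_top_of_smul hbr𝔩' hirr𝔩' hι' hι'ι' hP' hQ' hfinP' ⟨11, by omega⟩ (by omega) (s := fun x y : U' => s ((x : Um) : W) y) (fun x y z => by simp only [Submodule.coe_add, hadd]) (fun c x y => by simp only [Submodule.coe_smul, hsmul]) (fun x y => hsymm _ _) hP'Q' hdefP' hdefQ' hadj𝔩'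
  have hkillm7 : ∀ X ∈ 𝔊, Θ * X = X → X * Θ = -X → X * ι = ι * X → Module.finrank ℂ (Um.map X) ≠ 7 := by
    intro X hX hΘX hXΘ hXc h7
    obtain ⟨hxmem, hιmx, hxιm, hxrk⟩ := UnitaryLeviSetup.restrict_mem hcm hLm hιmapply X hX hΘX hXΘ hXc
    rw [h7] at hxrk
    refine hfullm_of (UnitaryDoubleLevi.eq_top_of_raise_of_core hbrLm hirrLm hιmmem hιmιm hPm hQm
      (s := fun v w : Um => s (v : W) w) (hsU Um) (fun v w => hsymm v w) hPmQm hdefPm hdefQm hadjLm hxmem hιmx hxιm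
      (by rw [hxrk]; omega) (by omega) (by omega)
      fun U' 𝔩' ι' P' Q' hbr𝔩' hirr𝔩' hι' hι'ι' hP' hQ' hfinP' hfinQ' hP'Q' hdefP' hdefQ' hadj𝔩' => ?_)
    rw [hxrk] at hfinP' hfinQ'
    exact UnitarySeven.eq_top_of_smul hbr𝔩' hirr𝔩' hι' hι'ι' hP' hQ' hfinP' (by omega) (s := fun x y : U' => s ((x : Um) : W) y) (fun x y z => by simp only [Submodule.coe_add, hadd]) (fun c x y => by simp only [Submodule.coe_smul, hsmul]) (fun x y => hsymm _ _) hP'Q' hdefP' hdefQ' hadj𝔩'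
  have hkillm8 : ∀ X ∈ 𝔊, Θ * X = X → X * Θ = -X → X * ι = ι * X → Module.finrank ℂ (Um.map X) ≠ 8 := by
    intro X hX hΘX hXΘ hXc h8
    obtain ⟨hxmem, hιmx, hxιm, hxrk⟩ := UnitaryLeviSetup.restrict_mem hcm hLm hιmapply X hX hΘX hXΘ hXc
    rw [h8] at hxrk
    refine hfullm_of (UnitaryDoubleLevi.eq_top_of_raise_of_core hbrLm hirrLm hιmmem hιmιm hPm hQm
      (s := fun v w : Um => s (v : W) w) (hsU Um) (fun v w => hsymm v w) hPmQm hdefPm hdefQm hadjLm hxmem hιmx hxιm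
      (by rw [hxrk]; omega) (by omega) (by omega)
      fun U' 𝔩' ι' P' Q' hbr𝔩' hirr𝔩' hι' hι'ι' hP' hQ' hfinP' hfinQ' hP'Q' hdefP' hdefQ' hadj𝔩' => ?_)
    rw [hxrk] at hfinP' hfinQ'
    exact UnitaryEightTwentyOne.eq_top_of_smul hbr𝔩' hirr𝔩' hι' hι'ι' hP' hQ' hfinP' (by omega) (s := fun x y : U' => s ((x : Um) : W) y) (fun x y z => by simp only [Submodule.coe_add, hadd]) (fun c x y => by simp only [Submodule.coe_smul, hsmul]) (fun x y => hsymm _ _) hP'Q' hdefP' hdefQ' hadj𝔩'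
  have hkillm9 : ∀ X ∈ 𝔊, Θ * X = X → X * Θ = -X → X * ι = ι * X → Module.finrank ℂ (Um.map X) ≠ 9 := by
    intro X hX hΘX hXΘ hXc h9
    obtain ⟨hxmem, hιmx, hxιm, hxrk⟩ := UnitaryLeviSetup.restrict_mem hcm hLm hιmapply X hX hΘX hXΘ hXc
    rw [h9] at hxrk
    refine hfullm_of (UnitaryDoubleLevi.eq_top_of_raise_of_core hbrLm hirrLm hιmmem hιmιm hPm hQm
      (s := fun v w : Um => s (v : W) w) (hsU Um) (fun v w => hsymm v w) hPmQm hdefPm hdefQm hadjLm hxmem hιmx hxιm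
      (by rw [hxrk]; omega) (by omega) (by omega)
      fun U' 𝔩' ι' P' Q' hbr𝔩' hirr𝔩' hι' hι'ι' hP' hQ' hfinP' hfinQ' hP'Q' hdefP' hdefQ' hadj𝔩' => ?_)
    rw [hxrk] at hfinP' hfinQ'
    exact UnitaryNineTwenty.eq_top_of_smul hbr𝔩' hirr𝔩' hι' hι'ι' hP' hQ' hfinP' (by omega) (s := fun x y : U' => s ((x : Um) : W) y) (fun x y z => by simp only [Submodule.coe_add, hadd]) (fun c x y => by simp only [Submodule.coe_smul, hsmul]) (fun x y => hsymm _ _) hP'Q' hdefP' hdefQ' hadj𝔩'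
  have hkillm10 : ∀ X ∈ 𝔊, Θ * X = X → X * Θ = -X → X * ι = ι * X → Module.finrank ℂ (Um.map X) ≠ 10 := by
    intro X hX hΘX hXΘ hXc h10
    obtain ⟨hxmem, hιmx, hxιm, hxrk⟩ := UnitaryLeviSetup.restrict_mem hcm hLm hιmapply X hX hΘX hXΘ hXc
    rw [h10] at hxrk
    refine hfullm_of (UnitaryDoubleLevi.eq_top_of_raise_of_core hbrLm hirrLm hιmmem hιmιm hPm hQm
      (s := fun v w : Um => s (v : W) w) (hsU Um) (fun v w => hsymm v w) hPmQm hdefPm hdefQm hadjLm hxmem hιmx hxιm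
      (by rw [hxrk]; omega) (by omega) (by omega)
      fun U' 𝔩' ι' P' Q' hbr𝔩' hirr𝔩' hι' hι'ι' hP' hQ' hfinP' hfinQ' hP'Q' hdefP' hdefQ' hadj𝔩' => ?_)
    rw [hxrk] at hfinP' hfinQ'
    exact UnitaryTenNineteen.eq_top_of_smul hbr𝔩' hirr𝔩' hι' hι'ι' hP' hQ' hfinP' (by omega) (s := fun x y : U' => s ((x : Um) : W) y) (fun x y z => by simp only [Submodule.coe_add, hadd]) (fun c x y => by simp only [Submodule.coe_smul, hsmul]) (fun x y => hsymm _ _) hP'Q' hdefP' hdefQ' hadj𝔩'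
  have hkillm11 : ∀ X ∈ 𝔊, Θ * X = X → X * Θ = -X → X * ι = ι * X → Module.finrank ℂ (Um.map X) ≠ 11 := by
    intro X hX hΘX hXΘ hXc h11
    obtain ⟨hxmem, hιmx, hxιm, hxrk⟩ := UnitaryLeviSetup.restrict_mem hcm hLm hιmapply X hX hΘX hXΘ hXc
    rw [h11] at hxrk
    refine hfullm_of (UnitaryDoubleLevi.eq_top_of_raise_of_core hbrLm hirrLm hιmmem hιmιm hPm hQm
      (s := fun v w : Um => s (v : W) w) (hsU Um) (fun v w => hsymm v w) hPmQm hdefPm hdefQm hadjLm hxmem hιmx hxιm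
      (by rw [hxrk]; omega) (by omega) (by omega)
      fun U' 𝔩' ι' P' Q' hbr𝔩' hirr𝔩' hι' hι'ι' hP' hQ' hfinP' hfinQ' hP'Q' hdefP' hdefQ' hadj𝔩' => ?_)
    rw [hxrk] at hfinP' hfinQ'
    exact UnitaryEleven.eq_top_of_smul hbr𝔩' hirr𝔩' hι' hι'ι' hP' hQ' hfinP' (by omega) (s := fun x y : U' => s ((x : Um) : W) y) (fun x y z => by simp only [Submodule.coe_add, hadd]) (fun c x y => by simp only [Submodule.coe_smul, hsmul]) (fun x y => hsymm _ _) hP'Q' hdefP' hdefQ' hadj𝔩'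
  have hkillm12 : ∀ X ∈ 𝔊, Θ * X = X → X * Θ = -X → X * ι = ι * X → Module.finrank ℂ (Um.map X) ≠ 12 := by
    intro X hX hΘX hXΘ hXc h12
    obtain ⟨hxmem, hιmx, hxιm, hxrk⟩ := UnitaryLeviSetup.restrict_mem hcm hLm hιmapply X hX hΘX hXΘ hXc
    rw [h12] at hxrk
    refine hfullm_of (UnitaryDoubleLevi.eq_top_of_raise_of_core hbrLm hirrLm hιmmem hιmιm hPm hQm
      (s := fun v w : Um => s (v : W) w) (hsU Um) (fun v w => hsymm v w) hPmQm hdefPm hdefQm hadjLm hxmem hιmx hxιm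
      (by rw [hxrk]; omega) (by omega) (by omega)
      fun U' 𝔩' ι' P' Q' hbr𝔩' hirr𝔩' hι' hι'ι' hP' hQ' hfinP' hfinQ' hP'Q' hdefP' hdefQ' hadj𝔩' => ?_)
    rw [hxrk] at hfinP' hfinQ'
    exact UnitarySeventeen.eq_top_of_smul hbr𝔩' hirr𝔩' hι' hι'ι' hP' hQ' (by omega) (by omega) (by omega) (s := fun x y : U' => s ((x : Um) : W) y) (fun x y z => by simp only [Submodule.coe_add, hadd]) (fun c x y => by simp only [Submodule.coe_smul, hsmul]) (fun x y => hsymm _ _) hP'Q' hdefP' hdefQ' hadj𝔩'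
  have hkillm13 : ∀ X ∈ 𝔊, Θ * X = X → X * Θ = -X → X * ι = ι * X → Module.finrank ℂ (Um.map X) ≠ 13 := by
    intro X hX hΘX hXΘ hXc h13
    obtain ⟨hxmem, hιmx, hxιm, hxrk⟩ := UnitaryLeviSetup.restrict_mem hcm hLm hιmapply X hX hΘX hXΘ hXc
    rw [h13] at hxrk
    refine hfullm_of (UnitaryDoubleLevi.eq_top_of_raise_of_core hbrLm hirrLm hιmmem hιmιm hPm hQm
      (s := fun v w : Um => s (v : W) w) (hsU Um) (fun v w => hsymm v w) hPmQm hdefPm hdefQm hadjLm hxmem hιmx hxιm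
      (by rw [hxrk]; omega) (by omega) (by omega)
      fun U' 𝔩' ι' P' Q' hbr𝔩' hirr𝔩' hι' hι'ι' hP' hQ' hfinP' hfinQ' hP'Q' hdefP' hdefQ' hadj𝔩' => ?_)
    rw [hxrk] at hfinP' hfinQ'
    exact UnitaryThirteen.eq_top_of_smul hbr𝔩' hirr𝔩' hι' hι'ι' hP' hQ' hfinP' (by omega) (s := fun x y : U' => s ((x : Um) : W) y) (fun x y z => by simp only [Submodule.coe_add, hadd]) (fun c x y => by simp only [Submodule.coe_smul, hsmul]) (fun x y => hsymm _ _) hP'Q' hdefP' hdefQ' hadj𝔩'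
  have hkillm14 : ∀ X ∈ 𝔊, Θ * X = X → X * Θ = -X → X * ι = ι * X → Module.finrank ℂ (Um.map X) ≠ 14 := by
    intro X hX hΘX hXΘ hXc h14
    obtain ⟨hxmem, hιmx, hxιm, hxrk⟩ := UnitaryLeviSetup.restrict_mem hcm hLm hιmapply X hX hΘX hXΘ hXc
    rw [h14] at hxrk
    refine hfullm_of (UnitaryDoubleLevi.eq_top_of_raise_of_core hbrLm hirrLm hιmmem hιmιm hPm hQm
      (s := fun v w : Um => s (v : W) w) (hsU Um) (fun v w => hsymm v w) hPmQm hdefPm hdefQm hadjLm hxmem hιmx hxιm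
      (by rw [hxrk]; omega) (by omega) (by omega)
      fun U' 𝔩' ι' P' Q' hbr𝔩' hirr𝔩' hι' hι'ι' hP' hQ' hfinP' hfinQ' hP'Q' hdefP' hdefQ' hadj𝔩' => ?_)
    rw [hxrk] at hfinP' hfinQ'
    exact UnitaryFourteenFifteen.eq_top_of_smul hbr𝔩' hirr𝔩' hι' hι'ι' hP' hQ' hfinP' (by omega) (s := fun x y : U' => s ((x : Um) : W) y) (fun x y z => by simp only [Submodule.coe_add, hadd]) (fun c x y => by simp only [Submodule.coe_smul, hsmul]) (fun x y => hsymm _ _) hP'Q' hdefP' hdefQ' hadj𝔩'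
  have hkillm15 : ∀ X ∈ 𝔊, Θ * X = X → X * Θ = -X → X * ι = ι * X → Module.finrank ℂ (Um.map X) ≠ 15 := by
    intro X hX hΘX hXΘ hXc h15
    obtain ⟨hxmem, hιmx, hxιm, hxrk⟩ := UnitaryLeviSetup.restrict_mem hcm hLm hιmapply X hX hΘX hXΘ hXc
    rw [h15] at hxrk
    refine hfullm_of (UnitaryDoubleLevi.eq_top_of_raise_of_core hbrLm hirrLm hιmmem hιmιm hPm hQm
      (s := fun v w : Um => s (v : W) w) (hsU Um) (fun v w => hsymm v w) hPmQm hdefPm hdefQm hadjLm hxmem hιmx hxιm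
      (by rw [hxrk]; omega) (by omega) (by omega)
      fun U' 𝔩' ι' P' Q' hbr𝔩' hirr𝔩' hι' hι'ι' hP' hQ' hfinP' hfinQ' hP'Q' hdefP' hdefQ' hadj𝔩' => ?_)
    rw [hxrk] at hfinP' hfinQ'
    exact UnitaryFourteenFifteen.eq_top_of_smul' hbr𝔩' hirr𝔩' hι' hι'ι' hP' hQ' hfinP' (by omega) (s := fun x y : U' => s ((x : Um) : W) y) (fun x y z => by simp only [Submodule.coe_add, hadd]) (fun c x y => by simp only [Submodule.coe_smul, hsmul]) (fun x y => hsymm _ _) hP'Q' hdefP' hdefQ' hadj𝔩'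
  have hfullp_of : Lp = ⊤ → False := by
    intro hLptop
    obtain ⟨T1, hιT1, hT1ι, hT1r⟩ := UnitaryRaisingSpace.exists_raise_finrank_range_eq hιpιp hPp hQp (k := 1)
      (by omega) (by omega)
    obtain ⟨X1, hX1, hΘX1, hX1Θ, hX1c, hX1Up⟩ := UnitaryLeviSetup.exists_lift hbr hΘ hΘΘ hcp hιΘ hLp hιpapply T1
      (by rw [hLptop]; exact Submodule.mem_top) hιT1 hT1ι
    rw [hT1r] at hX1Up
    obtain ⟨hs1, hi1, hi1', hj1, hj1'⟩ := hsplit X1 hΘX1 hX1Θ hX1c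
    have hrk1 := hS X1 hX1 hΘX1 hX1Θ
    have hd1 := hdich X1 hX1 hΘX1 hX1Θ hX1c
    rw [hs1] at hrk1
    rw [hX1Up] at hrk1 hd1
    have hk_hkillm14 := hkillm14 X1 hX1 hΘX1 hX1Θ hX1c
    omega
  have hprof0 : ∀ X ∈ 𝔊, Θ * X = X → X * Θ = -X → X * ι = ι * X →
      (Module.finrank ℂ (Up.map X) = 0 ∧ Module.finrank ℂ (Um.map X) = 0) ∨
        (Module.finrank ℂ (Up.map X) = 15 ∧ Module.finrank ℂ (Um.map X) = 0) := by
    intro X hX hΘX hXΘ hXc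
    obtain ⟨hs, hi, hi', hj, hj'⟩ := hsplit X hΘX hXΘ hXc
    have hkillm1' := hkillm1 X hX hΘX hXΘ hXc
    have hkillm2' := hkillm2 X hX hΘX hXΘ hXc
    have hkillm3' := hkillm3 X hX hΘX hXΘ hXc
    have hkillm4' := hkillm4 X hX hΘX hXΘ hXc
    have hkillm5' := hkillm5 X hX hΘX hXΘ hXc
    have hkillm6' := hkillm6 X hX hΘX hXΘ hXc
    have hkillm7' := hkillm7 X hX hΘX hXΘ hXc
    have hkillm8' := hkillm8 X hX hΘX hXΘ hXc
    have hkillm9' := hkillm9 X hX hΘX hXΘ hXc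
    have hkillm10' := hkillm10 X hX hΘX hXΘ hXc
    have hkillm11' := hkillm11 X hX hΘX hXΘ hXc
    have hkillm12' := hkillm12 X hX hΘX hXΘ hXc
    have hkillm13' := hkillm13 X hX hΘX hXΘ hXc
    have hkillm14' := hkillm14 X hX hΘX hXΘ hXc
    have hkillm15' := hkillm15 X hX hΘX hXΘ hXc
    have hrk := hS X hX hΘX hXΘ
    have hd := hdich X hX hΘX hXΘ hXc
    rw [hs] at hrk
    generalize Module.finrank ℂ ↥(Submodule.map X Um) = jj at *
    have hjle : jj ≤ 15 := by omega
    interval_cases jj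
    · rcases (show Module.finrank ℂ (Up.map X) = 0 ∨ Module.finrank ℂ (Up.map X) = 15 by omega) with h | h
      · exact Or.inl ⟨h, rfl⟩
      · exact Or.inr (⟨h, rfl⟩)
    · exact (hkillm1' rfl).elim
    · exact (hkillm2' rfl).elim
    · exact (hkillm3' rfl).elim
    · exact (hkillm4' rfl).elim
    · exact (hkillm5' rfl).elim
    · exact (hkillm6' rfl).elim
    · exact (hkillm7' rfl).elim
    · exact (hkillm8' rfl).elim
    · exact (hkillm9' rfl).elim
    · exact (hkillm10' rfl).elim
    · exact (hkillm11' rfl).elim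
    · exact (hkillm12' rfl).elim
    · exact (hkillm13' rfl).elim
    · exact (hkillm14' rfl).elim
    · exact (hkillm15' rfl).elim
  have hkillpF15 : ∀ X ∈ 𝔊, Θ * X = X → X * Θ = -X → X * ι = ι * X → Module.finrank ℂ (Up.map X) ≠ 15 := by
    intro X hX hΘX hXΘ hXc h15
    obtain ⟨hymem, hιpy, hyιp, hyrk⟩ := UnitaryLeviSetup.restrict_mem hcp hLp hιpapply X hX hΘX hXΘ hXc
    rw [h15] at hyrk
    refine UnitaryConstantRank.false_of_le_rank hbrLp hirrLp hιpmem hιpιp hPp hQp (s := fun v w : Up => s (v : W) w)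
      (hsU Up) (fun v w => hsymm v w) hPpQp hdefPp hdefQp hadjLp hymem hιpy hyιp
      (by rw [hyrk]; omega) (by rw [hyrk]; omega) fun A hA hιpA hAιp hAne => ?_
    obtain ⟨X', hX', hΘX', hX'Θ, hX'c, hX'Up⟩ :=
      UnitaryLeviSetup.exists_lift hbr hΘ hΘΘ hcp hιΘ hLp hιpapply A hA hιpA hAιp
    have hA0 : Module.finrank ℂ (LinearMap.range A) ≠ 0 := fun h =>
      hAne (LinearMap.range_eq_bot.1 (Submodule.finrank_eq_zero.1 h))
    have hp := hprof0 X' hX' hΘX' hX'Θ hX'c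
    rw [← hX'Up] at hA0
    rw [hyrk, ← hX'Up]
    omega
  have hprof : ∀ X ∈ 𝔊, Θ * X = X → X * Θ = -X → X * ι = ι * X →
      (Module.finrank ℂ (Up.map X) = 0 ∧ Module.finrank ℂ (Um.map X) = 0) := by
    intro X hX hΘX hXΘ hXc
    have hp := hprof0 X hX hΘX hXΘ hXc
    have hkillpF15' := hkillpF15 X hX hΘX hXΘ hXc
    omega
  obtain ⟨⟨p, hp⟩, hp0⟩ := Module.finrank_pos_iff_exists_ne_zero.1 (show 0 < Module.finrank ℂ PU by omega)
  obtain ⟨⟨q, hq⟩, hq0⟩ := Module.finrank_pos_iff_exists_ne_zero.1 (show 0 < Module.finrank ℂ QU by omega)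
  obtain ⟨X₀, hX₀, hΘX₀, hX₀Θ, hX₀c, c₀, hιc₀, -, hX₀c0⟩ :=
    UnitaryLeviFull.exists_raise_commute_apply_ne_zero hbr hirr hΘ hΘΘ hQ hιmem hιι hιΘ hUm hUp
      ⟨p, fun h => hp0 (Subtype.ext h), ((hPU p).1 hp).1, ((hPU p).1 hp).2⟩
      ⟨q, fun h => hq0 (Subtype.ext h), ((hQU q).1 hq).1, ((hQU q).1 hq).2⟩
  have hX₀i : Module.finrank ℂ (Up.map X₀) ≠ 0 := fun h0 => by
    have hmem : X₀ c₀ ∈ Up.map X₀ := Submodule.mem_map_of_mem ((hUp c₀).2 hιc₀)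
    rw [Submodule.finrank_eq_zero.1 h0, Submodule.mem_bot] at hmem
    exact hX₀c0 hmem
  have hp0 := hprof X₀ hX₀ hΘX₀ hX₀Θ hX₀c
  omega

/-- `(39 | 44)`, minimal rank `16`: after the Levi kills every profile has `i = 0` (profiles [(0, 0), (0, 16)]), against the non-vanishing lemma. [cite: Ribet1983, Thm. 3] [cite: Gordon1997, Thm. 6.3 (3)]
[cite: Deligne1982HodgeCycles, I §3 Prop. 3.4, 3.6] [cite: GoodmanWallachGTM255, §4.1.1] -/
theorem UnitaryThirtyNineFortyFour.no_minRank_16 [FiniteDimensional ℂ W] {𝔊 : Submodule ℂ (Module.End ℂ W)}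
    (hbr : ∀ Y ∈ 𝔊, ∀ Z ∈ 𝔊, Y * Z - Z * Y ∈ 𝔊)
    (hirr : ∀ U : Submodule ℂ W, (∀ A ∈ 𝔊, ∀ u ∈ U, A u ∈ U) → U = ⊥ ∨ U = ⊤)
    {Θ : Module.End ℂ W} (hΘ : Θ ∈ 𝔊) (hΘΘ : Θ * Θ = 1)
    {P Q : Submodule ℂ W} (hP : ∀ x, x ∈ P ↔ Θ x = x) (hQ : ∀ x, x ∈ Q ↔ Θ x = -x)
    (hP39 : Module.finrank ℂ P = 39) (hQ44 : Module.finrank ℂ Q = 44)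
    {s : W → W → ℂ} (hadd : ∀ x y z, s (x + y) z = s x z + s y z)
    (hsmul : ∀ (c : ℂ) (x y : W), s (c • x) y = c * s x y) (hsymm : ∀ x y, s y x = starRingEnd ℂ (s x y))
    (hPQ : ∀ p ∈ P, ∀ q ∈ Q, s p q = 0) (hdefP : ∀ p ∈ P, s p p = 0 → p = 0) (hdefQ : ∀ q ∈ Q, s q q = 0 → q = 0)
    (hadj : ∀ X ∈ 𝔊, ∃ Y ∈ 𝔊, ∀ x y, s (X x) y = s x (Y y))
    (hS : ∀ B' ∈ 𝔊, Θ * B' = B' → B' * Θ = -B' →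
      Module.finrank ℂ (LinearMap.range B') = 0 ∨ Module.finrank ℂ (LinearMap.range B') = 16 ∨ Module.finrank ℂ (LinearMap.range B') = 17 ∨ Module.finrank ℂ (LinearMap.range B') = 18 ∨ Module.finrank ℂ (LinearMap.range B') = 19 ∨ Module.finrank ℂ (LinearMap.range B') = 20 ∨ Module.finrank ℂ (LinearMap.range B') = 21 ∨ Module.finrank ℂ (LinearMap.range B') = 22 ∨ Module.finrank ℂ (LinearMap.range B') = 23 ∨ Module.finrank ℂ (LinearMap.range B') = 24 ∨ Module.finrank ℂ (LinearMap.range B') = 25 ∨ Module.finrank ℂ (LinearMap.range B') = 26 ∨ Module.finrank ℂ (LinearMap.range B') = 27 ∨ Module.finrank ℂ (LinearMap.range B') = 28 ∨ Module.finrank ℂ (LinearMap.range B') = 29 ∨ Module.finrank ℂ (LinearMap.range B') = 30 ∨ Module.finrank ℂ (LinearMap.range B') = 32 ∨ Module.finrank ℂ (LinearMap.range B') = 33 ∨ Module.finrank ℂ (LinearMap.range B') = 34 ∨ Module.finrank ℂ (LinearMap.range B') = 36 ∨ Module.finrank ℂ (LinearMap.range B') = 38)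
    {B : Module.End ℂ W} (hB : B ∈ 𝔊) (hΘB : Θ * B = B) (hBΘ : B * Θ = -B)
    (hr : Module.finrank ℂ (LinearMap.range B) = 16) : False := by
  classical
  have hsU : ∀ U : Submodule ℂ W, ∀ x y z : U, s ((x + y : U) : W) z = s (x : W) z + s (y : W) z :=
    fun U x y z => by simp only [Submodule.coe_add, hadd]
  have hsmU : ∀ U : Submodule ℂ W, ∀ (c : ℂ) (x y : U), s ((c • x : U) : W) y = c * s (x : W) y :=
    fun U c x y => by simp only [Submodule.coe_smul, hsmul]
  have hno1 : ∀ B' ∈ 𝔊, Θ * B' = B' → B' * Θ = -B' → Module.finrank ℂ (LinearMap.range B') ≠ 1 := by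
    intro B' hB' hΘB' hB'Θ h1
    rcases hS B' hB' hΘB' hB'Θ with h | h | h | h | h | h | h | h | h | h | h | h | h | h | h | h | h | h | h | h | h <;> omega
  have hmin : ∀ Y ∈ 𝔊, Θ * Y = Y → Y * Θ = -Y → Y ≠ 0 → 16 ≤ Module.finrank ℂ (LinearMap.range Y) := by
    intro Y hY hΘY hYΘ hY0
    have h0 : Module.finrank ℂ (LinearMap.range Y) ≠ 0 := fun h =>
      hY0 (LinearMap.range_eq_bot.1 (Submodule.finrank_eq_zero.1 h))
    rcases hS Y hY hΘY hYΘ with h | h | h | h | h | h | h | h | h | h | h | h | h | h | h | h | h | h | h | h | h <;> omega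
  have hmin' : ∀ Z ∈ 𝔊, Θ * Z = Z → Z * Θ = -Z → Z ≠ 0 → Module.finrank ℂ (LinearMap.range B) ≤ Module.finrank ℂ (LinearMap.range Z) := by
    rw [hr]; exact hmin
  obtain ⟨ι, Um, Up, PU, QU, Lm, ιm, Pm, Qm, Lp, ιp, Pp, Qp, hιmem, hιι, hιΘ, hιs, hUm, hUp, hfinUm, hfinUp,
    hPM, hQM, hPU, hQU, hrangeP, hPUP, hQUQ, hfinQM, hfinPU, hfinQU, hLm, hLp,
    hιmapply, hPmmem, hQmmem, hbrLm, hirrLm, hιmmem, hιmιm, hPm, hQm, hfinPm, hfinQm, hPmQm, hdefPm, hdefQm, hadjLm,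
    hιpapply, hPpmem, hQpmem, hbrLp, hirrLp, hιpmem, hιpιp, hPp, hQp, hfinPp, hfinQp, hPpQp, hdefPp, hdefQp, hadjLp,
    hsplit⟩ :=
    UnitaryLeviSetup.exists_levi_pair hbr hirr hΘ hΘΘ hP hQ hadd hsymm hPQ hdefP hdefQ hadj hB hΘB hBΘ
  have hdich : ∀ X ∈ 𝔊, Θ * X = X → X * Θ = -X → X * ι = ι * X →
      Module.finrank ℂ (Up.map X) + Module.finrank ℂ (Um.map X) ≤ Module.finrank ℂ (LinearMap.range B) ∨
        (16 ≤ Module.finrank ℂ (Up.map X) ∧ 16 ≤ Module.finrank ℂ (Um.map X)) := fun X hX hΘX hXΘ hXc =>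
    UnitaryLeviSetup.profile_dichotomy hbr hΘΘ hP hQ hadd hsymm hPQ hdefP hdefQ hadj hmin hB hΘB hBΘ hιι hιΘ hιs hUm hUp
      hPM hQM hQU hfinQU hrangeP hX hΘX hXΘ hXc
  have hfinQU' := hfinQU
  rw [hr] at hfinQM hfinPU hfinQU hfinPm hfinQm hfinPp hfinQp hsplit hdich
  rw [hQ44] at hfinQM hfinQm hfinUm
  rw [hP39] at hfinPU hfinPp hfinUp
  have hcm : ∀ Z : Module.End ℂ W, Z * ι = ι * Z → ∀ x ∈ Um, Z x ∈ Um := fun Z hZ x hx =>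
    (hUm _).2 (by rw [← Module.End.mul_apply, ← hZ, Module.End.mul_apply, (hUm x).1 hx, map_neg])
  have hcp : ∀ Z : Module.End ℂ W, Z * ι = ι * Z → ∀ x ∈ Up, Z x ∈ Up := fun Z hZ x hx =>
    (hUp _).2 (by rw [← Module.End.mul_apply, ← hZ, Module.End.mul_apply, (hUp x).1 hx])
  have hfullm_of : Lm = ⊤ → False := fun h =>
    UnitaryLeviSetup.false_of_full_larger hbr hΘΘ hno1 hιι hιΘ hUm hUp (by omega) (by omega) hPM hQM (by omega)
      (by omega) hLm h
  have hkillm1 : ∀ X ∈ 𝔊, Θ * X = X → X * Θ = -X → X * ι = ι * X → Module.finrank ℂ (Um.map X) ≠ 1 := by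
    intro X hX hΘX hXΘ hXc h1
    obtain ⟨hxmem, hιmx, hxιm, hxrk⟩ := UnitaryLeviSetup.restrict_mem hcm hLm hιmapply X hX hΘX hXΘ hXc
    rw [h1] at hxrk
    exact hfullm_of (UnitaryRankOneRaise.eq_top_of_rankOne_raise hbrLm hirrLm hιmmem hιmιm hPm hQm
      (s := fun v w : Um => s (v : W) w) (hsU Um) (fun v w => hsymm v w) hPmQm hdefPm hdefQm hadjLm hxmem hιmx hxιm
      hxrk (by omega) (by omega) (by omega))
  have hkillm3 : ∀ X ∈ 𝔊, Θ * X = X → X * Θ = -X → X * ι = ι * X → Module.finrank ℂ (Um.map X) ≠ 3 := by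
    intro X hX hΘX hXΘ hXc h3
    obtain ⟨hxmem, hιmx, hxιm, hxrk⟩ := UnitaryLeviSetup.restrict_mem hcm hLm hιmapply X hX hΘX hXΘ hXc
    rw [h3] at hxrk
    refine hfullm_of (UnitaryDoubleLevi.eq_top_of_raise_of_core hbrLm hirrLm hιmmem hιmιm hPm hQm
      (s := fun v w : Um => s (v : W) w) (hsU Um) (fun v w => hsymm v w) hPmQm hdefPm hdefQm hadjLm hxmem hιmx hxιm
      (by rw [hxrk]; omega) (by omega) (by omega)
      fun U' 𝔩' ι' P' Q' hbr𝔩' hirr𝔩' hι' hι'ι' hP' hQ' hfinP' hfinQ' hP'Q' hdefP' hdefQ' hadj𝔩' => ?_)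
    rw [hxrk] at hfinP' hfinQ'
    exact UnitaryThreeCoprime.eq_top hbr𝔩' hirr𝔩' hι' hι'ι' hP' hQ' hfinP' (by omega) (s := fun x y : U' => s ((x : Um) : W) y) (fun x y z => by simp only [Submodule.coe_add, hadd]) (fun x y => hsymm _ _) hP'Q' hdefP' hdefQ' hadj𝔩'
  have hkillm5 : ∀ X ∈ 𝔊, Θ * X = X → X * Θ = -X → X * ι = ι * X → Module.finrank ℂ (Um.map X) ≠ 5 := by
    intro X hX hΘX hXΘ hXc h5
    obtain ⟨hxmem, hιmx, hxιm, hxrk⟩ := UnitaryLeviSetup.restrict_mem hcm hLm hιmapply X hX hΘX hXΘ hXc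
    rw [h5] at hxrk
    refine hfullm_of (UnitaryDoubleLevi.eq_top_of_raise_of_core hbrLm hirrLm hιmmem hιmιm hPm hQm
      (s := fun v w : Um => s (v : W) w) (hsU Um) (fun v w => hsymm v w) hPmQm hdefPm hdefQm hadjLm hxmem hιmx hxιm
      (by rw [hxrk]; omega) (by omega) (by omega)
      fun U' 𝔩' ι' P' Q' hbr𝔩' hirr𝔩' hι' hι'ι' hP' hQ' hfinP' hfinQ' hP'Q' hdefP' hdefQ' hadj𝔩' => ?_)
    rw [hxrk] at hfinP' hfinQ'
    exact UnitaryFive.eq_top_of_smul hbr𝔩' hirr𝔩' hι' hι'ι' hP' hQ' hfinP' (by omega) (s := fun x y : U' => s ((x : Um) : W) y) (fun x y z => by simp only [Submodule.coe_add, hadd]) (fun c x y => by simp only [Submodule.coe_smul, hsmul]) (fun x y => hsymm _ _) hP'Q' hdefP' hdefQ' hadj𝔩'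
  have hkillm11 : ∀ X ∈ 𝔊, Θ * X = X → X * Θ = -X → X * ι = ι * X → Module.finrank ℂ (Um.map X) ≠ 11 := by
    intro X hX hΘX hXΘ hXc h11
    obtain ⟨hxmem, hιmx, hxιm, hxrk⟩ := UnitaryLeviSetup.restrict_mem hcm hLm hιmapply X hX hΘX hXΘ hXc
    rw [h11] at hxrk
    refine hfullm_of (UnitaryDoubleLevi.eq_top_of_raise_of_core hbrLm hirrLm hιmmem hιmιm hPm hQm
      (s := fun v w : Um => s (v : W) w) (hsU Um) (fun v w => hsymm v w) hPmQm hdefPm hdefQm hadjLm hxmem hιmx hxιm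
      (by rw [hxrk]; omega) (by omega) (by omega)
      fun U' 𝔩' ι' P' Q' hbr𝔩' hirr𝔩' hι' hι'ι' hP' hQ' hfinP' hfinQ' hP'Q' hdefP' hdefQ' hadj𝔩' => ?_)
    rw [hxrk] at hfinP' hfinQ'
    exact UnitaryEleven.eq_top_of_smul hbr𝔩' hirr𝔩' hι' hι'ι' hP' hQ' hfinP' (by omega) (s := fun x y : U' => s ((x : Um) : W) y) (fun x y z => by simp only [Submodule.coe_add, hadd]) (fun c x y => by simp only [Submodule.coe_smul, hsmul]) (fun x y => hsymm _ _) hP'Q' hdefP' hdefQ' hadj𝔩'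
  have hkillm13 : ∀ X ∈ 𝔊, Θ * X = X → X * Θ = -X → X * ι = ι * X → Module.finrank ℂ (Um.map X) ≠ 13 := by
    intro X hX hΘX hXΘ hXc h13
    obtain ⟨hxmem, hιmx, hxιm, hxrk⟩ := UnitaryLeviSetup.restrict_mem hcm hLm hιmapply X hX hΘX hXΘ hXc
    rw [h13] at hxrk
    refine hfullm_of (UnitaryDoubleLevi.eq_top_of_raise_of_core hbrLm hirrLm hιmmem hιmιm hPm hQm
      (s := fun v w : Um => s (v : W) w) (hsU Um) (fun v w => hsymm v w) hPmQm hdefPm hdefQm hadjLm hxmem hιmx hxιm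
      (by rw [hxrk]; omega) (by omega) (by omega)
      fun U' 𝔩' ι' P' Q' hbr𝔩' hirr𝔩' hι' hι'ι' hP' hQ' hfinP' hfinQ' hP'Q' hdefP' hdefQ' hadj𝔩' => ?_)
    rw [hxrk] at hfinP' hfinQ'
    exact UnitaryThirteen.eq_top_of_smul hbr𝔩' hirr𝔩' hι' hι'ι' hP' hQ' hfinP' (by omega) (s := fun x y : U' => s ((x : Um) : W) y) (fun x y z => by simp only [Submodule.coe_add, hadd]) (fun c x y => by simp only [Submodule.coe_smul, hsmul]) (fun x y => hsymm _ _) hP'Q' hdefP' hdefQ' hadj𝔩'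
  have hkillm15 : ∀ X ∈ 𝔊, Θ * X = X → X * Θ = -X → X * ι = ι * X → Module.finrank ℂ (Um.map X) ≠ 15 := by
    intro X hX hΘX hXΘ hXc h15
    obtain ⟨hxmem, hιmx, hxιm, hxrk⟩ := UnitaryLeviSetup.restrict_mem hcm hLm hιmapply X hX hΘX hXΘ hXc
    rw [h15] at hxrk
    refine hfullm_of (UnitaryDoubleLevi.eq_top_of_raise_of_core hbrLm hirrLm hιmmem hιmιm hPm hQm
      (s := fun v w : Um => s (v : W) w) (hsU Um) (fun v w => hsymm v w) hPmQm hdefPm hdefQm hadjLm hxmem hιmx hxιm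
      (by rw [hxrk]; omega) (by omega) (by omega)
      fun U' 𝔩' ι' P' Q' hbr𝔩' hirr𝔩' hι' hι'ι' hP' hQ' hfinP' hfinQ' hP'Q' hdefP' hdefQ' hadj𝔩' => ?_)
    rw [hxrk] at hfinP' hfinQ'
    exact UnitaryThirteen.eq_top_of_smul' hbr𝔩' hirr𝔩' hι' hι'ι' hP' hQ' (by omega) (by omega) (s := fun x y : U' => s ((x : Um) : W) y) (fun x y z => by simp only [Submodule.coe_add, hadd]) (fun c x y => by simp only [Submodule.coe_smul, hsmul]) (fun x y => hsymm _ _) hP'Q' hdefP' hdefQ' hadj𝔩'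
  have hfullp_of : Lp = ⊤ → False := by
    intro hLptop
    obtain ⟨T1, hιT1, hT1ι, hT1r⟩ := UnitaryRaisingSpace.exists_raise_finrank_range_eq hιpιp hPp hQp (k := 1)
      (by omega) (by omega)
    obtain ⟨X1, hX1, hΘX1, hX1Θ, hX1c, hX1Up⟩ := UnitaryLeviSetup.exists_lift hbr hΘ hΘΘ hcp hιΘ hLp hιpapply T1
      (by rw [hLptop]; exact Submodule.mem_top) hιT1 hT1ι
    rw [hT1r] at hX1Up
    obtain ⟨hs1, hi1, hi1', hj1, hj1'⟩ := hsplit X1 hΘX1 hX1Θ hX1c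
    have hrk1 := hS X1 hX1 hΘX1 hX1Θ
    have hd1 := hdich X1 hX1 hΘX1 hX1Θ hX1c
    rw [hs1] at hrk1
    rw [hX1Up] at hrk1 hd1
    have hk_hkillm15 := hkillm15 X1 hX1 hΘX1 hX1Θ hX1c
    omega
  have hkillp2 : ∀ X ∈ 𝔊, Θ * X = X → X * Θ = -X → X * ι = ι * X → Module.finrank ℂ (Up.map X) ≠ 2 := by
    intro X hX hΘX hXΘ hXc h2
    obtain ⟨hymem, hιpy, hyιp, hyrk⟩ := UnitaryLeviSetup.restrict_mem hcp hLp hιpapply X hX hΘX hXΘ hXc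
    rw [h2] at hyrk
    refine hfullp_of (UnitaryDoubleLevi.eq_top_of_raise_of_core' hbrLp hirrLp hιpmem hιpιp hPp hQp
      (s := fun v w : Up => s (v : W) w) (hsU Up) (fun v w => hsymm v w) hPpQp hdefPp hdefQp hadjLp hymem hιpy hyιp
      (by rw [hyrk]; omega) (by omega) (by omega)
      fun U' 𝔩' ι' P' Q' hbr𝔩' hirr𝔩' hι' hι'ι' hP' hQ' hfinP' hfinQ' hP'Q' hdefP' hdefQ' hadj𝔩' => ?_)
    rw [hyrk] at hfinP' hfinQ'
    exact UnitaryTwoOdd.eq_top hbr𝔩' hirr𝔩' hι' hι'ι' hP' hQ' hfinP' ⟨10, by omega⟩ (s := fun x y : U' => s ((x : Up) : W) y) (fun x y z => by simp only [Submodule.coe_add, hadd]) (fun x y => hsymm _ _) hP'Q' hdefP' hdefQ' hadj𝔩'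
  have hkillp4 : ∀ X ∈ 𝔊, Θ * X = X → X * Θ = -X → X * ι = ι * X → Module.finrank ℂ (Up.map X) ≠ 4 := by
    intro X hX hΘX hXΘ hXc h4
    obtain ⟨hymem, hιpy, hyιp, hyrk⟩ := UnitaryLeviSetup.restrict_mem hcp hLp hιpapply X hX hΘX hXΘ hXc
    rw [h4] at hyrk
    refine hfullp_of (UnitaryDoubleLevi.eq_top_of_raise_of_core' hbrLp hirrLp hιpmem hιpιp hPp hQp
      (s := fun v w : Up => s (v : W) w) (hsU Up) (fun v w => hsymm v w) hPpQp hdefPp hdefQp hadjLp hymem hιpy hyιp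
      (by rw [hyrk]; omega) (by omega) (by omega)
      fun U' 𝔩' ι' P' Q' hbr𝔩' hirr𝔩' hι' hι'ι' hP' hQ' hfinP' hfinQ' hP'Q' hdefP' hdefQ' hadj𝔩' => ?_)
    rw [hyrk] at hfinP' hfinQ'
    exact UnitaryFourOdd.eq_top hbr𝔩' hirr𝔩' hι' hι'ι' hP' hQ' hfinP' ⟨9, by omega⟩ (s := fun x y : U' => s ((x : Up) : W) y) (fun x y z => by simp only [Submodule.coe_add, hadd]) (fun x y => hsymm _ _) hP'Q' hdefP' hdefQ' hadj𝔩'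
  have hkillp6 : ∀ X ∈ 𝔊, Θ * X = X → X * Θ = -X → X * ι = ι * X → Module.finrank ℂ (Up.map X) ≠ 6 := by
    intro X hX hΘX hXΘ hXc h6
    obtain ⟨hymem, hιpy, hyιp, hyrk⟩ := UnitaryLeviSetup.restrict_mem hcp hLp hιpapply X hX hΘX hXΘ hXc
    rw [h6] at hyrk
    refine hfullp_of (UnitaryDoubleLevi.eq_top_of_raise_of_core' hbrLp hirrLp hιpmem hιpιp hPp hQp
      (s := fun v w : Up => s (v : W) w) (hsU Up) (fun v w => hsymm v w) hPpQp hdefPp hdefQp hadjLp hymem hιpy hyιp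
      (by rw [hyrk]; omega) (by omega) (by omega)
      fun U' 𝔩' ι' P' Q' hbr𝔩' hirr𝔩' hι' hι'ι' hP' hQ' hfinP' hfinQ' hP'Q' hdefP' hdefQ' hadj𝔩' => ?_)
    rw [hyrk] at hfinP' hfinQ'
    exact UnitarySix.eq_top_of_smul hbr𝔩' hirr𝔩' hι' hι'ι' hP' hQ' hfinP' ⟨8, by omega⟩ (by omega) (s := fun x y : U' => s ((x : Up) : W) y) (fun x y z => by simp only [Submodule.coe_add, hadd]) (fun c x y => by simp only [Submodule.coe_smul, hsmul]) (fun x y => hsymm _ _) hP'Q' hdefP' hdefQ' hadj𝔩'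
  have hkillp7 : ∀ X ∈ 𝔊, Θ * X = X → X * Θ = -X → X * ι = ι * X → Module.finrank ℂ (Up.map X) ≠ 7 := by
    intro X hX hΘX hXΘ hXc h7
    obtain ⟨hymem, hιpy, hyιp, hyrk⟩ := UnitaryLeviSetup.restrict_mem hcp hLp hιpapply X hX hΘX hXΘ hXc
    rw [h7] at hyrk
    refine hfullp_of (UnitaryDoubleLevi.eq_top_of_raise_of_core' hbrLp hirrLp hιpmem hιpιp hPp hQp
      (s := fun v w : Up => s (v : W) w) (hsU Up) (fun v w => hsymm v w) hPpQp hdefPp hdefQp hadjLp hymem hιpy hyιp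
      (by rw [hyrk]; omega) (by omega) (by omega)
      fun U' 𝔩' ι' P' Q' hbr𝔩' hirr𝔩' hι' hι'ι' hP' hQ' hfinP' hfinQ' hP'Q' hdefP' hdefQ' hadj𝔩' => ?_)
    rw [hyrk] at hfinP' hfinQ'
    exact UnitarySeven.eq_top_of_smul hbr𝔩' hirr𝔩' hι' hι'ι' hP' hQ' hfinP' (by omega) (s := fun x y : U' => s ((x : Up) : W) y) (fun x y z => by simp only [Submodule.coe_add, hadd]) (fun c x y => by simp only [Submodule.coe_smul, hsmul]) (fun x y => hsymm _ _) hP'Q' hdefP' hdefQ' hadj𝔩'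
  have hkillp8 : ∀ X ∈ 𝔊, Θ * X = X → X * Θ = -X → X * ι = ι * X → Module.finrank ℂ (Up.map X) ≠ 8 := by
    intro X hX hΘX hXΘ hXc h8
    obtain ⟨hymem, hιpy, hyιp, hyrk⟩ := UnitaryLeviSetup.restrict_mem hcp hLp hιpapply X hX hΘX hXΘ hXc
    rw [h8] at hyrk
    refine hfullp_of (UnitaryDoubleLevi.eq_top_of_raise_of_core' hbrLp hirrLp hιpmem hιpιp hPp hQp
      (s := fun v w : Up => s (v : W) w) (hsU Up) (fun v w => hsymm v w) hPpQp hdefPp hdefQp hadjLp hymem hιpy hyιp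
      (by rw [hyrk]; omega) (by omega) (by omega)
      fun U' 𝔩' ι' P' Q' hbr𝔩' hirr𝔩' hι' hι'ι' hP' hQ' hfinP' hfinQ' hP'Q' hdefP' hdefQ' hadj𝔩' => ?_)
    rw [hyrk] at hfinP' hfinQ'
    exact UnitaryEightFifteen.eq_top_of_smul hbr𝔩' hirr𝔩' hι' hι'ι' hP' hQ' hfinP' (by omega) (s := fun x y : U' => s ((x : Up) : W) y) (fun x y z => by simp only [Submodule.coe_add, hadd]) (fun c x y => by simp only [Submodule.coe_smul, hsmul]) (fun x y => hsymm _ _) hP'Q' hdefP' hdefQ' hadj𝔩'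
  have hkillp9 : ∀ X ∈ 𝔊, Θ * X = X → X * Θ = -X → X * ι = ι * X → Module.finrank ℂ (Up.map X) ≠ 9 := by
    intro X hX hΘX hXΘ hXc h9
    obtain ⟨hymem, hιpy, hyιp, hyrk⟩ := UnitaryLeviSetup.restrict_mem hcp hLp hιpapply X hX hΘX hXΘ hXc
    rw [h9] at hyrk
    refine hfullp_of (UnitaryDoubleLevi.eq_top_of_raise_of_core' hbrLp hirrLp hιpmem hιpιp hPp hQp
      (s := fun v w : Up => s (v : W) w) (hsU Up) (fun v w => hsymm v w) hPpQp hdefPp hdefQp hadjLp hymem hιpy hyιp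
      (by rw [hyrk]; omega) (by omega) (by omega)
      fun U' 𝔩' ι' P' Q' hbr𝔩' hirr𝔩' hι' hι'ι' hP' hQ' hfinP' hfinQ' hP'Q' hdefP' hdefQ' hadj𝔩' => ?_)
    rw [hyrk] at hfinP' hfinQ'
    exact UnitaryNineFourteen.eq_top_of_smul hbr𝔩' hirr𝔩' hι' hι'ι' hP' hQ' hfinP' (by omega) (s := fun x y : U' => s ((x : Up) : W) y) (fun x y z => by simp only [Submodule.coe_add, hadd]) (fun c x y => by simp only [Submodule.coe_smul, hsmul]) (fun x y => hsymm _ _) hP'Q' hdefP' hdefQ' hadj𝔩'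
  have hkillp10 : ∀ X ∈ 𝔊, Θ * X = X → X * Θ = -X → X * ι = ι * X → Module.finrank ℂ (Up.map X) ≠ 10 := by
    intro X hX hΘX hXΘ hXc h10
    obtain ⟨hymem, hιpy, hyιp, hyrk⟩ := UnitaryLeviSetup.restrict_mem hcp hLp hιpapply X hX hΘX hXΘ hXc
    rw [h10] at hyrk
    refine hfullp_of (UnitaryDoubleLevi.eq_top_of_raise_of_core' hbrLp hirrLp hιpmem hιpιp hPp hQp
      (s := fun v w : Up => s (v : W) w) (hsU Up) (fun v w => hsymm v w) hPpQp hdefPp hdefQp hadjLp hymem hιpy hyιp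
      (by rw [hyrk]; omega) (by omega) (by omega)
      fun U' 𝔩' ι' P' Q' hbr𝔩' hirr𝔩' hι' hι'ι' hP' hQ' hfinP' hfinQ' hP'Q' hdefP' hdefQ' hadj𝔩' => ?_)
    rw [hyrk] at hfinP' hfinQ'
    exact UnitaryThirteen.eq_top_of_smul' hbr𝔩' hirr𝔩' hι' hι'ι' hP' hQ' (by omega) (by omega) (s := fun x y : U' => s ((x : Up) : W) y) (fun x y z => by simp only [Submodule.coe_add, hadd]) (fun c x y => by simp only [Submodule.coe_smul, hsmul]) (fun x y => hsymm _ _) hP'Q' hdefP' hdefQ' hadj𝔩'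
  have hkillp12 : ∀ X ∈ 𝔊, Θ * X = X → X * Θ = -X → X * ι = ι * X → Module.finrank ℂ (Up.map X) ≠ 12 := by
    intro X hX hΘX hXΘ hXc h12
    obtain ⟨hymem, hιpy, hyιp, hyrk⟩ := UnitaryLeviSetup.restrict_mem hcp hLp hιpapply X hX hΘX hXΘ hXc
    rw [h12] at hyrk
    refine hfullp_of (UnitaryDoubleLevi.eq_top_of_raise_of_core' hbrLp hirrLp hιpmem hιpιp hPp hQp
      (s := fun v w : Up => s (v : W) w) (hsU Up) (fun v w => hsymm v w) hPpQp hdefPp hdefQp hadjLp hymem hιpy hyιp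
      (by rw [hyrk]; omega) (by omega) (by omega)
      fun U' 𝔩' ι' P' Q' hbr𝔩' hirr𝔩' hι' hι'ι' hP' hQ' hfinP' hfinQ' hP'Q' hdefP' hdefQ' hadj𝔩' => ?_)
    rw [hyrk] at hfinP' hfinQ'
    exact UnitaryEleven.eq_top_of_smul' hbr𝔩' hirr𝔩' hι' hι'ι' hP' hQ' (by omega) (by omega) (s := fun x y : U' => s ((x : Up) : W) y) (fun x y z => by simp only [Submodule.coe_add, hadd]) (fun c x y => by simp only [Submodule.coe_smul, hsmul]) (fun x y => hsymm _ _) hP'Q' hdefP' hdefQ' hadj𝔩'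
  have hkillp14 : ∀ X ∈ 𝔊, Θ * X = X → X * Θ = -X → X * ι = ι * X → Module.finrank ℂ (Up.map X) ≠ 14 := by
    intro X hX hΘX hXΘ hXc h14
    obtain ⟨hymem, hιpy, hyιp, hyrk⟩ := UnitaryLeviSetup.restrict_mem hcp hLp hιpapply X hX hΘX hXΘ hXc
    rw [h14] at hyrk
    refine hfullp_of (UnitaryDoubleLevi.eq_top_of_raise_of_core' hbrLp hirrLp hιpmem hιpιp hPp hQp
      (s := fun v w : Up => s (v : W) w) (hsU Up) (fun v w => hsymm v w) hPpQp hdefPp hdefQp hadjLp hymem hιpy hyιp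
      (by rw [hyrk]; omega) (by omega) (by omega)
      fun U' 𝔩' ι' P' Q' hbr𝔩' hirr𝔩' hι' hι'ι' hP' hQ' hfinP' hfinQ' hP'Q' hdefP' hdefQ' hadj𝔩' => ?_)
    rw [hyrk] at hfinP' hfinQ'
    exact UnitaryNineFourteen.eq_top_of_smul' hbr𝔩' hirr𝔩' hι' hι'ι' hP' hQ' hfinP' (by omega) (s := fun x y : U' => s ((x : Up) : W) y) (fun x y z => by simp only [Submodule.coe_add, hadd]) (fun c x y => by simp only [Submodule.coe_smul, hsmul]) (fun x y => hsymm _ _) hP'Q' hdefP' hdefQ' hadj𝔩'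
  have hkillp16 : ∀ X ∈ 𝔊, Θ * X = X → X * Θ = -X → X * ι = ι * X → Module.finrank ℂ (Up.map X) ≠ 16 := by
    intro X hX hΘX hXΘ hXc h16
    obtain ⟨hymem, hιpy, hyιp, hyrk⟩ := UnitaryLeviSetup.restrict_mem hcp hLp hιpapply X hX hΘX hXΘ hXc
    rw [h16] at hyrk
    refine hfullp_of (UnitaryDoubleLevi.eq_top_of_raise_of_core' hbrLp hirrLp hιpmem hιpιp hPp hQp
      (s := fun v w : Up => s (v : W) w) (hsU Up) (fun v w => hsymm v w) hPpQp hdefPp hdefQp hadjLp hymem hιpy hyιp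
      (by rw [hyrk]; omega) (by omega) (by omega)
      fun U' 𝔩' ι' P' Q' hbr𝔩' hirr𝔩' hι' hι'ι' hP' hQ' hfinP' hfinQ' hP'Q' hdefP' hdefQ' hadj𝔩' => ?_)
    rw [hyrk] at hfinP' hfinQ'
    exact UnitarySeven.eq_top_of_smul' hbr𝔩' hirr𝔩' hι' hι'ι' hP' hQ' (by omega) (by omega) (s := fun x y : U' => s ((x : Up) : W) y) (fun x y z => by simp only [Submodule.coe_add, hadd]) (fun c x y => by simp only [Submodule.coe_smul, hsmul]) (fun x y => hsymm _ _) hP'Q' hdefP' hdefQ' hadj𝔩'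
  have hprof : ∀ X ∈ 𝔊, Θ * X = X → X * Θ = -X → X * ι = ι * X →
      (Module.finrank ℂ (Up.map X) = 0 ∧ Module.finrank ℂ (Um.map X) = 0) ∨
        (Module.finrank ℂ (Up.map X) = 0 ∧ Module.finrank ℂ (Um.map X) = 16) := by
    intro X hX hΘX hXΘ hXc
    obtain ⟨hs, hi, hi', hj, hj'⟩ := hsplit X hΘX hXΘ hXc
    have hkillm1' := hkillm1 X hX hΘX hXΘ hXc
    have hkillm3' := hkillm3 X hX hΘX hXΘ hXc
    have hkillm5' := hkillm5 X hX hΘX hXΘ hXc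
    have hkillm11' := hkillm11 X hX hΘX hXΘ hXc
    have hkillm13' := hkillm13 X hX hΘX hXΘ hXc
    have hkillm15' := hkillm15 X hX hΘX hXΘ hXc
    have hkillp2' := hkillp2 X hX hΘX hXΘ hXc
    have hkillp4' := hkillp4 X hX hΘX hXΘ hXc
    have hkillp6' := hkillp6 X hX hΘX hXΘ hXc
    have hkillp7' := hkillp7 X hX hΘX hXΘ hXc
    have hkillp8' := hkillp8 X hX hΘX hXΘ hXc
    have hkillp9' := hkillp9 X hX hΘX hXΘ hXc
    have hkillp10' := hkillp10 X hX hΘX hXΘ hXc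
    have hkillp12' := hkillp12 X hX hΘX hXΘ hXc
    have hkillp14' := hkillp14 X hX hΘX hXΘ hXc
    have hkillp16' := hkillp16 X hX hΘX hXΘ hXc
    have hrk := hS X hX hΘX hXΘ
    have hd := hdich X hX hΘX hXΘ hXc
    rw [hs] at hrk
    generalize Module.finrank ℂ ↥(Submodule.map X Um) = jj at *
    have hjle : jj ≤ 16 := by omega
    interval_cases jj
    · exact Or.inl ⟨by omega, rfl⟩
    · exact (hkillm1' rfl).elim
    · exfalso; omega
    · exact (hkillm3' rfl).elim
    · exfalso; omega
    · exact (hkillm5' rfl).elim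
    · exfalso; omega
    · exfalso; omega
    · exfalso; omega
    · exfalso; omega
    · exfalso; omega
    · exact (hkillm11' rfl).elim
    · exfalso; omega
    · exact (hkillm13' rfl).elim
    · exfalso; omega
    · exact (hkillm15' rfl).elim
    · exact Or.inr (⟨by omega, rfl⟩)
  obtain ⟨⟨p, hp⟩, hp0⟩ := Module.finrank_pos_iff_exists_ne_zero.1 (show 0 < Module.finrank ℂ PU by omega)
  obtain ⟨⟨q, hq⟩, hq0⟩ := Module.finrank_pos_iff_exists_ne_zero.1 (show 0 < Module.finrank ℂ QU by omega)
  obtain ⟨X₀, hX₀, hΘX₀, hX₀Θ, hX₀c, c₀, hιc₀, -, hX₀c0⟩ :=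
    UnitaryLeviFull.exists_raise_commute_apply_ne_zero hbr hirr hΘ hΘΘ hQ hιmem hιι hιΘ hUm hUp
      ⟨p, fun h => hp0 (Subtype.ext h), ((hPU p).1 hp).1, ((hPU p).1 hp).2⟩
      ⟨q, fun h => hq0 (Subtype.ext h), ((hQU q).1 hq).1, ((hQU q).1 hq).2⟩
  have hX₀i : Module.finrank ℂ (Up.map X₀) ≠ 0 := fun h0 => by
    have hmem : X₀ c₀ ∈ Up.map X₀ := Submodule.mem_map_of_mem ((hUp c₀).2 hιc₀)
    rw [Submodule.finrank_eq_zero.1 h0, Submodule.mem_bot] at hmem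
    exact hX₀c0 hmem
  have hp0 := hprof X₀ hX₀ hΘX₀ hX₀Θ hX₀c
  omega


end HodgeStructure

end Literature.AlgebraicGeometry.Motives

end
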